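import Literature.NumberTheory.Transcendental.BakerQuantCore
import HarnessLib
import Literature.NumberTheory.Transcendental.BakerLinearFormsQuantitative

/-!
# Baker 1975, Ch. 3, Theorem 3.1 — the numerical verification and the proof
# (`baker1975_thm_3_1_holds`)

The discharge of the named fact `Literature.NumberTheory.Transcendental.baker1975_thm_3_1`.
This module consists of four consecutive parts, each with its own header below:
**(A) Numerics I** — every factor of the estimates is `exp(h · K · U · log s)` with explicit
constants `K` of the set-up; **(B) Numerics II** — the Hermite constant (the factorial cancels
`log h`), the units `U_J`, `U_F`, `U_θ`, the key inequality; **(C) Numerics III** — the thresholds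
`Setup.Good`, the exponent `Cexp`, `Data.numerics_of_good`; **(D) Proof** — §4's induction on the
number of logarithms in the language of the coefficient field and the public statement
`baker1975_thm_3_1_holds`. Everything here is proved; the only definitions are bookkeeping
(constants, units, thresholds, the predicates `HB`, `LB`, the set-up `stepSetup`).

## References

* A. Baker, *Transcendental Number Theory*, Cambridge Univ. Press 1975, Ch. 3, Thm 3.1, §§3–4
  (pp. 32–38). [BakerTNT1975]
-/

/-!
# Baker 1975, Ch. 3 — numerical estimates I: every factor is `exp(h · K · U · log s)`

Support for the proof of Theorem 3.1 of A. Baker, *Transcendental Number Theory* (1975), Ch. 3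
(`Literature.NumberTheory.Transcendental.baker1975_thm_3_1`); sequel to `BakerQuantCore.lean`.

Baker's constants `c, c₁, c₂, …` "depend only on `n, d, A` and the given determinations of the
logarithms" and every estimate of §3 has the shape `c^{hk + L|z|}`: exponential in `h` with an
exponent polynomial in the (constant) parameters. This file makes that explicit for the parameters
of `BakerQuantParams` at a base `s`: for `#Idx`, the Siegel bound `Umax` (hence `P = Data.Pb`), the
conjugate bound `gKB`, the denominator bound `denB`, the growth bound `growthB` and the error
`errB` we prove bounds `≤ exp(h · U · K · log s)` where `U` is a "unit" dominating the parameters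
involved (`k ≤ 2U`, `L X ≤ U`, …) and `K` is an explicit real constant of the set-up
(`Setup.K₁`, `Setup.KU`, `Setup.KP`, `Setup.KG`, `Setup.KD`, `Setup.Kgr`, `Setup.KE`, …).
The decisive comparisons (Baker's "plainly inconsistent if `k` is sufficiently large") are made in
the sequels.

Everything here is proved.

## References

* A. Baker, *Transcendental Number Theory*, Cambridge Univ. Press 1975, Ch. 3 §3 (pp. 32–36).
  [BakerTNT1975]
-/

noncomputable section

open Complex Finset Polynomial NumberField Real

namespace Literature.NumberTheory.Transcendental.Baker1975.Ch3

-- The literal `1000` in `Setup.gp` makes definitional unfolding of the parameters explode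
-- (e.g. in `positivity`'s hypothesis matching); nothing below depends on the value of `gp`.
attribute [local irreducible] Setup.gp

/-! ### Generic real inequalities -/

/-- `1 ≤ log s` for `s ≥ 3`. [folklore] -/
private theorem one_le_log_nat {s : ℕ} (hs : 3 ≤ s) : (1 : ℝ) ≤ Real.log s := by
  have h3 : (3 : ℝ) ≤ s := by exact_mod_cast hs
  have he : Real.exp 1 < 3 := lt_trans Real.exp_one_lt_d9 (by norm_num)
  have : Real.log (Real.exp 1) ≤ Real.log s := Real.log_le_log (Real.exp_pos 1) (by linarith)
  rwa [Real.log_exp] at this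

/-- `log x ≤ x` for `x ≥ 0` (with `log 0 = 0`). [folklore] -/
private theorem log_le_self' {x : ℝ} (hx : 0 ≤ x) : Real.log x ≤ x := by
  rcases hx.eq_or_lt with h | h
  · rw [← h, Real.log_zero]
  · have := Real.log_le_sub_one_of_pos h; linarith

/-- `x ≤ exp x`. [folklore] -/
private theorem le_exp_self (x : ℝ) : x ≤ Real.exp x := by
  have := Real.add_one_le_exp x; linarith

/-- A natural power of a positive real as an exponential: `x^e = exp(e log x)`. [folklore] -/
private theorem pow_eq_exp_mul_log {x : ℝ} (hx : 0 < x) (e : ℕ) : x ^ e = Real.exp (e * Real.log x) := by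
  rw [← Real.log_pow, Real.exp_log (pow_pos hx e)]

/-- `x^e ≤ exp(e · c)` when `0 < x` and `log x ≤ c`. [folklore] -/
theorem pow_le_exp_of_log_le {x c : ℝ} (hx : 0 < x) (hc : Real.log x ≤ c) (e : ℕ) :
    x ^ e ≤ Real.exp (e * c) := by
  rw [pow_eq_exp_mul_log hx]
  exact Real.exp_le_exp.mpr (mul_le_mul_of_nonneg_left hc (Nat.cast_nonneg e))

/-- `n! ≤ exp(n log n)` (`n! ≤ nⁿ`). [folklore] -/
private theorem factorial_le_exp (n : ℕ) : (n.factorial : ℝ) ≤ Real.exp (n * Real.log n) := by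
  rcases Nat.eq_zero_or_pos n with h0 | hpos
  · subst h0; simp
  have h1 : (n.factorial : ℝ) ≤ ((n ^ n : ℕ) : ℝ) := by exact_mod_cast Nat.factorial_le_pow n
  refine h1.trans ?_
  push_cast
  rw [pow_eq_exp_mul_log (by exact_mod_cast hpos)]

/-- `4^N ≤ exp(2N)`. [folklore] -/
theorem four_pow_le_exp (N : ℕ) : (4 : ℝ) ^ N ≤ Real.exp (2 * N) := by
  have h4 : (4 : ℝ) ≤ Real.exp 2 := by
    have := Real.add_one_le_exp (1 : ℝ)
    have h1 : Real.exp 2 = Real.exp 1 * Real.exp 1 := by rw [← Real.exp_add]; norm_num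
    rw [h1]; nlinarith [Real.exp_pos 1]
  calc (4 : ℝ) ^ N ≤ (Real.exp 2) ^ N := pow_le_pow_left₀ (by norm_num) h4 N
    _ = Real.exp (2 * N) := by rw [← Real.exp_nat_mul]; ring_nf

/-- The final step of every factor bound: `exp a ≤ exp(h (U (K x)))` from `a ≤ h U K x`. [folklore] -/
theorem exp_le_exp_hUK {a h U K x : ℝ} (hle : a ≤ h * (U * (K * x))) :
    Real.exp a ≤ Real.exp (h * (U * (K * x))) := Real.exp_le_exp.mpr hle

namespace Setup

variable (S : Setup)

/-! ### The constants of the set-up entering the exponents -/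

/-- `ca = log ∏ aᵢ ≥ 0`. [folklore] -/
def ca : ℝ := Real.log ((∏ i, S.aden i : ℕ) : ℝ)

/-- `cM = log ∏ Mᵢ ≥ 0`. [folklore] -/
def cM : ℝ := Real.log (∏ i, S.αM i)

/-- `cℓ = log ℓ⁻ ≥ 0`. [folklore] -/
def cℓ : ℝ := Real.log S.ℓinv

/-- The height constant of the generator `αᵢ` in the Siegel step: `(2 aᵢ Mᵢ)^{D₀}`. [folklore] -/
def xHα (i : Fin (S.n + 1)) : ℝ := (2 * ((S.aden i : ℝ) * S.αM i)) ^ S.D₀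

/-- `cx = ∑ᵢ log(2 xHα_i²) ≥ 0`. [folklore] -/
def cx : ℝ := ∑ i, Real.log (2 * S.xHα i * S.xHα i)

/-- `0 ≤ ca`. [folklore] -/
theorem ca_nonneg : 0 ≤ S.ca := Real.log_nonneg (by exact_mod_cast Finset.one_le_prod' fun i _ => S.one_le_aden i)

/-- `1 ≤ ∏ Mᵢ`. [folklore] -/
theorem one_le_prod_αM' : (1 : ℝ) ≤ ∏ i, S.αM i := by
  calc (1 : ℝ) = ∏ _i : Fin (S.n + 1), (1 : ℝ) := by simp
    _ ≤ ∏ i, S.αM i := prod_le_prod (fun _ _ => zero_le_one) fun i _ => S.one_le_αM i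

/-- `0 ≤ cM`. [folklore] -/
theorem cM_nonneg : 0 ≤ S.cM := Real.log_nonneg S.one_le_prod_αM'

/-- `0 ≤ cℓ`. [folklore] -/
theorem cℓ_nonneg : 0 ≤ S.cℓ := Real.log_nonneg S.one_le_ℓinv

/-- `1 ≤ xHα i`. [folklore] -/
theorem one_le_xHα (i : Fin (S.n + 1)) : 1 ≤ S.xHα i := by
  unfold xHα
  refine one_le_pow₀ ?_
  have h1 : (1 : ℝ) ≤ S.aden i := by exact_mod_cast S.one_le_aden i
  have h2 := S.one_le_αM i
  nlinarith

/-- `0 ≤ cx`. [folklore] -/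
theorem cx_nonneg : 0 ≤ S.cx := by
  unfold cx
  refine sum_nonneg fun i _ => Real.log_nonneg ?_
  nlinarith [S.one_le_xHα i]

/-! ### The explicit constants `K` of the exponents (all depending on the set-up only) -/

/-- A common bound `eY · log s` for `log X`, `X` any of the ranges `s^e` used (`e ≤ J₁ + gp + 2`). [folklore] -/
def eY : ℕ := S.J₁ + S.gp + 2

/-- `#Idx ≤ exp(h U K₁ log s)`. [folklore] -/
def K₁ : ℝ := 1 + (S.n + 2) * (1 + S.eL)

/-- `T! ≤ exp(h U KF log s)` (`T ≤ k`, `T ≤ 2U`). [folklore] -/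
def KF : ℝ := 2 * (S.ek + 1)

/-- `(1 + L eʰ)^T ≤ exp(h U K4 log s)`. [folklore] -/
def K4 : ℝ := 2 * (2 + S.eL)

/-- `(2 L eʰ c)^T ≤ exp(h U (K5 c) log s)`. [folklore] -/
def K5 (c : ℝ) : ℝ := 2 * (2 + S.eL + c)

/-- The `ν`-factor `e^{h(6 + 9 log((R+h)/h)) T} ≤ exp(h U K9 log s)`. [folklore] -/
def K9 : ℝ := 2 * (15 + 9 * S.eY)

/-- `(k+1)^{n+1} ≤ exp(h U K12 log s)`. [folklore] -/
def K12 : ℝ := (S.n + 1) * (S.ek + 2)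

/-- `(2 L² eʰ)^{(n+1)k} ≤ exp(h U K13 log s)`. [folklore] -/
def K13 : ℝ := 4 * (S.n + 1) * (1 + S.eL)

/-- `∏_g (2 xH_g²)^{N_g} ≤ exp(h U K14 log s)`. [folklore] -/
def K14 : ℝ := S.cx + 2 * (S.n + 1) * (1 + 6 * S.D₀)

/-- `2 L l ≤ exp(h U K17 log s)`. [folklore] -/
def K17 : ℝ := 1 + S.eL + S.eY

/-- `Umax ≤ exp(h U KU log s)`. [folklore] -/
def KU : ℝ := S.K12 + S.K9 + 8 + S.KF + S.K13 + S.ca + S.K14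

/-- `P ≤ exp(h U KP log s)`. [folklore] -/
def KP : ℝ := S.K₁ + S.KU

/-- `gKB ≤ exp(h U KG log s)`. [folklore] -/
def KG : ℝ := S.KF + 8 + S.K4 + S.K5 1 + S.cM

/-- `denB ≤ exp(h U KD log s)`. [folklore] -/
def KD : ℝ := S.K9 + 2 * (S.n + 1) + S.ca

/-- `growthB ≤ exp(h U Kgr log s)`. [folklore] -/
def Kgr : ℝ := S.K₁ + S.KP + S.KF + 8 + S.K4 + S.K5 S.Λ + (S.Λ + 1)

/-- `errB ≤ exp(h U KE log s) |Λ'|`. [folklore] -/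
def KE : ℝ := 2 * S.Λ + S.K₁ + S.KP + S.KG + S.K17

/-- `(n+1)^{T} errB ≤ exp(h U Kε log s) |Λ'|`. [folklore] -/
def Kε : ℝ := 2 * S.n + S.KE

/-- `hermH ≤ ε exp(h V KH log s)`. [folklore] -/
def KH : ℝ := S.ek + 2 * S.eY + 8

/-- The main Liouville term `ℓ⁻^T denB^{D₀} (#Idx P gKB)^{D₀} ≤ exp(h U KΞ log s)`. [folklore] -/
def KΞ : ℝ := 2 * S.cℓ + S.D₀ * (S.KD + S.K₁ + S.KP + S.KG)

/-- `denθ ≤ exp(h U Kdθ log s)`. [folklore] -/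
def Kdθ : ℝ := 4 * (S.eL + 1) + S.ca

/-- `Mθ ≤ exp(h U KM log s)`. [folklore] -/
def KM : ℝ := S.K₁ + S.KP + 8 + S.cM

/-- `denθ^{Dθ} Mθ^{Dθ} ≤ exp(h (Dθ U) KY log s)`. [folklore] -/
def KY : ℝ := S.Kdθ + S.KM

/-- `errθ ≤ exp(h U KθE log s) |Λ'|`. [folklore] -/
def KθE : ℝ := S.K₁ + S.KP + 8 + S.Λ + S.K17

/-- One constant to rule them all: the threshold is `(Kall + 2) log s ≤ s`. [folklore] -/
def Kall : ℝ := S.Kε + S.KH + S.KΞ + S.Kgr + S.KY + S.KθE + S.KE + (S.eL + S.J₁ + S.gp + 2)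

/-- `0 ≤ K₁`. [folklore] -/
theorem K₁_nonneg : 0 ≤ S.K₁ := by unfold K₁; positivity
/-- `0 ≤ KF`. [folklore] -/
theorem KF_nonneg : 0 ≤ S.KF := by unfold KF; positivity
/-- `0 ≤ K4`. [folklore] -/
theorem K4_nonneg : 0 ≤ S.K4 := by unfold K4; positivity
/-- `0 ≤ K5`. [folklore] -/
theorem K5_nonneg {c : ℝ} (hc : 0 ≤ c) : 0 ≤ S.K5 c := by unfold K5; positivity
/-- `0 ≤ K9`. [folklore] -/
theorem K9_nonneg : 0 ≤ S.K9 := by unfold K9; positivity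
/-- `0 ≤ K12`. [folklore] -/
theorem K12_nonneg : 0 ≤ S.K12 := by unfold K12; positivity
/-- `0 ≤ K13`. [folklore] -/
theorem K13_nonneg : 0 ≤ S.K13 := by unfold K13; positivity
/-- `0 ≤ K14`. [folklore] -/
theorem K14_nonneg : 0 ≤ S.K14 := by have := S.cx_nonneg; unfold K14; positivity
/-- `0 ≤ K17`. [folklore] -/
theorem K17_nonneg : 0 ≤ S.K17 := by unfold K17; positivity
/-- `0 ≤ KU`. [folklore] -/
theorem KU_nonneg : 0 ≤ S.KU := by
  have := S.K12_nonneg; have := S.K9_nonneg; have := S.KF_nonneg; have := S.K13_nonneg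
  have := S.ca_nonneg; have := S.K14_nonneg; unfold KU; linarith
/-- `0 ≤ KP`. [folklore] -/
theorem KP_nonneg : 0 ≤ S.KP := by have := S.K₁_nonneg; have := S.KU_nonneg; unfold KP; linarith
/-- `0 ≤ KG`. [folklore] -/
theorem KG_nonneg : 0 ≤ S.KG := by
  have := S.KF_nonneg; have := S.K4_nonneg; have := S.K5_nonneg zero_le_one; have := S.cM_nonneg
  unfold KG; linarith
/-- `0 ≤ KD`. [folklore] -/
theorem KD_nonneg : 0 ≤ S.KD := by have := S.K9_nonneg; have := S.ca_nonneg; unfold KD; positivity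
/-- `0 ≤ Kgr`. [folklore] -/
theorem Kgr_nonneg : 0 ≤ S.Kgr := by
  have := S.K₁_nonneg; have := S.KP_nonneg; have := S.KF_nonneg; have := S.K4_nonneg
  have := S.K5_nonneg (zero_le_one.trans S.one_le_Λ); have := S.one_le_Λ; unfold Kgr; linarith
/-- `0 ≤ KE`. [folklore] -/
theorem KE_nonneg : 0 ≤ S.KE := by
  have := S.K₁_nonneg; have := S.KP_nonneg; have := S.KG_nonneg; have := S.K17_nonneg
  have := S.one_le_Λ; unfold KE; linarith
/-- `0 ≤ Kε`. [folklore] -/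
theorem Kε_nonneg : 0 ≤ S.Kε := by have := S.KE_nonneg; unfold Kε; positivity
/-- `0 ≤ KH`. [folklore] -/
theorem KH_nonneg : 0 ≤ S.KH := by unfold KH; positivity
/-- `0 ≤ KΞ`. [folklore] -/
theorem KΞ_nonneg : 0 ≤ S.KΞ := by
  have := S.cℓ_nonneg; have := S.KD_nonneg; have := S.K₁_nonneg; have := S.KP_nonneg; have := S.KG_nonneg
  unfold KΞ; positivity
/-- `0 ≤ Kdθ`. [folklore] -/
theorem Kdθ_nonneg : 0 ≤ S.Kdθ := by have := S.ca_nonneg; unfold Kdθ; positivity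
/-- `0 ≤ KM`. [folklore] -/
theorem KM_nonneg : 0 ≤ S.KM := by
  have := S.K₁_nonneg; have := S.KP_nonneg; have := S.cM_nonneg; unfold KM; positivity
/-- `0 ≤ KY`. [folklore] -/
theorem KY_nonneg : 0 ≤ S.KY := by have := S.Kdθ_nonneg; have := S.KM_nonneg; unfold KY; positivity
/-- `0 ≤ KθE`. [folklore] -/
theorem KθE_nonneg : 0 ≤ S.KθE := by
  have := S.K₁_nonneg; have := S.KP_nonneg; have := S.K17_nonneg; have := S.one_le_Λ; unfold KθE; linarith
/-- `0 ≤ Kall`. [folklore] -/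
theorem Kall_nonneg : 0 ≤ S.Kall := by
  have := S.Kε_nonneg; have := S.KH_nonneg; have := S.KΞ_nonneg; have := S.Kgr_nonneg
  have := S.KY_nonneg; have := S.KθE_nonneg; have := S.KE_nonneg; unfold Kall; positivity

/-! ### The parameters as real numbers -/

section Base

variable {s : ℕ}

/-- `(L : ℝ) = s^{eL}`. [folklore] -/
theorem Lp_cast (s : ℕ) : (S.Lp s : ℝ) = (s : ℝ) ^ S.eL := by unfold Lp; push_cast; rfl

/-- `(k : ℝ) = 2^{J₁} s^{ek}`. [folklore] -/
theorem kp_cast (s : ℕ) : (S.kp s : ℝ) = (2 : ℝ) ^ S.J₁ * (s : ℝ) ^ S.ek := by unfold kp; push_cast; rfl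

/-- `(Sord J : ℝ) = 2^{J₁-J} s^{ek}`. [folklore] -/
theorem Sord_cast (s J : ℕ) : (S.Sord s J : ℝ) = (2 : ℝ) ^ (S.J₁ - J) * (s : ℝ) ^ S.ek := by
  unfold Sord; push_cast; rfl

/-- `log L = eL log s`. [folklore] -/
theorem log_Lp (s : ℕ) : Real.log (S.Lp s) = S.eL * Real.log s := by
  rw [S.Lp_cast, Real.log_pow]

/-- `1 ≤ (L : ℝ)`. [folklore] -/
theorem one_le_Lp_real (hs : 1 ≤ s) : (1 : ℝ) ≤ S.Lp s := by exact_mod_cast S.one_le_Lp hs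

/-- `log (L+1) ≤ 1 + eL log s` (from `L + 1 ≤ 2L`). [folklore] -/
theorem log_Lp_succ_le (hs : 1 ≤ s) : Real.log (S.Lp s + 1) ≤ 1 + S.eL * Real.log s := by
  have hL := S.one_le_Lp_real hs
  have h1 : (S.Lp s + 1 : ℝ) ≤ 2 * S.Lp s := by linarith
  calc Real.log (S.Lp s + 1) ≤ Real.log (2 * S.Lp s) := Real.log_le_log (by linarith) h1
    _ = Real.log 2 + Real.log (S.Lp s) := Real.log_mul (by norm_num) (by linarith)
    _ ≤ 1 + S.eL * Real.log s := by
        rw [S.log_Lp s]; have := Real.log_two_lt_d9; linarith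

/-- With the threshold `2^{J₁} ≤ s`: `k ≤ s^{ek+1}`. [folklore] -/
theorem kp_real_le (h2 : 2 ^ S.J₁ ≤ s) : (S.kp s : ℝ) ≤ (s : ℝ) ^ (S.ek + 1) := by
  rw [S.kp_cast, pow_succ']
  have : ((2 : ℝ)) ^ S.J₁ ≤ s := by exact_mod_cast h2
  exact mul_le_mul_of_nonneg_right this (by positivity)

/-- `log k ≤ (ek+1) log s`. [folklore] -/
theorem log_kp_le (hs : 1 ≤ s) (h2 : 2 ^ S.J₁ ≤ s) : Real.log (S.kp s) ≤ (S.ek + 1) * Real.log s := by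
  have hk0 : (0 : ℝ) < S.kp s := by exact_mod_cast S.one_le_kp hs
  calc Real.log (S.kp s) ≤ Real.log ((s : ℝ) ^ (S.ek + 1)) := Real.log_le_log hk0 (S.kp_real_le h2)
    _ = (S.ek + 1) * Real.log s := by rw [Real.log_pow]; push_cast; ring

/-- `log (k+1) ≤ 1 + (ek+1) log s`. [folklore] -/
theorem log_kp_succ_le (hs : 1 ≤ s) (h2 : 2 ^ S.J₁ ≤ s) : Real.log (S.kp s + 1) ≤ 1 + (S.ek + 1) * Real.log s := by
  have hk : (1 : ℝ) ≤ S.kp s := by exact_mod_cast S.one_le_kp hs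
  calc Real.log (S.kp s + 1) ≤ Real.log (2 * S.kp s) := Real.log_le_log (by linarith) (by linarith)
    _ = Real.log 2 + Real.log (S.kp s) := Real.log_mul (by norm_num) (by linarith)
    _ ≤ 1 + (S.ek + 1) * Real.log s := by
        have := Real.log_two_lt_d9; have := S.log_kp_le hs h2; linarith

/-- `log T ≤ (ek+1) log s` for `1 ≤ T ≤ k`. [folklore] -/
theorem log_le_of_le_kp (hs : 1 ≤ s) (h2 : 2 ^ S.J₁ ≤ s) {T : ℕ} (hT1 : 1 ≤ T) (hT : T ≤ S.kp s) :
    Real.log T ≤ (S.ek + 1) * Real.log s := by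
  have h1 : (T : ℝ) ≤ S.kp s := by exact_mod_cast hT
  exact (Real.log_le_log (by exact_mod_cast hT1) h1).trans (S.log_kp_le hs h2)

end Base

end Setup

/-! ### Factor-by-factor exponential bounds -/

namespace Data

variable {S : Setup} (D : Data S) {s : ℕ}

/-- `1 ≤ h` as a real number. [folklore] -/
theorem one_le_h_real : (1 : ℝ) ≤ D.h := by exact_mod_cast D.one_le_h

/-- `log h ≤ h - 1`. [folklore] -/
theorem log_h_le : Real.log D.h ≤ D.h - 1 :=
  Real.log_le_sub_one_of_pos (by have := D.one_le_h_real; linarith)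

/-- **`#Idx ≤ exp(h U K₁ log s)`** (`1 ≤ U`). [cite: BakerTNT1975, Ch. 3 §3 Lemma 4] -/
theorem card_le (hs : 3 ≤ s) {U : ℝ} (hU : 1 ≤ U) :
    (Fintype.card (Idx S.n (S.Lp s) D.h) : ℝ) ≤ Real.exp (D.h * (U * (S.K₁ * Real.log s))) := by
  have hx := one_le_log_nat hs
  have hs1 : 1 ≤ s := by omega
  have hh := D.one_le_h_real
  have hL := S.one_le_Lp_real hs1
  have hlog := S.log_Lp_succ_le hs1
  rw [card_Idx]
  push_cast
  have h1 : (D.h : ℝ) * ((S.Lp s : ℝ) + 1) * ((S.Lp s : ℝ) + 1) ^ (S.n + 1) =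
      D.h * ((S.Lp s : ℝ) + 1) ^ (S.n + 2) := by ring
  rw [h1]
  have h2 : ((S.Lp s : ℝ) + 1) ^ (S.n + 2) ≤ Real.exp ((S.n + 2 : ℕ) * (1 + S.eL * Real.log s)) :=
    pow_le_exp_of_log_le (by linarith) hlog _
  have h3 : (D.h : ℝ) ≤ Real.exp (D.h - 1) := by
    have := Real.add_one_le_exp ((D.h : ℝ) - 1); linarith
  calc (D.h : ℝ) * ((S.Lp s : ℝ) + 1) ^ (S.n + 2)
      ≤ Real.exp (D.h - 1) * Real.exp ((S.n + 2 : ℕ) * (1 + S.eL * Real.log s)) :=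
        mul_le_mul h3 h2 (by positivity) (by positivity)
    _ ≤ Real.exp (D.h * (U * (S.K₁ * Real.log s))) := by
        rw [← Real.exp_add]
        refine Real.exp_le_exp.mpr ?_
        unfold Setup.K₁; push_cast
        -- (h - 1) + (n+2)(1 + eL x) ≤ h · 1 · (1 + (n+2)(1+eL)) x
        have hn : (0 : ℝ) ≤ S.n := Nat.cast_nonneg _
        have heL : (0 : ℝ) ≤ S.eL := Nat.cast_nonneg _
        have hA : (S.n + 2) * (1 + S.eL * Real.log s) ≤ ((S.n + 2) * (1 + S.eL)) * Real.log s := by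
          nlinarith
        have hB : (D.h : ℝ) - 1 + ((S.n + 2) * (1 + S.eL)) * Real.log s ≤
            D.h * ((1 + (S.n + 2) * (1 + S.eL)) * Real.log s) := by
          have h0 : (0 : ℝ) ≤ ((S.n + 2) * (1 + S.eL)) * Real.log s := by positivity
          nlinarith
        have hC : D.h * ((1 + (S.n + 2) * (1 + S.eL)) * Real.log s) ≤
            D.h * (U * ((1 + (S.n + 2) * (1 + S.eL)) * Real.log s)) := by
          refine mul_le_mul_of_nonneg_left ?_ (by linarith)
          have h0 : (0 : ℝ) ≤ (1 + (S.n + 2) * (1 + S.eL)) * Real.log s := by positivity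
          nlinarith
        linarith

/-- `1 ≤ #Idx`. [folklore] -/
theorem one_le_card (s : ℕ) : (1 : ℝ) ≤ Fintype.card (Idx S.n (S.Lp s) D.h) := by
  rw [card_Idx]
  have h1 := D.one_le_h
  exact_mod_cast Nat.mul_pos (Nat.mul_pos (by omega) (Nat.succ_pos _)) (pow_pos (Nat.succ_pos _) _)

/-- `T! ≤ exp(h U KF log s)` for `T ≤ k`, `T ≤ 2U`. [folklore] -/
theorem factorial_le (hs : 3 ≤ s) (h2 : 2 ^ S.J₁ ≤ s) {T : ℕ} (hT : T ≤ S.kp s) {U : ℝ} (hTU : (T : ℝ) ≤ 2 * U) :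
    (T.factorial : ℝ) ≤ Real.exp (D.h * (U * (S.KF * Real.log s))) := by
  have hx := one_le_log_nat hs
  have hs1 : 1 ≤ s := by omega
  have hh := D.one_le_h_real
  refine (factorial_le_exp T).trans (Real.exp_le_exp.mpr ?_)
  have hT0 : (0 : ℝ) ≤ T := Nat.cast_nonneg T
  have hlogT : Real.log T ≤ (S.ek + 1) * Real.log s := by
    rcases Nat.eq_zero_or_pos T with h0 | hpos
    · subst h0; simp; positivity
    · exact S.log_le_of_le_kp hs1 h2 hpos hT
  unfold Setup.KF
  have h1 : (T : ℝ) * Real.log T ≤ T * ((S.ek + 1) * Real.log s) := mul_le_mul_of_nonneg_left hlogT hT0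
  have h2 : (T : ℝ) * ((S.ek + 1) * Real.log s) ≤ (2 * U) * ((S.ek + 1) * Real.log s) :=
    mul_le_mul_of_nonneg_right hTU (by positivity)
  have h3 : (2 * U) * ((S.ek + 1) * Real.log s) ≤ D.h * ((2 * U) * ((S.ek + 1) * Real.log s)) := by
    have h0 : 0 ≤ (2 * U) * ((S.ek + 1) * Real.log s) := le_trans (by positivity) h2
    nlinarith
  calc (T : ℝ) * Real.log T ≤ D.h * ((2 * U) * ((S.ek + 1) * Real.log s)) := by linarith
    _ = D.h * (U * (2 * (S.ek + 1) * Real.log s)) := by ring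

/-- `4^{(R+h)(L+1)} ≤ exp(h U 8 log s)` for `R ≤ h X`, `1 ≤ X`, `L X ≤ U`. [cite: BakerTNT1975, Ch. 3 §3 Lemma 5] -/
theorem four_pow_le (hs : 3 ≤ s) {R : ℕ} {X U : ℝ} (hR : (R : ℝ) ≤ D.h * X) (hX : 1 ≤ X)
    (hLX : (S.Lp s : ℝ) * X ≤ U) :
    (4 : ℝ) ^ ((R + D.h) * (S.Lp s + 1)) ≤ Real.exp (D.h * (U * (8 * Real.log s))) := by
  have hx := one_le_log_nat hs
  have hs1 : 1 ≤ s := by omega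
  have hh := D.one_le_h_real
  have hL := S.one_le_Lp_real hs1
  refine (four_pow_le_exp _).trans (Real.exp_le_exp.mpr ?_)
  push_cast
  have h0 : (0 : ℝ) ≤ D.h := by linarith
  have h1 : (R : ℝ) + D.h ≤ 2 * (D.h * X) := by nlinarith
  have h2' : (S.Lp s : ℝ) + 1 ≤ 2 * S.Lp s := by linarith
  have hU0 : 0 ≤ U := le_trans (by positivity) hLX
  calc 2 * (((R : ℝ) + D.h) * ((S.Lp s : ℝ) + 1))
      ≤ 2 * ((2 * (D.h * X)) * (2 * S.Lp s)) := by gcongr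
    _ = D.h * ((S.Lp s * X) * 8) := by ring
    _ ≤ D.h * (U * 8) := by gcongr
    _ ≤ D.h * (U * (8 * Real.log s)) := by
        refine mul_le_mul_of_nonneg_left ?_ h0
        nlinarith

/-- `(1 + L eʰ)^T ≤ exp(h U K4 log s)` for `T ≤ 2U`. [cite: BakerTNT1975, Ch. 3 §3 Lemma 5] -/
theorem one_add_pow_le (hs : 3 ≤ s) (T : ℕ) {U : ℝ} (hTU : (T : ℝ) ≤ 2 * U) :
    (1 + S.Lp s * Real.exp D.h) ^ T ≤ Real.exp (D.h * (U * (S.K4 * Real.log s))) := by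
  have hx := one_le_log_nat hs
  have hs1 : 1 ≤ s := by omega
  have hh := D.one_le_h_real
  have hL := S.one_le_Lp_real hs1
  have he := D.one_le_exp_h
  have hlog := S.log_Lp_succ_le hs1
  have h1 : 1 + S.Lp s * Real.exp D.h ≤ (S.Lp s + 1) * Real.exp D.h := by nlinarith
  have h2 : Real.log (1 + S.Lp s * Real.exp D.h) ≤ 1 + S.eL * Real.log s + D.h := by
    calc Real.log (1 + S.Lp s * Real.exp D.h) ≤ Real.log ((S.Lp s + 1) * Real.exp D.h) :=
          Real.log_le_log (by positivity) h1
      _ = Real.log (S.Lp s + 1) + D.h := by rw [Real.log_mul (by positivity) (by positivity), Real.log_exp]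
      _ ≤ 1 + S.eL * Real.log s + D.h := by linarith
  refine (pow_le_exp_of_log_le (by positivity) h2 T).trans (Real.exp_le_exp.mpr ?_)
  have hT : (0 : ℝ) ≤ T := Nat.cast_nonneg T
  unfold Setup.K4
  -- T (1 + eL x + h) ≤ h T (2 + eL x) ≤ h (2U) (2 + eL) x
  have heL : (0 : ℝ) ≤ S.eL := Nat.cast_nonneg _
  have hexl : 0 ≤ S.eL * Real.log s := mul_nonneg heL (by linarith)
  have hA : 1 + S.eL * Real.log s + D.h ≤ D.h * (2 + S.eL * Real.log s) := by
    have : 0 ≤ ((D.h : ℝ) - 1) * (S.eL * Real.log s) := mul_nonneg (by linarith) hexl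
    nlinarith
  have hB : (2 + S.eL * Real.log s) ≤ (2 + S.eL) * Real.log s := by nlinarith
  have hU0 : 0 ≤ U := by linarith
  calc (T : ℝ) * (1 + S.eL * Real.log s + D.h) ≤ T * (D.h * ((2 + S.eL) * Real.log s)) := by
        refine mul_le_mul_of_nonneg_left (hA.trans ?_) hT
        exact mul_le_mul_of_nonneg_left hB (by linarith)
    _ ≤ (2 * U) * (D.h * ((2 + S.eL) * Real.log s)) := mul_le_mul_of_nonneg_right hTU (by positivity)
    _ = D.h * (U * (2 * (2 + S.eL) * Real.log s)) := by ring

/-- `(2 L eʰ c)^T ≤ exp(h U (K5 c) log s)` for `1 ≤ c`, `T ≤ 2U`. [cite: BakerTNT1975, Ch. 3 §3 Lemma 5] -/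
theorem two_L_exp_pow_le (hs : 3 ≤ s) {c : ℝ} (hc : 1 ≤ c) (T : ℕ) {U : ℝ} (hTU : (T : ℝ) ≤ 2 * U) :
    (2 * S.Lp s * Real.exp D.h * c) ^ T ≤ Real.exp (D.h * (U * (S.K5 c * Real.log s))) := by
  have hx := one_le_log_nat hs
  have hs1 : 1 ≤ s := by omega
  have hh := D.one_le_h_real
  have hL := S.one_le_Lp_real hs1
  have h2 : Real.log (2 * S.Lp s * Real.exp D.h * c) ≤ 1 + S.eL * Real.log s + D.h + c := by
    rw [Real.log_mul (by positivity) (by positivity), Real.log_mul (by positivity) (by positivity),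
      Real.log_mul (by norm_num) (by positivity), Real.log_exp, S.log_Lp s]
    have := Real.log_two_lt_d9
    have := log_le_self' (zero_le_one.trans hc)
    linarith
  refine (pow_le_exp_of_log_le (by positivity) h2 T).trans (Real.exp_le_exp.mpr ?_)
  have hT : (0 : ℝ) ≤ T := Nat.cast_nonneg T
  unfold Setup.K5
  have heL : (0 : ℝ) ≤ S.eL := Nat.cast_nonneg _
  have hexl : 0 ≤ S.eL * Real.log s := mul_nonneg heL (by linarith)
  have hA : 1 + S.eL * Real.log s + D.h + c ≤ D.h * (2 + S.eL * Real.log s + c) := by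
    have : 0 ≤ ((D.h : ℝ) - 1) * (S.eL * Real.log s) := mul_nonneg (by linarith) hexl
    have : 0 ≤ ((D.h : ℝ) - 1) * c := mul_nonneg (by linarith) (by linarith)
    nlinarith
  have hB : (2 + S.eL * Real.log s + c) ≤ (2 + S.eL + c) * Real.log s := by
    have : 0 ≤ (Real.log s - 1) * c := mul_nonneg (by linarith) (by linarith)
    nlinarith
  have hU0 : 0 ≤ U := by linarith
  calc (T : ℝ) * (1 + S.eL * Real.log s + D.h + c) ≤ T * (D.h * ((2 + S.eL + c) * Real.log s)) := by
        refine mul_le_mul_of_nonneg_left (hA.trans ?_) hT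
        exact mul_le_mul_of_nonneg_left hB (by linarith)
    _ ≤ (2 * U) * (D.h * ((2 + S.eL + c) * Real.log s)) := mul_le_mul_of_nonneg_right hTU (by positivity)
    _ = D.h * (U * (2 * (2 + S.eL + c) * Real.log s)) := by ring

/-- `(2 L eʰ)^T ≤ exp(h U (K5 1) log s)`. [cite: BakerTNT1975, Ch. 3 §3 Lemma 5] -/
theorem two_L_exp_pow_le' (hs : 3 ≤ s) (T : ℕ) {U : ℝ} (hTU : (T : ℝ) ≤ 2 * U) :
    (2 * S.Lp s * Real.exp D.h) ^ T ≤ Real.exp (D.h * (U * (S.K5 1 * Real.log s))) := by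
  simpa using D.two_L_exp_pow_le hs (le_refl (1 : ℝ)) T hTU

/-- `exp(L (Λ+1) R) ≤ exp(h U (Λ+1) log s)` for `R ≤ h X`, `L X ≤ U`. [folklore] -/
theorem exp_L_mul_le (hs : 3 ≤ s) {R : ℕ} {X U : ℝ} (hR : (R : ℝ) ≤ D.h * X) (hX : 1 ≤ X)
    (hLX : (S.Lp s : ℝ) * X ≤ U) :
    Real.exp (S.Lp s * (S.Λ + 1) * R) ≤ Real.exp (D.h * (U * ((S.Λ + 1) * Real.log s))) := by
  have hx := one_le_log_nat hs
  have hh := D.one_le_h_real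
  have hΛ := S.one_le_Λ
  refine Real.exp_le_exp.mpr ?_
  have hU0 : 0 ≤ U := le_trans (by positivity) hLX
  calc (S.Lp s : ℝ) * (S.Λ + 1) * R ≤ S.Lp s * (S.Λ + 1) * (D.h * X) := by gcongr
    _ = D.h * ((S.Lp s * X) * (S.Λ + 1)) := by ring
    _ ≤ D.h * (U * (S.Λ + 1)) := by gcongr
    _ ≤ D.h * (U * ((S.Λ + 1) * Real.log s)) := by
        refine mul_le_mul_of_nonneg_left (mul_le_mul_of_nonneg_left ?_ hU0) (by linarith)
        nlinarith

/-- `(∏ Mᵢ)^{L l} ≤ exp(h U cM log s)` for `l ≤ h X`, `L X ≤ U`. [folklore] -/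
theorem prod_αM_pow_le (hs : 3 ≤ s) {l : ℕ} {X U : ℝ} (hl : (l : ℝ) ≤ D.h * X) (hX : 1 ≤ X)
    (hLX : (S.Lp s : ℝ) * X ≤ U) :
    (∏ i, S.αM i) ^ (S.Lp s * l) ≤ Real.exp (D.h * (U * (S.cM * Real.log s))) := by
  have hx := one_le_log_nat hs
  have hh := D.one_le_h_real
  have hpos : (0 : ℝ) < ∏ i, S.αM i := lt_of_lt_of_le one_pos S.one_le_prod_αM'
  have hc := S.cM_nonneg
  rw [pow_eq_exp_mul_log hpos]
  refine Real.exp_le_exp.mpr ?_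
  have hL0 : (0 : ℝ) ≤ S.Lp s := Nat.cast_nonneg _
  have hU0 : 0 ≤ U := le_trans (mul_nonneg hL0 (by linarith)) hLX
  show ((S.Lp s * l : ℕ) : ℝ) * Real.log (∏ i, S.αM i) ≤ _
  unfold Setup.cM at hc ⊢
  set c := Real.log (∏ i, S.αM i)
  rw [Nat.cast_mul]
  have h0 : (0 : ℝ) ≤ D.h := by linarith
  have e1 : (S.Lp s : ℝ) * l * c ≤ S.Lp s * (D.h * X) * c :=
    mul_le_mul_of_nonneg_right (mul_le_mul_of_nonneg_left hl hL0) hc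
  have e2 : D.h * ((S.Lp s * X) * c) ≤ D.h * (U * c) :=
    mul_le_mul_of_nonneg_left (mul_le_mul_of_nonneg_right hLX hc) h0
  have e3 : D.h * (U * c) ≤ D.h * (U * (c * Real.log s)) := by
    refine mul_le_mul_of_nonneg_left (mul_le_mul_of_nonneg_left ?_ hU0) h0
    nlinarith
  calc (S.Lp s : ℝ) * l * c ≤ S.Lp s * (D.h * X) * c := e1
    _ = D.h * ((S.Lp s * X) * c) := by ring
    _ ≤ D.h * (U * (c * Real.log s)) := e2.trans e3

/-- `(∏ aᵢ)^{L l} ≤ exp(h U ca log s)` for `l ≤ h X`, `L X ≤ U`. [folklore] -/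
theorem prod_aden_pow_le (hs : 3 ≤ s) {l : ℕ} {X U : ℝ} (hl : (l : ℝ) ≤ D.h * X) (hX : 1 ≤ X)
    (hLX : (S.Lp s : ℝ) * X ≤ U) :
    ((∏ i, S.aden i : ℕ) : ℝ) ^ (S.Lp s * l) ≤ Real.exp (D.h * (U * (S.ca * Real.log s))) := by
  have hx := one_le_log_nat hs
  have hh := D.one_le_h_real
  have hpos : (0 : ℝ) < ((∏ i, S.aden i : ℕ) : ℝ) := by exact_mod_cast prod_pos fun i _ => S.one_le_aden i
  have hc := S.ca_nonneg
  rw [pow_eq_exp_mul_log hpos]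
  refine Real.exp_le_exp.mpr ?_
  have hL0 : (0 : ℝ) ≤ S.Lp s := Nat.cast_nonneg _
  have hU0 : 0 ≤ U := le_trans (mul_nonneg hL0 (by linarith)) hLX
  show ((S.Lp s * l : ℕ) : ℝ) * Real.log ((∏ i, S.aden i : ℕ) : ℝ) ≤ _
  unfold Setup.ca at hc ⊢
  set c := Real.log ((∏ i, S.aden i : ℕ) : ℝ)
  rw [Nat.cast_mul]
  have h0 : (0 : ℝ) ≤ D.h := by linarith
  have e1 : (S.Lp s : ℝ) * l * c ≤ S.Lp s * (D.h * X) * c :=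
    mul_le_mul_of_nonneg_right (mul_le_mul_of_nonneg_left hl hL0) hc
  have e2 : D.h * ((S.Lp s * X) * c) ≤ D.h * (U * c) :=
    mul_le_mul_of_nonneg_left (mul_le_mul_of_nonneg_right hLX hc) h0
  have e3 : D.h * (U * c) ≤ D.h * (U * (c * Real.log s)) := by
    refine mul_le_mul_of_nonneg_left (mul_le_mul_of_nonneg_left ?_ hU0) h0
    nlinarith
  calc (S.Lp s : ℝ) * l * c ≤ S.Lp s * (D.h * X) * c := e1
    _ = D.h * ((S.Lp s * X) * c) := by ring
    _ ≤ D.h * (U * (c * Real.log s)) := e2.trans e3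

/-- `log((R+h)/h) ≤ 1 + log X` for `R ≤ h X`, `1 ≤ X`. [folklore] -/
theorem log_ratio_le {R : ℕ} {X : ℝ} (hR : (R : ℝ) ≤ D.h * X) (hX : 1 ≤ X) :
    Real.log (((R : ℝ) + D.h) / D.h) ≤ 1 + Real.log X := by
  have hh : (0 : ℝ) < D.h := by have := D.one_le_h_real; linarith
  have h1 : ((R : ℝ) + D.h) / D.h ≤ 2 * X := by
    rw [div_le_iff₀ hh]; nlinarith
  have h0 : 0 < ((R : ℝ) + D.h) / D.h := by positivity
  calc Real.log (((R : ℝ) + D.h) / D.h) ≤ Real.log (2 * X) := Real.log_le_log h0 h1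
    _ = Real.log 2 + Real.log X := Real.log_mul (by norm_num) (by positivity)
    _ ≤ 1 + Real.log X := by have := Real.log_two_lt_d9; linarith

/-- `0 ≤ log((R+h)/h)`. [folklore] -/
theorem log_ratio_nonneg (R : ℕ) : 0 ≤ Real.log (((R : ℝ) + D.h) / D.h) := by
  have hh : (0 : ℝ) < D.h := by have := D.one_le_h_real; linarith
  refine Real.log_nonneg ?_
  rw [le_div_iff₀ hh]; have : (0 : ℝ) ≤ R := Nat.cast_nonneg _; linarith

/-- The `ν`-factor: `exp(h (6 + 9 log((R+h)/h)) T) ≤ exp(h U K9 log s)` for `R ≤ h X`,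
`log X ≤ eY log s`, `T ≤ 2U`. [cite: BakerTNT1975, Ch. 3 §2 Lemma 1] -/
theorem nu_factor_le (hs : 3 ≤ s) {R : ℕ} {X U : ℝ} (hR : (R : ℝ) ≤ D.h * X) (hX : 1 ≤ X)
    (hlX : Real.log X ≤ S.eY * Real.log s) (T : ℕ) (hTU : (T : ℝ) ≤ 2 * U) :
    Real.exp (D.h * (6 + 9 * Real.log (((R : ℝ) + D.h) / D.h)) * T) ≤
      Real.exp (D.h * (U * (S.K9 * Real.log s))) := by
  have hx := one_le_log_nat hs
  have hh := D.one_le_h_real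
  have h1 := D.log_ratio_le hR hX
  have h1' := D.log_ratio_nonneg R
  refine Real.exp_le_exp.mpr ?_
  have hT : (0 : ℝ) ≤ T := Nat.cast_nonneg T
  have h0 : (0 : ℝ) ≤ D.h := by linarith
  unfold Setup.K9
  have heY : (0 : ℝ) ≤ S.eY := Nat.cast_nonneg _
  have hA : 6 + 9 * Real.log (((R : ℝ) + D.h) / D.h) ≤ (15 + 9 * S.eY) * Real.log s := by nlinarith
  have hU0 : 0 ≤ U := by linarith
  calc D.h * (6 + 9 * Real.log (((R : ℝ) + D.h) / D.h)) * T ≤ D.h * ((15 + 9 * S.eY) * Real.log s) * (2 * U) := by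
        gcongr
    _ = D.h * (U * (2 * (15 + 9 * S.eY) * Real.log s)) := by ring

/-- `exp(h (n+1) T) ≤ exp(h U (2(n+1)) log s)` for `T ≤ 2U`. [folklore] -/
theorem exp_n1_le (hs : 3 ≤ s) (T : ℕ) {U : ℝ} (hTU : (T : ℝ) ≤ 2 * U) :
    Real.exp (D.h * ((S.n + 1) * T)) ≤ Real.exp (D.h * (U * ((2 * (S.n + 1)) * Real.log s))) := by
  have hx := one_le_log_nat hs
  have hh := D.one_le_h_real
  refine Real.exp_le_exp.mpr (mul_le_mul_of_nonneg_left ?_ (by linarith))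
  have hn : (0 : ℝ) ≤ S.n := Nat.cast_nonneg _
  have hU0 : 0 ≤ U := by have : (0:ℝ) ≤ T := Nat.cast_nonneg T; linarith
  calc ((S.n : ℝ) + 1) * T ≤ (S.n + 1) * (2 * U) := by gcongr
    _ = U * (2 * (S.n + 1)) := by ring
    _ ≤ U * ((2 * (S.n + 1)) * Real.log s) := by
        refine mul_le_mul_of_nonneg_left ?_ hU0; nlinarith

/-- `ℓ⁻^T ≤ exp(h U (2cℓ) log s)` for `T ≤ 2U`. [folklore] -/
theorem ℓinv_pow_le (hs : 3 ≤ s) (T : ℕ) {U : ℝ} (hTU : (T : ℝ) ≤ 2 * U) :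
    S.ℓinv ^ T ≤ Real.exp (D.h * (U * ((2 * S.cℓ) * Real.log s))) := by
  have hx := one_le_log_nat hs
  have hh := D.one_le_h_real
  have hpos : 0 < S.ℓinv := lt_of_lt_of_le one_pos S.one_le_ℓinv
  have hc := S.cℓ_nonneg
  rw [pow_eq_exp_mul_log hpos]
  refine Real.exp_le_exp.mpr ?_
  unfold Setup.cℓ at hc ⊢
  have hU0 : 0 ≤ U := by have : (0:ℝ) ≤ T := Nat.cast_nonneg T; linarith
  calc (T : ℝ) * Real.log S.ℓinv ≤ (2 * U) * Real.log S.ℓinv := mul_le_mul_of_nonneg_right hTU hc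
    _ = 1 * (U * (2 * Real.log S.ℓinv)) := by ring
    _ ≤ D.h * (U * ((2 * Real.log S.ℓinv) * Real.log s)) := by
        refine mul_le_mul hh (mul_le_mul_of_nonneg_left ?_ hU0) (by positivity) (by linarith)
        nlinarith

/-- `(k+1)^{n+1} ≤ exp(h U K12 log s)` (`1 ≤ U`). [folklore] -/
theorem kp_succ_pow_le (hs : 3 ≤ s) (h2 : 2 ^ S.J₁ ≤ s) {U : ℝ} (hU : 1 ≤ U) :
    (((S.kp s + 1 : ℕ) : ℝ)) ^ (S.n + 1) ≤ Real.exp (D.h * (U * (S.K12 * Real.log s))) := by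
  have hx := one_le_log_nat hs
  have hs1 : 1 ≤ s := by omega
  have hh := D.one_le_h_real
  have hlog := S.log_kp_succ_le hs1 h2
  have hk : (1 : ℝ) ≤ S.kp s := by exact_mod_cast S.one_le_kp hs1
  push_cast
  refine (pow_le_exp_of_log_le (by positivity) hlog _).trans (Real.exp_le_exp.mpr ?_)
  unfold Setup.K12; push_cast
  have hek : (0 : ℝ) ≤ S.ek := Nat.cast_nonneg _
  have hn : (0 : ℝ) ≤ S.n := Nat.cast_nonneg _
  have hA : 1 + (S.ek + 1) * Real.log s ≤ (S.ek + 2) * Real.log s := by nlinarith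
  calc ((S.n : ℝ) + 1) * (1 + (S.ek + 1) * Real.log s) ≤ (S.n + 1) * ((S.ek + 2) * Real.log s) := by gcongr
    _ = 1 * (1 * ((S.n + 1) * (S.ek + 2) * Real.log s)) := by ring
    _ ≤ D.h * (U * ((S.n + 1) * (S.ek + 2) * Real.log s)) := by gcongr

/-- `(2 L² eʰ)^{(n+1)k} ≤ exp(h U K13 log s)` for `k ≤ 2U`. [cite: BakerTNT1975, Ch. 3 §3 Lemma 4] -/
theorem two_L_sq_pow_le (hs : 3 ≤ s) {U : ℝ} (hkU : (S.kp s : ℝ) ≤ 2 * U) :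
    (2 * (S.Lp s : ℝ) ^ 2 * Real.exp D.h) ^ ((S.n + 1) * S.kp s) ≤
      Real.exp (D.h * (U * (S.K13 * Real.log s))) := by
  have hx := one_le_log_nat hs
  have hs1 : 1 ≤ s := by omega
  have hh := D.one_le_h_real
  have hL := S.one_le_Lp_real hs1
  have h2 : Real.log (2 * (S.Lp s : ℝ) ^ 2 * Real.exp D.h) ≤ D.h * (2 + 2 * S.eL * Real.log s) := by
    rw [Real.log_mul (by positivity) (by positivity), Real.log_mul (by norm_num) (by positivity),
      Real.log_exp, Real.log_pow, S.log_Lp s]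
    have := Real.log_two_lt_d9
    have heL : (0 : ℝ) ≤ S.eL * Real.log s := by positivity
    push_cast
    nlinarith
  refine (pow_le_exp_of_log_le (by positivity) h2 _).trans (Real.exp_le_exp.mpr ?_)
  unfold Setup.K13; push_cast
  have heL : (0 : ℝ) ≤ S.eL := Nat.cast_nonneg _
  have hn : (0 : ℝ) ≤ S.n := Nat.cast_nonneg _
  have hk0 : (0 : ℝ) ≤ S.kp s := Nat.cast_nonneg _
  have hA : (2 + 2 * S.eL * Real.log s) ≤ (2 + 2 * S.eL) * Real.log s := by nlinarith
  have h0 : (0 : ℝ) ≤ D.h := by linarith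
  have hU0 : 0 ≤ U := by linarith
  have e1 : ((S.n : ℝ) + 1) * (S.kp s) ≤ (S.n + 1) * (2 * U) := mul_le_mul_of_nonneg_left hkU (by linarith)
  have e2 : D.h * (2 + 2 * S.eL * Real.log s) ≤ D.h * ((2 + 2 * S.eL) * Real.log s) := mul_le_mul_of_nonneg_left hA h0
  have hpos2 : 0 ≤ D.h * (2 + 2 * S.eL * Real.log s) := mul_nonneg h0 (by nlinarith)
  calc ((S.n : ℝ) + 1) * (S.kp s) * (D.h * (2 + 2 * S.eL * Real.log s))
      ≤ ((S.n + 1) * (2 * U)) * (D.h * ((2 + 2 * S.eL) * Real.log s)) :=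
        mul_le_mul e1 e2 hpos2 (mul_nonneg (by linarith) (by linarith))
    _ = D.h * (U * (4 * (S.n + 1) * (1 + S.eL) * Real.log s)) := by ring

/-- `xH` of an `α`-generator is the constant `xHα`. [folklore] -/
theorem xH_inl (i : Fin (S.n + 1)) : D.xH (Sum.inl i) = S.xHα i := rfl

/-- `xH` of a `β`-generator is `(2 eʰ eʰ)^{D₀}`. [folklore] -/
theorem xH_inr (j : Option (Fin S.n)) : D.xH (Sum.inr j) = (2 * (Real.exp D.h * Real.exp D.h)) ^ S.D₀ := rfl

/-- `log(2 xHβ²) ≤ h (1 + 6 D₀)` for the `β`-generators. [folklore] -/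
theorem log_xH_inr_le (j : Option (Fin S.n)) :
    Real.log (2 * D.xH (Sum.inr j) * D.xH (Sum.inr j)) ≤ D.h * (1 + 6 * S.D₀) := by
  have hh := D.one_le_h_real
  rw [D.xH_inr]
  have he : 0 < Real.exp D.h := Real.exp_pos _
  have hq : (0 : ℝ) < (2 * (Real.exp D.h * Real.exp D.h)) ^ S.D₀ := by positivity
  rw [Real.log_mul (by positivity) hq.ne', Real.log_mul (by norm_num) hq.ne', Real.log_pow,
    Real.log_mul (by norm_num) (by positivity), Real.log_mul he.ne' he.ne', Real.log_exp]
  have h2 := Real.log_two_lt_d9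
  have hD : (0 : ℝ) ≤ S.D₀ := Nat.cast_nonneg _
  nlinarith

/-- `∏_g (2 xH_g²)^{N_g} ≤ exp(h U K14 log s)` for the caps at `R₀ ≤ h X` (`L X ≤ U`, `k ≤ 2U`).
[cite: BakerTNT1975, Ch. 3 §3 Lemma 4] -/
theorem prod_xH_pow_le (hs : 3 ≤ s) {R₀ : ℕ} {X U : ℝ} (hR : (R₀ : ℝ) ≤ D.h * X) (hX : 1 ≤ X)
    (hLX : (S.Lp s : ℝ) * X ≤ U) (hkU : (S.kp s : ℝ) ≤ 2 * U) :
    ∏ g, (2 * D.xH g * D.xH g) ^ Ncap (S.Lp s) (S.kp s) R₀ g ≤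
      Real.exp (D.h * (U * (S.K14 * Real.log s))) := by
  have hx := one_le_log_nat hs
  have hh := D.one_le_h_real
  have hxH := D.one_le_xH
  have hU0 : 0 ≤ U := le_trans (by positivity) hLX
  rw [Fintype.prod_sum_type]
  -- the α-part
  have hA : ∏ i : Fin (S.n + 1), (2 * D.xH (Sum.inl i) * D.xH (Sum.inl i)) ^ Ncap (S.Lp s) (S.kp s) R₀ (Sum.inl i : Gen S.n)
      ≤ Real.exp (D.h * (U * (S.cx * Real.log s))) := by
    have h1 : ∏ i : Fin (S.n + 1), (2 * D.xH (Sum.inl i) * D.xH (Sum.inl i)) ^ Ncap (S.Lp s) (S.kp s) R₀ (Sum.inl i : Gen S.n)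
        = (∏ i : Fin (S.n + 1), (2 * S.xHα i * S.xHα i)) ^ (S.Lp s * R₀) := by
      rw [← prod_pow]; rfl
    rw [h1]
    have hpos : 0 < ∏ i : Fin (S.n + 1), (2 * S.xHα i * S.xHα i) :=
      prod_pos fun i _ => by nlinarith [S.one_le_xHα i]
    rw [pow_eq_exp_mul_log hpos, Real.log_prod (fun i _ => (by nlinarith [S.one_le_xHα i] : (2 * S.xHα i * S.xHα i) ≠ 0))]
    refine Real.exp_le_exp.mpr ?_
    have hc := S.cx_nonneg
    unfold Setup.cx at hc ⊢
    set c := ∑ i, Real.log (2 * S.xHα i * S.xHα i)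
    push_cast
    calc (S.Lp s : ℝ) * R₀ * c ≤ S.Lp s * (D.h * X) * c := by gcongr
      _ = D.h * ((S.Lp s * X) * c) := by ring
      _ ≤ D.h * (U * c) := by gcongr
      _ ≤ D.h * (U * (c * Real.log s)) := by
          refine mul_le_mul_of_nonneg_left (mul_le_mul_of_nonneg_left ?_ hU0) (by linarith)
          nlinarith
  -- the β-part
  have hB : ∏ j : Option (Fin S.n), (2 * D.xH (Sum.inr j) * D.xH (Sum.inr j)) ^ Ncap (S.Lp s) (S.kp s) R₀ (Sum.inr j : Gen S.n)
      ≤ Real.exp (D.h * (U * ((2 * (S.n + 1) * (1 + 6 * S.D₀)) * Real.log s))) := by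
    have h1 : ∀ j : Option (Fin S.n), (2 * D.xH (Sum.inr j) * D.xH (Sum.inr j)) ^ Ncap (S.Lp s) (S.kp s) R₀ (Sum.inr j : Gen S.n)
        ≤ Real.exp (S.kp s * (D.h * (1 + 6 * S.D₀))) := fun j => by
      have hq : 0 < 2 * D.xH (Sum.inr j) * D.xH (Sum.inr j) := by nlinarith [hxH (Sum.inr j)]
      exact pow_le_exp_of_log_le hq (D.log_xH_inr_le j) _
    calc ∏ j : Option (Fin S.n), (2 * D.xH (Sum.inr j) * D.xH (Sum.inr j)) ^ Ncap (S.Lp s) (S.kp s) R₀ (Sum.inr j : Gen S.n)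
        ≤ ∏ _j : Option (Fin S.n), Real.exp (S.kp s * (D.h * (1 + 6 * S.D₀))) :=
          prod_le_prod (fun j _ => pow_nonneg (by nlinarith [hxH (Sum.inr j)]) _) fun j _ => h1 j
      _ = Real.exp ((S.n + 1 : ℕ) * (S.kp s * (D.h * (1 + 6 * S.D₀)))) := by
          rw [prod_const, ← Real.exp_nat_mul]; simp [Fintype.card_option]
      _ ≤ _ := by
          refine Real.exp_le_exp.mpr ?_
          push_cast
          have hD : (0 : ℝ) ≤ S.D₀ := Nat.cast_nonneg _
          have hn : (0 : ℝ) ≤ S.n := Nat.cast_nonneg _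
          have h0 : (0 : ℝ) ≤ D.h := by linarith
          calc ((S.n : ℝ) + 1) * (S.kp s * (D.h * (1 + 6 * S.D₀))) ≤ (S.n + 1) * ((2 * U) * (D.h * (1 + 6 * S.D₀))) := by
                gcongr
            _ = D.h * (U * (2 * (S.n + 1) * (1 + 6 * S.D₀))) := by ring
            _ ≤ D.h * (U * (2 * (S.n + 1) * (1 + 6 * S.D₀) * Real.log s)) := by
                refine mul_le_mul_of_nonneg_left (mul_le_mul_of_nonneg_left ?_ hU0) h0
                have : (0 : ℝ) ≤ 2 * (S.n + 1) * (1 + 6 * S.D₀) := by positivity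
                nlinarith
  have hA0 : 0 ≤ ∏ i : Fin (S.n + 1), (2 * D.xH (Sum.inl i) * D.xH (Sum.inl i)) ^ Ncap (S.Lp s) (S.kp s) R₀ (Sum.inl i : Gen S.n) :=
    prod_nonneg fun i _ => by have := hxH (Sum.inl i); positivity
  calc _ ≤ Real.exp (D.h * (U * (S.cx * Real.log s))) *
        Real.exp (D.h * (U * ((2 * (S.n + 1) * (1 + 6 * S.D₀)) * Real.log s))) :=
        mul_le_mul hA hB (prod_nonneg fun j _ => by have := hxH (Sum.inr j); positivity) (by positivity)
    _ = Real.exp (D.h * (U * (S.K14 * Real.log s))) := by rw [← Real.exp_add]; unfold Setup.K14; ring_nf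

/-- `Λ^T ≤ exp(h U (2Λ) log s)` for `T ≤ 2U`. [folklore] -/
theorem Λ_pow_le (hs : 3 ≤ s) (T : ℕ) {U : ℝ} (hTU : (T : ℝ) ≤ 2 * U) :
    S.Λ ^ T ≤ Real.exp (D.h * (U * ((2 * S.Λ) * Real.log s))) := by
  have hx := one_le_log_nat hs
  have hh := D.one_le_h_real
  have hΛ := S.one_le_Λ
  have hlog : Real.log S.Λ ≤ S.Λ := log_le_self' (by linarith)
  refine (pow_le_exp_of_log_le (by linarith) hlog T).trans (Real.exp_le_exp.mpr ?_)
  have hU0 : 0 ≤ U := by have : (0:ℝ) ≤ T := Nat.cast_nonneg T; linarith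
  calc (T : ℝ) * S.Λ ≤ (2 * U) * S.Λ := mul_le_mul_of_nonneg_right hTU (by linarith)
    _ = 1 * (U * (2 * S.Λ)) := by ring
    _ ≤ D.h * (U * ((2 * S.Λ) * Real.log s)) := by
        refine mul_le_mul hh (mul_le_mul_of_nonneg_left ?_ hU0) (by positivity) (by linarith)
        nlinarith

/-- `(n+1)^T ≤ exp(h U (2n) log s)` for `T ≤ 2U`. [folklore] -/
theorem n1_pow_le (hs : 3 ≤ s) (T : ℕ) {U : ℝ} (hTU : (T : ℝ) ≤ 2 * U) :
    ((S.n + 1 : ℕ) : ℝ) ^ T ≤ Real.exp (D.h * (U * ((2 * S.n) * Real.log s))) := by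
  have hx := one_le_log_nat hs
  have hh := D.one_le_h_real
  have hlog : Real.log ((S.n + 1 : ℕ) : ℝ) ≤ S.n := by
    have h1 := Real.add_one_le_exp (S.n : ℝ)
    have h2 : Real.log ((S.n + 1 : ℕ) : ℝ) ≤ Real.log (Real.exp S.n) :=
      Real.log_le_log (by positivity) (by push_cast; linarith)
    rwa [Real.log_exp] at h2
  refine (pow_le_exp_of_log_le (by positivity) hlog T).trans (Real.exp_le_exp.mpr ?_)
  have hU0 : 0 ≤ U := by have : (0:ℝ) ≤ T := Nat.cast_nonneg T; linarith
  have hn : (0 : ℝ) ≤ S.n := Nat.cast_nonneg _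
  calc (T : ℝ) * S.n ≤ (2 * U) * S.n := mul_le_mul_of_nonneg_right hTU hn
    _ = 1 * (U * (2 * S.n)) := by ring
    _ ≤ D.h * (U * ((2 * S.n) * Real.log s)) := by
        refine mul_le_mul hh (mul_le_mul_of_nonneg_left ?_ hU0) (by positivity) (by linarith)
        nlinarith

/-- `2 L l ≤ exp(h U K17 log s)` for `l ≤ h X`, `1 ≤ X`, `log X ≤ eY log s`, `1 ≤ U`. [folklore] -/
theorem two_L_l_le (hs : 3 ≤ s) {l : ℕ} {X U : ℝ} (hl : (l : ℝ) ≤ D.h * X) (hX : 1 ≤ X)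
    (hlX : Real.log X ≤ S.eY * Real.log s) (hU : 1 ≤ U) :
    2 * (S.Lp s : ℝ) * l ≤ Real.exp (D.h * (U * (S.K17 * Real.log s))) := by
  have hx := one_le_log_nat hs
  have hs1 : 1 ≤ s := by omega
  have hh := D.one_le_h_real
  have hL := S.one_le_Lp_real hs1
  have hlogh := D.log_h_le
  have h1 : 2 * (S.Lp s : ℝ) * l ≤ 2 * S.Lp s * (D.h * X) := by gcongr
  refine h1.trans ?_
  have hpos : 0 < 2 * S.Lp s * (D.h * X) := by positivity
  rw [← Real.exp_log hpos]
  refine Real.exp_le_exp.mpr ?_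
  rw [Real.log_mul (by positivity) (by positivity), Real.log_mul (by norm_num) (by positivity),
    Real.log_mul (by positivity) (by positivity), S.log_Lp s]
  unfold Setup.K17
  have heL : (0 : ℝ) ≤ S.eL := Nat.cast_nonneg _
  have heY : (0 : ℝ) ≤ S.eY := Nat.cast_nonneg _
  have h0 : (0 : ℝ) ≤ D.h := by linarith
  -- log 2 + eL x + log h + log X ≤ h (1 + eL + eY) x ≤ h U K17 x
  have hA : Real.log 2 + S.eL * Real.log s + Real.log D.h + Real.log X ≤ D.h * ((1 + S.eL + S.eY) * Real.log s) := by
    have h2 : Real.log 2 ≤ 1 := by have := Real.log_two_lt_d9; linarith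
    have p1 : 0 ≤ (Real.log s - 1) * D.h := mul_nonneg (by linarith) h0
    have p2 : 0 ≤ ((D.h : ℝ) - 1) * (S.eL * Real.log s) := mul_nonneg (by linarith) (mul_nonneg heL (by linarith))
    have p3 : 0 ≤ ((D.h : ℝ) - 1) * (S.eY * Real.log s) := mul_nonneg (by linarith) (mul_nonneg heY (by linarith))
    nlinarith
  have hB : D.h * ((1 + S.eL + S.eY) * Real.log s) ≤ D.h * (U * ((1 + S.eL + S.eY) * Real.log s)) := by
    refine mul_le_mul_of_nonneg_left ?_ h0
    have : (0 : ℝ) ≤ (1 + S.eL + S.eY) * Real.log s := mul_nonneg (by linarith) (by linarith)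
    nlinarith
  linarith

/-- `exp(L Λ l / q) ≤ exp(h U Λ log s)` for `l ≤ h X`, `L X ≤ U` (dropping the `q`). [folklore] -/
theorem exp_LΛ_div_le (hs : 3 ≤ s) {l : ℕ} {X U : ℝ} (hl : (l : ℝ) ≤ D.h * X) (hX : 1 ≤ X)
    (hLX : (S.Lp s : ℝ) * X ≤ U) :
    Real.exp (S.Lp s * S.Λ * l / S.qp s) ≤ Real.exp (D.h * (U * (S.Λ * Real.log s))) := by
  have hx := one_le_log_nat hs
  have hs1 : 1 ≤ s := by omega
  have hh := D.one_le_h_real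
  have hΛ := S.one_le_Λ
  have hq : (1 : ℝ) ≤ S.qp s := by exact_mod_cast S.qp_pos hs1
  refine Real.exp_le_exp.mpr ?_
  have hL0 : (0 : ℝ) ≤ S.Lp s := Nat.cast_nonneg _
  have hl0 : (0 : ℝ) ≤ l := Nat.cast_nonneg _
  have h0 : (0 : ℝ) ≤ D.h := by linarith
  have hU0 : 0 ≤ U := le_trans (mul_nonneg hL0 (by linarith)) hLX
  have hLΛ : 0 ≤ (S.Lp s : ℝ) * S.Λ := mul_nonneg hL0 (by linarith)
  have hnum : 0 ≤ (S.Lp s : ℝ) * S.Λ * l := mul_nonneg hLΛ hl0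
  have e1 : (S.Lp s : ℝ) * S.Λ * l ≤ S.Lp s * S.Λ * (D.h * X) := mul_le_mul_of_nonneg_left hl hLΛ
  have e2 : D.h * ((S.Lp s * X) * S.Λ) ≤ D.h * (U * S.Λ) :=
    mul_le_mul_of_nonneg_left (mul_le_mul_of_nonneg_right hLX (by linarith)) h0
  have e3 : D.h * (U * S.Λ) ≤ D.h * (U * (S.Λ * Real.log s)) := by
    refine mul_le_mul_of_nonneg_left (mul_le_mul_of_nonneg_left ?_ hU0) h0
    nlinarith
  calc (S.Lp s : ℝ) * S.Λ * l / S.qp s ≤ S.Lp s * S.Λ * l := div_le_self hnum hq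
    _ ≤ S.Lp s * S.Λ * (D.h * X) := e1
    _ = D.h * ((S.Lp s * X) * S.Λ) := by ring
    _ ≤ D.h * (U * (S.Λ * Real.log s)) := e2.trans e3

/-! ### Composite bounds: `Umax`, `P`, `gKB`, `denB`, `growthB`, `errB` -/

/-- Combining exponentials: `exp(hU a x) exp(hU b x) = exp(hU (a+b) x)`. [folklore] -/
theorem exp_hU_mul (a b : ℝ) {h U x : ℝ} :
    Real.exp (h * (U * (a * x))) * Real.exp (h * (U * (b * x))) = Real.exp (h * (U * ((a + b) * x))) := by
  rw [← Real.exp_add]; ring_nf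

/-- **`Umax(L, k, h s) ≤ exp(h U KU log s)`** for `k ≤ 2U`, `L s ≤ U`, `1 ≤ U`.
[cite: BakerTNT1975, Ch. 3 §3 Lemma 4] -/
theorem Umax_le (hs : 3 ≤ s) (h2 : 2 ^ S.J₁ ≤ s) {U : ℝ} (hU : 1 ≤ U) (hkU : (S.kp s : ℝ) ≤ 2 * U)
    (hLs : (S.Lp s : ℝ) * s ≤ U) :
    D.Umax (S.Lp s) (S.kp s) (D.h * s) ≤ Real.exp (D.h * (U * (S.KU * Real.log s))) := by
  have hx := one_le_log_nat hs
  have hs1 : 1 ≤ s := by omega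
  have hsX : (1 : ℝ) ≤ (s : ℝ) := by exact_mod_cast hs1
  have hR : (((D.h * s : ℕ)) : ℝ) ≤ D.h * (s : ℝ) := by push_cast; exact le_rfl
  have hls : Real.log (s : ℝ) ≤ S.eY * Real.log s := by
    have : (1 : ℝ) ≤ S.eY := by unfold Setup.eY; exact_mod_cast (show 1 ≤ S.J₁ + S.gp + 2 by omega)
    nlinarith
  have f1 := D.kp_succ_pow_le hs h2 hU
  have f2 := D.nu_factor_le hs hR hsX hls (S.kp s) hkU
  have f3 := D.four_pow_le hs hR hsX hLs
  have f4 := D.factorial_le hs h2 le_rfl hkU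
  have f5 := D.two_L_sq_pow_le hs hkU
  have f6 := D.prod_aden_pow_le hs hR hsX hLs
  have f7 := D.prod_xH_pow_le hs hR hsX hLs hkU
  have hxH := D.one_le_xH
  unfold Umax
  calc _ ≤ Real.exp (D.h * (U * (S.K12 * Real.log s))) *
        (Real.exp (D.h * (U * (S.K9 * Real.log s))) * Real.exp (D.h * (U * (8 * Real.log s))) *
          Real.exp (D.h * (U * (S.KF * Real.log s))) * Real.exp (D.h * (U * (S.K13 * Real.log s))) *
          Real.exp (D.h * (U * (S.ca * Real.log s)))) *
        Real.exp (D.h * (U * (S.K14 * Real.log s))) := by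
        have hp0 : 0 ≤ ∏ g, (2 * D.xH g * D.xH g) ^ Ncap (S.Lp s) (S.kp s) (D.h * s) g :=
          prod_nonneg fun g _ => by have := hxH g; positivity
        refine mul_le_mul (mul_le_mul f1 ?_ (by positivity) (by positivity)) f7 hp0 (by positivity)
        push_cast at f2 f3 f6 ⊢
        gcongr
    _ = Real.exp (D.h * (U * (S.KU * Real.log s))) := by
        simp only [← Real.exp_add]; unfold Setup.KU; ring_nf

/-- `0 < P`. [folklore] -/
theorem Pb_pos (hs : 1 ≤ s) : 0 < D.Pb s := by
  unfold Pb
  exact mul_pos (lt_of_lt_of_le one_pos (D.one_le_card s)) (lt_of_lt_of_le one_pos (D.one_le_Umax _ _ _ (S.one_le_Lp hs)))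

/-- `1 ≤ P`. [folklore] -/
theorem one_le_Pb (hs : 1 ≤ s) : 1 ≤ D.Pb s := by
  unfold Pb
  exact one_le_mul_of_one_le_of_one_le (D.one_le_card s) (D.one_le_Umax _ _ _ (S.one_le_Lp hs))

/-- **`P ≤ exp(h U KP log s)`** for `k ≤ 2U`, `L s ≤ U`, `1 ≤ U`. [cite: BakerTNT1975, Ch. 3 §3 Lemma 4] -/
theorem Pb_le (hs : 3 ≤ s) (h2 : 2 ^ S.J₁ ≤ s) {U : ℝ} (hU : 1 ≤ U) (hkU : (S.kp s : ℝ) ≤ 2 * U)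
    (hLs : (S.Lp s : ℝ) * s ≤ U) :
    D.Pb s ≤ Real.exp (D.h * (U * (S.KP * Real.log s))) := by
  unfold Pb
  calc _ ≤ Real.exp (D.h * (U * (S.K₁ * Real.log s))) * Real.exp (D.h * (U * (S.KU * Real.log s))) :=
        mul_le_mul (D.card_le hs hU) (D.Umax_le hs h2 hU hkU hLs)
          (le_trans zero_le_one (D.one_le_Umax _ _ _ (S.one_le_Lp (by omega)))) (by positivity)
    _ = _ := by rw [exp_hU_mul]; rfl

/-- **`gKB(L, T, R) ≤ exp(h U KG log s)`** for `T ≤ k`, `T ≤ 2U`, `R ≤ h X`, `1 ≤ X`, `L X ≤ U`.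
[cite: BakerTNT1975, Ch. 3 §3 Lemma 5] -/
theorem gKB_le (hs : 3 ≤ s) (h2 : 2 ^ S.J₁ ≤ s) {T : ℕ} (hT : T ≤ S.kp s) {R : ℕ} {X U : ℝ}
    (hTU : (T : ℝ) ≤ 2 * U) (hR : (R : ℝ) ≤ D.h * X) (hX : 1 ≤ X) (hLX : (S.Lp s : ℝ) * X ≤ U) :
    D.gKB (S.Lp s) T R ≤ Real.exp (D.h * (U * (S.KG * Real.log s))) := by
  have f1 := D.factorial_le hs h2 hT hTU
  have f2 := D.four_pow_le hs hR hX hLX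
  have f3 := D.one_add_pow_le hs T hTU
  have f4 := D.two_L_exp_pow_le' hs T hTU
  have f5 := D.prod_αM_pow_le hs hR hX hLX
  have hM := S.one_le_prod_αM'
  unfold gKB
  calc _ ≤ Real.exp (D.h * (U * (S.KF * Real.log s))) * Real.exp (D.h * (U * (8 * Real.log s))) *
        Real.exp (D.h * (U * (S.K4 * Real.log s))) * Real.exp (D.h * (U * (S.K5 1 * Real.log s))) *
        Real.exp (D.h * (U * (S.cM * Real.log s))) := by
        refine mul_le_mul ?_ f5 (by positivity) (by positivity)
        gcongr
    _ = _ := by simp only [← Real.exp_add]; unfold Setup.KG; ring_nf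

/-- **`denB(L, T, R) ≤ exp(h U KD log s)`** for `T ≤ 2U`, `R ≤ h X`, `log X ≤ eY log s`, `L X ≤ U`.
[cite: BakerTNT1975, Ch. 3 §3 Lemma 5] -/
theorem denB_le (hs : 3 ≤ s) {T R : ℕ} {X U : ℝ} (hTU : (T : ℝ) ≤ 2 * U) (hR : (R : ℝ) ≤ D.h * X)
    (hX : 1 ≤ X) (hlX : Real.log X ≤ S.eY * Real.log s) (hLX : (S.Lp s : ℝ) * X ≤ U) :
    D.denB (S.Lp s) T R ≤ Real.exp (D.h * (U * (S.KD * Real.log s))) := by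
  have f1 := D.nu_factor_le hs hR hX hlX T hTU
  have f2 := D.exp_n1_le hs T hTU
  have f3 := D.prod_aden_pow_le hs hR hX hLX
  unfold denB
  calc _ ≤ Real.exp (D.h * (U * (S.K9 * Real.log s))) * Real.exp (D.h * (U * ((2 * (S.n + 1)) * Real.log s))) *
        Real.exp (D.h * (U * (S.ca * Real.log s))) := by
        push_cast at f1 f2 f3 ⊢
        gcongr
    _ = _ := by simp only [← Real.exp_add]; unfold Setup.KD; ring_nf

/-- **`growthB(L, k, Rc, P) ≤ exp(h U Kgr log s)`** for `Rc ≤ h X`, `1 ≤ X`, `L X ≤ U`, `k ≤ 2U`,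
`L s ≤ U`, `1 ≤ U`. [cite: BakerTNT1975, Ch. 3 §3 Lemma 5] -/
theorem growthB_le (hs : 3 ≤ s) (h2 : 2 ^ S.J₁ ≤ s) {Rc : ℕ} {X U : ℝ} (hU : 1 ≤ U)
    (hkU : (S.kp s : ℝ) ≤ 2 * U) (hLs : (S.Lp s : ℝ) * s ≤ U) (hR : (Rc : ℝ) ≤ D.h * X) (hX : 1 ≤ X)
    (hLX : (S.Lp s : ℝ) * X ≤ U) :
    D.growthB (S.Lp s) (S.kp s) Rc (D.Pb s) ≤ Real.exp (D.h * (U * (S.Kgr * Real.log s))) := by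
  have f0 := D.card_le hs hU
  have fP := D.Pb_le hs h2 hU hkU hLs
  have f1 := D.factorial_le hs h2 le_rfl hkU
  have f2 := D.four_pow_le hs hR hX hLX
  have f3 := D.one_add_pow_le hs (S.kp s) hkU
  have f4 := D.two_L_exp_pow_le hs S.one_le_Λ (S.kp s) hkU
  have f5 := D.exp_L_mul_le hs hR hX hLX
  have hP0 := (D.Pb_pos (s := s) (by omega)).le
  have hΛ0 : 0 ≤ S.Λ := zero_le_one.trans S.one_le_Λ
  have hb0 : 0 ≤ (2 * (S.Lp s : ℝ) * Real.exp D.h * S.Λ) ^ S.kp s := pow_nonneg (by positivity) _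
  have hc0 : 0 ≤ ((S.kp s).factorial : ℝ) * 4 ^ ((Rc + D.h) * (S.Lp s + 1)) * (1 + S.Lp s * Real.exp D.h) ^ S.kp s *
      (2 * S.Lp s * Real.exp D.h * S.Λ) ^ S.kp s * Real.exp (S.Lp s * (S.Λ + 1) * Rc) :=
    mul_nonneg (mul_nonneg (by positivity) hb0) (Real.exp_pos _).le
  unfold growthB
  calc _ ≤ Real.exp (D.h * (U * (S.K₁ * Real.log s))) * Real.exp (D.h * (U * (S.KP * Real.log s))) *
        (Real.exp (D.h * (U * (S.KF * Real.log s))) * Real.exp (D.h * (U * (8 * Real.log s))) *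
          Real.exp (D.h * (U * (S.K4 * Real.log s))) * Real.exp (D.h * (U * (S.K5 S.Λ * Real.log s))) *
          Real.exp (D.h * (U * ((S.Λ + 1) * Real.log s)))) := by
        gcongr
    _ = _ := by simp only [← Real.exp_add]; unfold Setup.Kgr; ring_nf

/-- **`errB(L, T, l, P) ≤ exp(h U KE log s) · |Λ'|`** for `T ≤ k`, `T ≤ 2U`, `l ≤ h X`, `1 ≤ X`,
`log X ≤ eY log s`, `L X ≤ U`, `k ≤ 2U`, `L s ≤ U`, `1 ≤ U`. [cite: BakerTNT1975, Ch. 3 §3 Lemma 4, eq. (5)] -/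
theorem errB_le (hs : 3 ≤ s) (h2 : 2 ^ S.J₁ ≤ s) {T l : ℕ} {X U : ℝ} (hT : T ≤ S.kp s) (hU : 1 ≤ U)
    (hTU : (T : ℝ) ≤ 2 * U) (hkU : (S.kp s : ℝ) ≤ 2 * U) (hLs : (S.Lp s : ℝ) * s ≤ U)
    (hl : (l : ℝ) ≤ D.h * X) (hX : 1 ≤ X) (hlX : Real.log X ≤ S.eY * Real.log s) (hLX : (S.Lp s : ℝ) * X ≤ U) :
    D.errB (S.Lp s) T l (D.Pb s) ≤ Real.exp (D.h * (U * (S.KE * Real.log s))) * ‖D.Λ'‖ := by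
  have fΛ := D.Λ_pow_le hs T hTU
  have f0 := D.card_le hs hU
  have fP := D.Pb_le hs h2 hU hkU hLs
  have fG := D.gKB_le hs h2 hT hTU hl hX hLX
  have f2 := D.two_L_l_le hs hl hX hlX hU
  have hP0 := (D.Pb_pos (s := s) (by omega)).le
  have hG0 := D.gKB_nonneg (S.Lp s) T l
  have hΛ := S.one_le_Λ
  unfold errB
  calc S.Λ ^ T * ((Fintype.card (Idx S.n (S.Lp s) D.h) : ℝ) * D.Pb s * D.gKB (S.Lp s) T l) * (2 * S.Lp s * l * ‖D.Λ'‖)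
      = S.Λ ^ T * ((Fintype.card (Idx S.n (S.Lp s) D.h) : ℝ) * D.Pb s * D.gKB (S.Lp s) T l) * (2 * S.Lp s * l) * ‖D.Λ'‖ := by ring
    _ ≤ Real.exp (D.h * (U * ((2 * S.Λ) * Real.log s))) *
        (Real.exp (D.h * (U * (S.K₁ * Real.log s))) * Real.exp (D.h * (U * (S.KP * Real.log s))) *
          Real.exp (D.h * (U * (S.KG * Real.log s)))) * Real.exp (D.h * (U * (S.K17 * Real.log s))) * ‖D.Λ'‖ := by
        gcongr
    _ = _ := by simp only [← Real.exp_add]; unfold Setup.KE; ring_nf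

end Data

end Literature.NumberTheory.Transcendental.Baker1975.Ch3




/-!
# Baker 1975, Ch. 3 — numerical estimates II: interpolation constants, units, and the key inequality

Support for the proof of Theorem 3.1 of A. Baker, *Transcendental Number Theory* (1975), Ch. 3
(`Literature.NumberTheory.Transcendental.baker1975_thm_3_1`); sequel to `BakerQuantNumericsA.lean`.

* `hermH_le` — the Hermite interpolant bound `𝓗(t) ≤ ε · exp(h V KH log s)`: the factorial in
  `Λ₀ = (R₁-1)!/2^{R₁-1}` cancels the `log h` coming from `(2(t+R₁))^{S R₁}` (this is where the
  nodes `1, …, R₁` with `R₁ ∝ h` are essential, Baker p. 35).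
* `liouMain_le`, `denθ_le`, `Mθ_le`, `errθ_le`, `Ymain_le` — the remaining composite bounds.
* `ratio_le`, `ratio_pow_le_exp` — `((ρ+R₁)/(Rc-R₁))^{S R₁} ≤ exp(-h V (gp log s - log 4))`, the
  gain of the extrapolation (Baker's `2^{-p(K)RS}` on p. 36, eq. after (10)).
* the "units" `U_J = Sord(J+1) s^J`, `U_F = s^{ek+J₁}` dominating all parameters at stage `J`
  resp. in the final step, and
* `key_ineq` — the abstract form of "the estimates are plainly inconsistent".

Everything here is proved.

## References

* A. Baker, *Transcendental Number Theory*, Cambridge Univ. Press 1975, Ch. 3 §3 (pp. 35–37).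
  [BakerTNT1975]
-/

noncomputable section

open Complex Finset Polynomial NumberField Real

namespace Literature.NumberTheory.Transcendental.Baker1975.Ch3

namespace Setup

variable (S : Setup)

/-- `n + 3 ≤ gp` (and so `3 ≤ gp`, `n ≤ gp`). [folklore] -/
theorem n_add_three_le_gp : S.n + 3 ≤ S.gp := by
  unfold gp
  have h1 : 1 ≤ (S.D₀ + 1) ^ 2 := Nat.one_le_pow _ _ (Nat.succ_pos _)
  have h2 : S.n + 2 ≤ (S.n + 2) ^ 2 := Nat.le_self_pow (by norm_num) _
  calc S.n + 3 ≤ 1000 * 1 * (S.n + 2) := by omega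
    _ ≤ 1000 * (S.D₀ + 1) ^ 2 * (S.n + 2) ^ 2 := Nat.mul_le_mul (Nat.mul_le_mul_left _ h1) h2

/-- `3 ≤ gp`. [folklore] -/
theorem three_le_gp : 3 ≤ S.gp := le_trans (by omega) S.n_add_three_le_gp

end Setup

-- see `BakerQuantNumericsA`: never unfold `gp` definitionally below this line
attribute [local irreducible] Setup.gp

/-! ### The key inequality in abstract form -/

/-- **"The estimates are plainly inconsistent"** (Baker pp. 35–37) in abstract form: if the three
`Λ'`-proportional terms are `≤ |Λ'| e^{hAᵢ}` with `|Λ'| ≤ e^{-h Cx}`, the growth term is `≤ e^{hG}`,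
the extrapolation gain is `≤ e^{-h·dec}`, the main lower bound is `≥ e^{-hΞ}`, and
`Aᵢ + Ξ + 2 ≤ Cx`, `G + Ξ + 2 ≤ dec`, then `H₁ + (Gr + H₂)·gain + E < X`. [cite: BakerTNT1975, Ch. 3 §3 Lemma 6] -/
theorem key_ineq {h Ξ Cx A₁ A₂ A₃ G dec Λn H₁ H₂ Gr gain E X : ℝ} (hh : 1 ≤ h)
    (hΛn : Λn ≤ Real.exp (-(h * Cx)))
    (hH₁ : H₁ ≤ Λn * Real.exp (h * A₁)) (hH₂0 : 0 ≤ H₂) (hH₂ : H₂ ≤ Λn * Real.exp (h * A₂))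
    (hGr : Gr ≤ Real.exp (h * G)) (hg0 : 0 ≤ gain) (hg1 : gain ≤ 1)
    (hg : gain ≤ Real.exp (-(h * dec))) (hE : E ≤ Λn * Real.exp (h * A₃)) (hX : Real.exp (-(h * Ξ)) ≤ X)
    (c₁ : A₁ + Ξ + 2 ≤ Cx) (c₂ : A₂ + Ξ + 2 ≤ Cx) (c₃ : A₃ + Ξ + 2 ≤ Cx) (c₄ : G + Ξ + 2 ≤ dec) :
    H₁ + (Gr + H₂) * gain + E < X := by
  set Y := Real.exp (-(h * Ξ)) with hY
  have hY0 : 0 < Y := Real.exp_pos _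
  have he2 : Real.exp (-2 : ℝ) < 1 / 5 := by
    have h1 : Real.exp (1 : ℝ) * Real.exp 1 = Real.exp 2 := by rw [← Real.exp_add]; norm_num
    have h2 : (2.7 : ℝ) < Real.exp 1 := lt_trans (by norm_num) Real.exp_one_gt_d9
    rw [Real.exp_neg, inv_lt_comm₀ (Real.exp_pos 2) (by norm_num)]
    nlinarith [Real.exp_pos (1 : ℝ)]
  -- each small term is ≤ Y e^{-2}
  have bound : ∀ {A T : ℝ}, T ≤ Λn * Real.exp (h * A) → A + Ξ + 2 ≤ Cx → T ≤ Y * Real.exp (-2) := by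
    intro A T hT hA
    refine hT.trans ?_
    calc Λn * Real.exp (h * A) ≤ Real.exp (-(h * Cx)) * Real.exp (h * A) :=
          mul_le_mul_of_nonneg_right hΛn (Real.exp_pos _).le
      _ = Real.exp (-(h * Cx) + h * A) := by rw [Real.exp_add]
      _ ≤ Real.exp (-(h * Ξ) + -2) := Real.exp_le_exp.mpr (by nlinarith)
      _ = Y * Real.exp (-2) := by rw [Real.exp_add]
  have b₁ := bound hH₁ c₁
  have b₂ := bound hH₂ c₂
  have b₃ := bound hE c₃
  have b₄ : Gr * gain ≤ Y * Real.exp (-2) := by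
    calc Gr * gain ≤ Real.exp (h * G) * Real.exp (-(h * dec)) := mul_le_mul hGr hg hg0 (Real.exp_pos _).le
      _ = Real.exp (h * G + -(h * dec)) := by rw [Real.exp_add]
      _ ≤ Real.exp (-(h * Ξ) + -2) := Real.exp_le_exp.mpr (by nlinarith)
      _ = Y * Real.exp (-2) := by rw [Real.exp_add]
  have b₅ : H₂ * gain ≤ Y * Real.exp (-2) := le_trans (mul_le_of_le_one_right hH₂0 hg1) b₂
  have hsum : H₁ + (Gr + H₂) * gain + E ≤ 4 * (Y * Real.exp (-2)) := by nlinarith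
  calc H₁ + (Gr + H₂) * gain + E ≤ 4 * (Y * Real.exp (-2)) := hsum
    _ < Y := by nlinarith
    _ ≤ X := hX

/-! ### The extrapolation gain -/

/-- `(ρ + R₁)/(Rc - R₁) ≤ 4/M` when `0 < R₁ ≤ ρ`, `2 ≤ M`, `M ρ ≤ Rc`. [folklore] -/
theorem ratio_le {R₁ ρ Rc M : ℝ} (hR₁ : 0 < R₁) (h1 : R₁ ≤ ρ) (hM : 2 ≤ M) (hRc : M * ρ ≤ Rc) :
    (ρ + R₁) / (Rc - R₁) ≤ 4 / M := by
  have hρ : 0 < ρ := lt_of_lt_of_le hR₁ h1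
  have hden : 0 < Rc - R₁ := by nlinarith
  rw [div_le_div_iff₀ hden (by linarith)]
  nlinarith

/-- `0 ≤ (ρ + R₁)/(Rc - R₁)` under the same hypotheses. [folklore] -/
theorem ratio_nonneg {R₁ ρ Rc M : ℝ} (hR₁ : 0 < R₁) (h1 : R₁ ≤ ρ) (hM : 2 ≤ M) (hRc : M * ρ ≤ Rc) :
    0 ≤ (ρ + R₁) / (Rc - R₁) := by
  have hρ : 0 < ρ := lt_of_lt_of_le hR₁ h1
  have hden : 0 < Rc - R₁ := by nlinarith
  positivity

/-- **The gain**: `((ρ + R₁)/(Rc - R₁))^N ≤ exp(-(N (log M - log 4)))` and `≤ 1` (`M ≥ 4`).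
[cite: BakerTNT1975, Ch. 3 §3 Lemma 6] -/
theorem ratio_pow_le_exp {R₁ ρ Rc M : ℝ} (hR₁ : 0 < R₁) (h1 : R₁ ≤ ρ) (hM : 4 ≤ M) (hRc : M * ρ ≤ Rc) (N : ℕ) :
    ((ρ + R₁) / (Rc - R₁)) ^ N ≤ Real.exp (-((N : ℝ) * (Real.log M - Real.log 4))) ∧
      ((ρ + R₁) / (Rc - R₁)) ^ N ≤ 1 := by
  have hr := ratio_le hR₁ h1 (by linarith) hRc
  have hr0 := ratio_nonneg hR₁ h1 (by linarith) hRc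
  have h4M : 4 / M ≤ 1 := by rw [div_le_one (by linarith)]; exact hM
  refine ⟨?_, pow_le_one₀ hr0 (hr.trans h4M)⟩
  calc ((ρ + R₁) / (Rc - R₁)) ^ N ≤ (4 / M) ^ N := pow_le_pow_left₀ hr0 hr N
    _ = Real.exp (-((N : ℝ) * (Real.log M - Real.log 4))) := by
        rw [pow_eq_exp_mul_log (by positivity), Real.log_div (by norm_num) (by linarith)]
        ring_nf

/-! ### The Hermite interpolant bound: the factorial cancels `log h` -/

/-- `Λ₀(R₁) ≥ exp(m log m - m - m log 2)`, `m = R₁ - 1 ≥ 1` (from `mᵐ/m! ≤ eᵐ`). [folklore] -/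
theorem exp_le_Λ₀ {R₁ : ℕ} (hR : 2 ≤ R₁) :
    Real.exp (((R₁ - 1 : ℕ) : ℝ) * Real.log ((R₁ - 1 : ℕ) : ℝ) - ((R₁ - 1 : ℕ) : ℝ) - ((R₁ - 1 : ℕ) : ℝ) * Real.log 2) ≤ Data.Λ₀ R₁ := by
  set m : ℕ := R₁ - 1 with hm
  have hm1 : 1 ≤ m := by omega
  have hm0 : (0 : ℝ) < m := by exact_mod_cast hm1
  have hfac : (0 : ℝ) < m.factorial := by exact_mod_cast Nat.factorial_pos m
  have key := Real.pow_div_factorial_le_exp (m : ℝ) (by positivity) m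
  -- m^m / m! ≤ e^m  ⇒  m^m e^{-m} ≤ m!
  rw [div_le_iff₀ hfac] at key
  unfold Data.Λ₀
  rw [← hm, le_div_iff₀ (by positivity)]
  have h1 : Real.exp ((m : ℝ) * Real.log m - m - m * Real.log 2) * (2 : ℝ) ^ m =
      (m : ℝ) ^ m * Real.exp (-(m : ℝ)) := by
    rw [pow_eq_exp_mul_log hm0, pow_eq_exp_mul_log (by norm_num : (0:ℝ) < 2), ← Real.exp_add, ← Real.exp_add]
    ring_nf
  rw [h1]
  calc (m : ℝ) ^ m * Real.exp (-(m : ℝ)) ≤ (Real.exp m * m.factorial) * Real.exp (-(m : ℝ)) :=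
        mul_le_mul_of_nonneg_right key (Real.exp_pos _).le
    _ = m.factorial := by rw [mul_comm (Real.exp _), mul_assoc, ← Real.exp_add]; simp

/-- Pure arithmetic for `hermH_le`: the prefactor exponent. [folklore] -/
theorem hermH_aux1 {lR lS h V x eY ek : ℝ} (hh : 1 ≤ h) (hx : 1 ≤ x) (hV1 : 1 ≤ V) (heY : 0 ≤ eY)
    (hek : 0 ≤ ek) (hlR : lR ≤ (h - 1) + eY * x) (hlS : lS ≤ (ek + 1) * x) :
    lR + lS ≤ h * (V * ((ek + eY + 2) * x)) := by
  have p1 : 0 ≤ (x - 1) * h := mul_nonneg (by linarith) (by linarith)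
  have p2 : 0 ≤ (h - 1) * ((eY + ek + 1) * x) := mul_nonneg (by linarith) (mul_nonneg (by linarith) (by linarith))
  have p3 : 0 ≤ (V - 1) * (h * ((ek + eY + 2) * x)) :=
    mul_nonneg (by linarith) (mul_nonneg (by linarith) (mul_nonneg (by linarith) (by linarith)))
  linarith

/-- Pure arithmetic for `hermH_le`: the interpolation exponent (`log h` cancels). [folklore] -/
theorem hermH_aux2 {P Sd m a y ℓ₁ lm c h V X₁ x eY : ℝ}
    (hP0 : 0 ≤ P) (hSd0 : 0 ≤ Sd) (hSm0 : 0 ≤ Sd * m) (hy0 : 0 ≤ y) (hx : 1 ≤ x) (hh : 1 ≤ h)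
    (hSdV : Sd * X₁ ≤ V) (hV0 : 0 ≤ V) (hPdef : P = h * (Sd * X₁))
    (hℓ₁ : ℓ₁ ≤ 2 * c + a + y) (hc0 : 0 ≤ c) (hc : c ≤ 0.7) (hlogm : a - c ≤ lm) (ha : a ≤ h - 1)
    (hmP : Sd * m ≤ P) (he4 : Sd * m * a = P * a - Sd * a) (hy : y = eY * x) (hSdVx : Sd ≤ V * x) :
    P * ℓ₁ + Sd * c - (Sd * m * lm - Sd * m - Sd * m * c) ≤ h * (V * ((6 + eY) * x)) := by
  have e1 : P * ℓ₁ ≤ P * (2 * c + a + y) := mul_le_mul_of_nonneg_left hℓ₁ hP0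
  have e2 : Sd * m * (a - c) ≤ Sd * m * lm := mul_le_mul_of_nonneg_left hlogm hSm0
  have f1 : P * c ≤ P * 0.7 := mul_le_mul_of_nonneg_left hc hP0
  have f2 : Sd * c ≤ Sd * 0.7 := mul_le_mul_of_nonneg_left hc hSd0
  have f3 : Sd * a ≤ Sd * (h - 1) := mul_le_mul_of_nonneg_left ha hSd0
  have f4 : Sd * m * (2 * c + 1) ≤ P * (2 * c + 1) := mul_le_mul_of_nonneg_right hmP (by linarith)
  have f5 : 0 ≤ P * y := mul_nonneg hP0 hy0
  have step1 : P * ℓ₁ + Sd * c - (Sd * m * lm - Sd * m - Sd * m * c) ≤ P * (4 + y) + Sd * h := by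
    linarith
  have h0 : 0 ≤ h := by linarith
  have heY : 0 ≤ eY * x := by rw [← hy]; exact hy0
  have q2 : 4 + y ≤ (4 + eY) * x := by rw [hy]; nlinarith
  have q1 : Sd * X₁ * (4 + y) ≤ V * (4 + y) := mul_le_mul_of_nonneg_right hSdV (by linarith)
  have q3 : V * (4 + y) ≤ V * ((4 + eY) * x) := mul_le_mul_of_nonneg_left q2 hV0
  have q5 : h * (Sd * X₁ * (4 + y)) ≤ h * (V * ((4 + eY) * x)) := mul_le_mul_of_nonneg_left (q1.trans q3) h0
  have q6 : h * Sd ≤ h * (V * x) := mul_le_mul_of_nonneg_left hSdVx h0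
  have q7 : 0 ≤ h * (V * x) := mul_nonneg h0 (mul_nonneg hV0 (by linarith))
  calc P * ℓ₁ + Sd * c - (Sd * m * lm - Sd * m - Sd * m * c) ≤ P * (4 + y) + Sd * h := step1
    _ = h * (Sd * X₁ * (4 + y)) + h * Sd := by rw [hPdef]; ring
    _ ≤ h * (V * ((4 + eY) * x)) + h * (V * x) := add_le_add q5 q6
    _ ≤ h * (V * ((6 + eY) * x)) := by linarith

namespace Data

variable {S : Setup} (D : Data S) {s : ℕ}

/-- **The Hermite interpolant bound** `𝓗(t) ≤ ε · exp(h V KH log s)` for `R₁ = h X₁`, `1 ≤ Sd ≤ k`,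
`Sd X₁ ≤ V`, `Sd ≤ V`, `R₁ ≤ t ≤ h Xt`, `log Xt ≤ eY log s` (the `log h` from
`(2(t+R₁))^{Sd R₁}` is cancelled by `(R₁-1)!^{Sd}` in `Λ₀^{Sd}`). [cite: BakerTNT1975, Ch. 3 §3 Lemma 6] -/
theorem hermH_le (hs : 3 ≤ s) (h2J : 2 ^ S.J₁ ≤ s) {R₁ Sd : ℕ} {X₁ Xt V t ε : ℝ}
    (hR₁ : (R₁ : ℝ) = D.h * X₁) (hX₁ : 1 ≤ X₁) (hSd1 : 1 ≤ Sd) (hSdk : Sd ≤ S.kp s)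
    (hSdV : (Sd : ℝ) * X₁ ≤ V) (hSdV' : (Sd : ℝ) ≤ V) (ht : (R₁ : ℝ) ≤ t) (htX : t ≤ D.h * Xt)
    (hlXt : Real.log Xt ≤ S.eY * Real.log s) (hε : 0 ≤ ε) :
    hermH R₁ Sd ε t ≤ ε * Real.exp (D.h * (V * (S.KH * Real.log s))) := by
  have hx := one_le_log_nat hs
  have hs1 : 1 ≤ s := by omega
  have hh := D.one_le_h_real
  have hh2 : (2 : ℝ) ≤ D.h := by exact_mod_cast D.two_le_h
  have hlogh := D.log_h_le
  have h0 : (0 : ℝ) ≤ D.h := by linarith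
  have hhX₁ : (D.h : ℝ) ≤ D.h * X₁ := by have := mul_le_mul_of_nonneg_left hX₁ h0; simpa using this
  have hR₁2r : (2 : ℝ) ≤ R₁ := by rw [hR₁]; linarith
  have hR₁2 : 2 ≤ R₁ := by exact_mod_cast hR₁2r
  have hR₁pos : (0 : ℝ) < R₁ := by linarith
  have ht0 : 0 < t := by linarith
  have hXt1 : 1 ≤ Xt := by
    have h1 : D.h * 1 ≤ D.h * Xt := by rw [mul_one]; linarith
    exact le_of_mul_le_mul_left h1 (by linarith)
  have hSdr : (1 : ℝ) ≤ Sd := by exact_mod_cast hSd1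
  have hSd0 : (0 : ℝ) ≤ Sd := by linarith
  have hV1 : 1 ≤ V := le_trans hSdr hSdV'
  have hV0 : 0 ≤ V := by linarith
  have heY : (0 : ℝ) ≤ S.eY := Nat.cast_nonneg _
  have hek : (0 : ℝ) ≤ S.ek := Nat.cast_nonneg _
  -- (i) the prefactor R₁ Sd
  have hpre : (R₁ : ℝ) * Sd ≤ Real.exp (D.h * (V * ((S.ek + S.eY + 2) * Real.log s))) := by
    have hX₁t : X₁ ≤ Xt := by
      have : D.h * X₁ ≤ D.h * Xt := by rw [← hR₁]; exact ht.trans htX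
      exact le_of_mul_le_mul_left this (by linarith)
    have hlR : Real.log R₁ ≤ (D.h - 1) + S.eY * Real.log s := by
      rw [hR₁, Real.log_mul (by linarith) (by linarith)]
      have : Real.log X₁ ≤ Real.log Xt := Real.log_le_log (by linarith) hX₁t
      linarith
    have hlS : Real.log Sd ≤ (S.ek + 1) * Real.log s := S.log_le_of_le_kp hs1 h2J hSd1 hSdk
    have hprod : (R₁ : ℝ) * Sd = Real.exp (Real.log R₁ + Real.log Sd) := by
      rw [Real.exp_add, Real.exp_log hR₁pos, Real.exp_log (by linarith)]
    rw [hprod]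
    exact Real.exp_le_exp.mpr (hermH_aux1 hh hx hV1 heY hek hlR hlS)
  -- (ii) the interpolation part B C / Λ₀^Sd
  set m : ℕ := R₁ - 1 with hm
  have hm1 : 1 ≤ m := by omega
  have hmr : (m : ℝ) = R₁ - 1 := by
    rw [hm, Nat.cast_sub (by omega)]; simp
  have hm0 : (0 : ℝ) < m := by exact_mod_cast hm1
  have hΛ₀ := exp_le_Λ₀ hR₁2
  rw [← hm] at hΛ₀
  have hΛ₀pos := Λ₀_pos R₁
  have hDn : Real.exp (Sd * ((m : ℝ) * Real.log m - m - m * Real.log 2)) ≤ Λ₀ R₁ ^ Sd := by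
    calc Real.exp (Sd * ((m : ℝ) * Real.log m - m - m * Real.log 2))
        = Real.exp ((m : ℝ) * Real.log m - m - m * Real.log 2) ^ Sd := by rw [← Real.exp_nat_mul]
      _ ≤ Λ₀ R₁ ^ Sd := pow_le_pow_left₀ (Real.exp_pos _).le hΛ₀ Sd
  have h2tR : 0 < 2 * (t + R₁) := by linarith
  have hB : (2 * (t + R₁)) ^ (Sd * R₁) = Real.exp (((Sd : ℝ) * R₁) * Real.log (2 * (t + R₁))) := by
    rw [pow_eq_exp_mul_log h2tR, Nat.cast_mul]
  have hC : ((2 : ℝ) / 1) ^ Sd = Real.exp (Sd * Real.log 2) := by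
    rw [div_one, pow_eq_exp_mul_log (by norm_num)]
  -- the logarithmic facts
  have hlog4 : Real.log 4 = 2 * Real.log 2 := by
    rw [show (4 : ℝ) = 2 ^ 2 by norm_num, Real.log_pow]; push_cast; ring
  have hℓ₁ : Real.log (2 * (t + R₁)) ≤ 2 * Real.log 2 + Real.log D.h + S.eY * Real.log s := by
    have h4t : 2 * (t + R₁) ≤ 4 * (D.h * Xt) := by linarith
    have hhXt : 0 < D.h * Xt := mul_pos (by linarith) (by linarith)
    calc Real.log (2 * (t + R₁)) ≤ Real.log (4 * (D.h * Xt)) := Real.log_le_log h2tR h4t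
      _ = Real.log 4 + Real.log D.h + Real.log Xt := by
          rw [Real.log_mul (by norm_num) hhXt.ne', Real.log_mul (by linarith) (by linarith)]; ring
      _ ≤ _ := by linarith
  have hlogm : Real.log D.h - Real.log 2 ≤ Real.log m := by
    have h1 : (D.h : ℝ) / 2 ≤ m := by rw [hmr, hR₁]; linarith
    have h2 : Real.log ((D.h : ℝ) / 2) = Real.log D.h - Real.log 2 := Real.log_div (by linarith) (by norm_num)
    rw [← h2]; exact Real.log_le_log (by linarith) h1
  have hlog2 : Real.log 2 ≤ 0.7 := by have := Real.log_two_lt_d9; linarith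
  have hlog2' : 0 ≤ Real.log 2 := Real.log_nonneg (by norm_num)
  -- the exponent inequality
  have hexp : (Sd : ℝ) * R₁ * Real.log (2 * (t + R₁)) + Sd * Real.log 2 -
      Sd * ((m : ℝ) * Real.log m - m - m * Real.log 2) ≤ D.h * (V * ((6 + S.eY) * Real.log s)) := by
    have hPdef : (Sd : ℝ) * R₁ = D.h * (Sd * X₁) := by rw [hR₁]; ring
    have hmP : (Sd : ℝ) * m ≤ Sd * R₁ := mul_le_mul_of_nonneg_left (by linarith) hSd0
    have he4 : (Sd : ℝ) * m * Real.log D.h = Sd * R₁ * Real.log D.h - Sd * Real.log D.h := by rw [hmr]; ring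
    have hSdVx : (Sd : ℝ) ≤ V * Real.log s := by
      have : 0 ≤ V * (Real.log s - 1) := mul_nonneg hV0 (by linarith)
      linarith
    have hP0 : (0 : ℝ) ≤ Sd * R₁ := mul_nonneg hSd0 hR₁pos.le
    have hSm0 : (0 : ℝ) ≤ Sd * m := mul_nonneg hSd0 hm0.le
    have hy0 : (0 : ℝ) ≤ S.eY * Real.log s := mul_nonneg heY (by linarith)
    have key := hermH_aux2 (lm := Real.log m) hP0 hSd0 hSm0 hy0 hx hh
      hSdV hV0 hPdef hℓ₁ hlog2' hlog2 hlogm hlogh hmP he4 rfl hSdVx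
    have hE : (Sd : ℝ) * ((m : ℝ) * Real.log m - m - m * Real.log 2) =
        Sd * m * Real.log m - Sd * m - Sd * m * Real.log 2 := by ring
    rw [hE]; linarith only [key]
  -- assemble
  have hKH : (S.ek + S.eY + 2) + (6 + S.eY) ≤ S.KH := by unfold Setup.KH; linarith
  unfold hermH
  have hBCD : (2 * (t + R₁)) ^ (Sd * R₁) * ((2 : ℝ) / 1) ^ Sd / Λ₀ R₁ ^ Sd ≤
      Real.exp (D.h * (V * ((6 + S.eY) * Real.log s))) := by
    rw [div_le_iff₀ (pow_pos hΛ₀pos _), hB, hC]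
    calc Real.exp (((Sd : ℝ) * R₁) * Real.log (2 * (t + R₁))) * Real.exp (Sd * Real.log 2)
        = Real.exp (D.h * (V * ((6 + S.eY) * Real.log s))) *
            Real.exp ((Sd : ℝ) * R₁ * Real.log (2 * (t + R₁)) + Sd * Real.log 2 - D.h * (V * ((6 + S.eY) * Real.log s))) := by
          rw [← Real.exp_add, ← Real.exp_add]; ring_nf
      _ ≤ Real.exp (D.h * (V * ((6 + S.eY) * Real.log s))) * Real.exp (Sd * ((m : ℝ) * Real.log m - m - m * Real.log 2)) := by
          refine mul_le_mul_of_nonneg_left (Real.exp_le_exp.mpr ?_) (Real.exp_pos _).le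
          linarith only [hexp]
      _ ≤ Real.exp (D.h * (V * ((6 + S.eY) * Real.log s))) * Λ₀ R₁ ^ Sd :=
          mul_le_mul_of_nonneg_left hDn (Real.exp_pos _).le
  have hBCD0 : 0 ≤ (2 * (t + R₁)) ^ (Sd * R₁) * ((2 : ℝ) / 1) ^ Sd / Λ₀ R₁ ^ Sd :=
    div_nonneg (mul_nonneg (pow_nonneg h2tR.le _) (pow_nonneg (by norm_num) _)) (pow_nonneg hΛ₀pos.le _)
  calc (R₁ : ℝ) * Sd * ε * (2 * (t + R₁)) ^ (Sd * R₁) * (2 / 1) ^ Sd / Λ₀ R₁ ^ Sd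
      = ε * ((R₁ * Sd) * ((2 * (t + R₁)) ^ (Sd * R₁) * (2 / 1) ^ Sd / Λ₀ R₁ ^ Sd)) := by ring
    _ ≤ ε * (Real.exp (D.h * (V * ((S.ek + S.eY + 2) * Real.log s))) * Real.exp (D.h * (V * ((6 + S.eY) * Real.log s)))) :=
        mul_le_mul_of_nonneg_left (mul_le_mul hpre hBCD hBCD0 (Real.exp_pos _).le) hε
    _ ≤ ε * Real.exp (D.h * (V * (S.KH * Real.log s))) := by
        refine mul_le_mul_of_nonneg_left ?_ hε
        rw [← Real.exp_add]
        refine Real.exp_le_exp.mpr ?_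
        have h0' : 0 ≤ D.h * (V * Real.log s) := mul_nonneg h0 (mul_nonneg hV0 (by linarith))
        have := mul_le_mul_of_nonneg_left hKH h0'
        linarith only [this]

/-- `0 ≤ hermH` for `ε ≥ 0`. [folklore] -/
theorem hermH_nonneg (R₁ Sd : ℕ) {ε t : ℝ} (hε : 0 ≤ ε) (ht : 0 ≤ t) : 0 ≤ hermH R₁ Sd ε t := by
  have := Λ₀_pos R₁
  unfold hermH; positivity

/-! ### The main Liouville term and the final-stage composites -/

/-- **The main Liouville term**: `ℓ⁻^T denB^{D₀} (#Idx P gKB)^{D₀} ≤ exp(h U KΞ log s)`.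
[cite: BakerTNT1975, Ch. 3 §3 Lemma 5, eq. (6)] -/
theorem liouMain_le (hs : 3 ≤ s) (h2 : 2 ^ S.J₁ ≤ s) {T R : ℕ} {X U : ℝ} (hT : T ≤ S.kp s) (hU : 1 ≤ U)
    (hTU : (T : ℝ) ≤ 2 * U) (hkU : (S.kp s : ℝ) ≤ 2 * U) (hLs : (S.Lp s : ℝ) * s ≤ U)
    (hR : (R : ℝ) ≤ D.h * X) (hX : 1 ≤ X) (hlX : Real.log X ≤ S.eY * Real.log s) (hLX : (S.Lp s : ℝ) * X ≤ U) :
    S.ℓinv ^ T * (D.denB (S.Lp s) T R ^ S.D₀ *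
      ((Fintype.card (Idx S.n (S.Lp s) D.h) : ℝ) * D.Pb s * D.gKB (S.Lp s) T R) ^ S.D₀) ≤
      Real.exp (D.h * (U * (S.KΞ * Real.log s))) := by
  have f1 := D.ℓinv_pow_le hs T hTU
  have f2 := D.denB_le hs hTU hR hX hlX hLX
  have f3 := D.card_le hs hU
  have f4 := D.Pb_le hs h2 hU hkU hLs
  have f5 := D.gKB_le hs h2 hT hTU hR hX hLX
  have hP0 := (D.Pb_pos (s := s) (by omega)).le
  have hG0 := D.gKB_nonneg (S.Lp s) T R
  have hden0 : 0 ≤ D.denB (S.Lp s) T R := by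
    have := one_le_prod_aden S; unfold denB; positivity
  have g1 : D.denB (S.Lp s) T R ^ S.D₀ ≤ Real.exp (D.h * (U * (S.KD * Real.log s))) ^ S.D₀ :=
    pow_le_pow_left₀ hden0 f2 _
  have g2 : ((Fintype.card (Idx S.n (S.Lp s) D.h) : ℝ) * D.Pb s * D.gKB (S.Lp s) T R) ^ S.D₀ ≤
      (Real.exp (D.h * (U * (S.K₁ * Real.log s))) * Real.exp (D.h * (U * (S.KP * Real.log s))) *
        Real.exp (D.h * (U * (S.KG * Real.log s)))) ^ S.D₀ :=
    pow_le_pow_left₀ (by positivity) (mul_le_mul (mul_le_mul f3 f4 hP0 (Real.exp_pos _).le) f5 hG0 (by positivity)) _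
  calc _ ≤ Real.exp (D.h * (U * ((2 * S.cℓ) * Real.log s))) * (Real.exp (D.h * (U * (S.KD * Real.log s))) ^ S.D₀ *
        (Real.exp (D.h * (U * (S.K₁ * Real.log s))) * Real.exp (D.h * (U * (S.KP * Real.log s))) *
          Real.exp (D.h * (U * (S.KG * Real.log s)))) ^ S.D₀) :=
        mul_le_mul f1 (mul_le_mul g1 g2 (by positivity) (by positivity)) (by positivity) (Real.exp_pos _).le
    _ = Real.exp (D.h * (U * (S.KΞ * Real.log s))) := by
        simp only [← Real.exp_nat_mul, ← Real.exp_add]; unfold Setup.KΞ; ring_nf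

/-- `(denθ : ℝ) = (q²)^{h(L+1)} (∏ aᵢ)^{L l}`. [folklore] -/
theorem denθ_cast (L q l : ℕ) : ((D.denθ L q l : ℕ) : ℝ) =
    ((q : ℝ) ^ 2) ^ (D.h * (L + 1)) * ((∏ i, S.aden i : ℕ) : ℝ) ^ (L * l) := by
  unfold denθ; push_cast; ring

/-- **`denθ(L, q, l) ≤ exp(h U Kdθ log s)`** for `l ≤ h X`, `L X ≤ U`, `L ≤ U`. [cite: BakerTNT1975, Ch. 3 §3 Lemma 7] -/
theorem denθ_le (hs : 3 ≤ s) {l : ℕ} {X U : ℝ} (hl : (l : ℝ) ≤ D.h * X) (hX : 1 ≤ X)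
    (hLX : (S.Lp s : ℝ) * X ≤ U) (hLU : (S.Lp s : ℝ) ≤ U) :
    ((D.denθ (S.Lp s) (S.qp s) l : ℕ) : ℝ) ≤ Real.exp (D.h * (U * (S.Kdθ * Real.log s))) := by
  have hx := one_le_log_nat hs
  have hs1 : 1 ≤ s := by omega
  have hs0 : (0 : ℝ) < s := by exact_mod_cast hs1
  have hh := D.one_le_h_real
  have hL := S.one_le_Lp_real hs1
  have f2 := D.prod_aden_pow_le hs hl hX hLX
  rw [D.denθ_cast]
  have hq : ((S.qp s : ℝ) ^ 2) ^ (D.h * (S.Lp s + 1)) ≤ Real.exp (D.h * (U * ((4 * (S.eL + 1)) * Real.log s))) := by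
    have hqc : (S.qp s : ℝ) = (s : ℝ) ^ (S.eL + 1) := by unfold Setup.qp; push_cast; rfl
    have hq0 : (0 : ℝ) < (S.qp s : ℝ) ^ 2 := by rw [hqc]; positivity
    rw [pow_eq_exp_mul_log hq0]
    refine Real.exp_le_exp.mpr ?_
    rw [Real.log_pow, hqc, Real.log_pow]
    push_cast
    have heL : (0 : ℝ) ≤ S.eL := Nat.cast_nonneg _
    have h0 : (0 : ℝ) ≤ D.h := by linarith
    have e1 : ((S.Lp s : ℝ) + 1) ≤ 2 * U := by linarith
    have e2 : 0 ≤ (S.eL + 1) * Real.log s := by positivity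
    calc (D.h : ℝ) * (S.Lp s + 1) * (2 * ((S.eL + 1) * Real.log s))
        ≤ D.h * (2 * U) * (2 * ((S.eL + 1) * Real.log s)) :=
          mul_le_mul_of_nonneg_right (mul_le_mul_of_nonneg_left e1 h0) (by positivity)
      _ = D.h * (U * (4 * (S.eL + 1) * Real.log s)) := by ring
  calc _ ≤ Real.exp (D.h * (U * ((4 * (S.eL + 1)) * Real.log s))) * Real.exp (D.h * (U * (S.ca * Real.log s))) :=
        mul_le_mul hq f2 (by positivity) (Real.exp_pos _).le
    _ = _ := by rw [exp_hU_mul]; unfold Setup.Kdθ; ring_nf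

/-- **`Mθ(l) ≤ exp(h U KM log s)`** for `l ≤ h X`, `L X ≤ U` (and the `P`-hypotheses). [cite: BakerTNT1975, Ch. 3 §3 Lemma 7] -/
theorem Mθ_le (hs : 3 ≤ s) (h2 : 2 ^ S.J₁ ≤ s) {l : ℕ} {X U : ℝ} (hU : 1 ≤ U)
    (hkU : (S.kp s : ℝ) ≤ 2 * U) (hLs : (S.Lp s : ℝ) * s ≤ U) (hl : (l : ℝ) ≤ D.h * X) (hX : 1 ≤ X)
    (hLX : (S.Lp s : ℝ) * X ≤ U) :
    D.Mθ s l ≤ Real.exp (D.h * (U * (S.KM * Real.log s))) := by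
  have f1 := D.card_le hs hU
  have f2 := D.Pb_le hs h2 hU hkU hLs
  have f3 := D.four_pow_le hs hl hX hLX
  have f4 := D.prod_αM_pow_le hs hl hX hLX
  have hP0 := (D.Pb_pos (s := s) (by omega)).le
  have hM := S.one_le_prod_αM'
  unfold Mθ
  calc _ ≤ Real.exp (D.h * (U * (S.K₁ * Real.log s))) * Real.exp (D.h * (U * (S.KP * Real.log s))) *
        Real.exp (D.h * (U * (8 * Real.log s))) * Real.exp (D.h * (U * (S.cM * Real.log s))) := by
        gcongr
    _ = _ := by simp only [← Real.exp_add]; unfold Setup.KM; ring_nf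

/-- **`errθ(l) ≤ exp(h U KθE log s) |Λ'|`** for `l ≤ h X`, `log X ≤ eY log s`, `L X ≤ U` (and the
`P`-hypotheses). [cite: BakerTNT1975, Ch. 3 §3 Lemma 7] -/
theorem errθ_le (hs : 3 ≤ s) (h2 : 2 ^ S.J₁ ≤ s) {l : ℕ} {X U : ℝ} (hU : 1 ≤ U)
    (hkU : (S.kp s : ℝ) ≤ 2 * U) (hLs : (S.Lp s : ℝ) * s ≤ U) (hl : (l : ℝ) ≤ D.h * X) (hX : 1 ≤ X)
    (hlX : Real.log X ≤ S.eY * Real.log s) (hLX : (S.Lp s : ℝ) * X ≤ U) :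
    D.errθ s l ≤ Real.exp (D.h * (U * (S.KθE * Real.log s))) * ‖D.Λ'‖ := by
  have hs1 : 1 ≤ s := by omega
  have f1 := D.card_le hs hU
  have f2 := D.Pb_le hs h2 hU hkU hLs
  have f3 := D.four_pow_le hs hl hX hLX
  have f4 := D.exp_LΛ_div_le hs hl hX hLX
  have f5 := D.two_L_l_le hs hl hX hlX hU
  have hP0 := (D.Pb_pos (s := s) (by omega)).le
  have hq : (1 : ℝ) ≤ S.qp s := by exact_mod_cast S.qp_pos hs1
  have hl0 : (0 : ℝ) ≤ l := Nat.cast_nonneg _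
  have hL0 : (0 : ℝ) ≤ S.Lp s := Nat.cast_nonneg _
  have f5' : 2 * (S.Lp s : ℝ) * ((l : ℝ) / S.qp s) ≤ Real.exp (D.h * (U * (S.K17 * Real.log s))) := by
    refine le_trans ?_ f5
    rw [mul_div_assoc']
    exact div_le_self (by positivity) hq
  unfold errθ
  calc _ = ((Fintype.card (Idx S.n (S.Lp s) D.h) : ℝ) * D.Pb s * ((4 : ℝ) ^ ((l + D.h) * (S.Lp s + 1)) *
        Real.exp (S.Lp s * S.Λ * l / S.qp s))) * (2 * S.Lp s * ((l : ℝ) / S.qp s)) * ‖D.Λ'‖ := by ring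
    _ ≤ Real.exp (D.h * (U * (S.K₁ * Real.log s))) * Real.exp (D.h * (U * (S.KP * Real.log s))) *
        (Real.exp (D.h * (U * (8 * Real.log s))) * Real.exp (D.h * (U * (S.Λ * Real.log s)))) *
        Real.exp (D.h * (U * (S.K17 * Real.log s))) * ‖D.Λ'‖ := by
        gcongr
    _ = _ := by simp only [← Real.exp_add]; unfold Setup.KθE; ring_nf

/-- **The main lower term of Lemma 7**: `denθ^{Dθ} Mθ^{Dθ} ≤ exp(h (Dθ U) KY log s)`.
[cite: BakerTNT1975, Ch. 3 §3 Lemma 7] -/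
theorem Ymain_le (hs : 3 ≤ s) (h2 : 2 ^ S.J₁ ≤ s) {l : ℕ} {X U : ℝ} (hU : 1 ≤ U)
    (hkU : (S.kp s : ℝ) ≤ 2 * U) (hLs : (S.Lp s : ℝ) * s ≤ U) (hl : (l : ℝ) ≤ D.h * X) (hX : 1 ≤ X)
    (hLX : (S.Lp s : ℝ) * X ≤ U) (hLU : (S.Lp s : ℝ) ≤ U) (Dθ : ℕ) :
    ((D.denθ (S.Lp s) (S.qp s) l : ℕ) : ℝ) ^ Dθ * D.Mθ s l ^ Dθ ≤
      Real.exp (D.h * ((Dθ * U) * (S.KY * Real.log s))) := by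
  have f1 := D.denθ_le hs hl hX hLX hLU
  have f2 := D.Mθ_le hs h2 hU hkU hLs hl hX hLX
  have hM0 : 0 ≤ D.Mθ s l := by
    have := S.one_le_prod_αM'; have := (D.Pb_pos (s := s) (by omega)).le; unfold Mθ; positivity
  calc _ ≤ Real.exp (D.h * (U * (S.Kdθ * Real.log s))) ^ Dθ * Real.exp (D.h * (U * (S.KM * Real.log s))) ^ Dθ :=
        mul_le_mul (pow_le_pow_left₀ (Nat.cast_nonneg _) f1 _) (pow_le_pow_left₀ hM0 f2 _) (by positivity) (by positivity)
    _ = _ := by simp only [← Real.exp_nat_mul, ← Real.exp_add]; unfold Setup.KY; ring_nf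

end Data

/-! ### The units -/

namespace Setup

variable (S : Setup) {s : ℕ}

/-- `k = 2^{J+1} Sord(J+1)` for `J < J₁`. [folklore] -/
theorem kp_eq_pow_mul_Sord {J : ℕ} (hJ : J < S.J₁) (s : ℕ) : S.kp s = 2 ^ (J + 1) * S.Sord s (J + 1) := by
  unfold kp Sord
  rw [← mul_assoc, ← pow_add]; congr 2; omega

/-- **The unit of stage `J`**: `U_J = Sord(J+1) · s^J`. [folklore] -/
def UJ (s J : ℕ) : ℝ := (S.Sord s (J + 1) : ℝ) * (s : ℝ) ^ J

/-- `k ≤ 2 U_J` (`J < J₁`, `2 ≤ s`). [folklore] -/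
theorem kp_le_UJ {J : ℕ} (hJ : J < S.J₁) (hs : 2 ≤ s) : (S.kp s : ℝ) ≤ 2 * S.UJ s J := by
  unfold UJ
  have h1 : S.kp s ≤ 2 * (S.Sord s (J + 1) * s ^ J) := by
    rw [S.kp_eq_pow_mul_Sord hJ s, pow_succ]
    calc 2 ^ J * 2 * S.Sord s (J + 1) = 2 * (S.Sord s (J + 1) * 2 ^ J) := by ring
      _ ≤ 2 * (S.Sord s (J + 1) * s ^ J) :=
          Nat.mul_le_mul_left _ (Nat.mul_le_mul_left _ (Nat.pow_le_pow_left hs J))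
  exact_mod_cast h1

/-- `Sord(J+1) ≤ U_J` (`1 ≤ s`). [folklore] -/
theorem Sord_succ_le_UJ (J : ℕ) (hs : 1 ≤ s) : (S.Sord s (J + 1) : ℝ) ≤ S.UJ s J := by
  unfold UJ
  have : (1 : ℝ) ≤ (s : ℝ) ^ J := one_le_pow₀ (by exact_mod_cast hs)
  have h0 : (0 : ℝ) ≤ S.Sord s (J + 1) := Nat.cast_nonneg _
  nlinarith

/-- `Sord J ≤ 2 U_J` (`J < J₁`). [folklore] -/
theorem Sord_le_UJ {J : ℕ} (hJ : J < S.J₁) (hs : 1 ≤ s) : (S.Sord s J : ℝ) ≤ 2 * S.UJ s J := by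
  have h1 : (S.Sord s J : ℝ) = 2 * S.Sord s (J + 1) := by
    rw [← S.Sord_succ_add hJ]; push_cast; ring
  rw [h1]; have := S.Sord_succ_le_UJ J hs; linarith

/-- `1 ≤ U_J`. [folklore] -/
theorem one_le_UJ (J : ℕ) (hs : 1 ≤ s) : 1 ≤ S.UJ s J := by
  have h1 : 1 ≤ S.Sord s (J + 1) := le_trans (Nat.one_le_pow _ _ hs) (S.pow_ek_le_Sord s (J + 1))
  have h1' : (1 : ℝ) ≤ S.Sord s (J + 1) := by exact_mod_cast h1
  exact h1'.trans (S.Sord_succ_le_UJ J hs)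

/-- `L s^e ≤ U_J` for `e ≤ J + gp + 2`. [folklore] -/
theorem Lp_pow_le_UJ {J e : ℕ} (he : e ≤ J + S.gp + 2) (hs : 1 ≤ s) : (S.Lp s : ℝ) * (s : ℝ) ^ e ≤ S.UJ s J := by
  unfold UJ
  have h1 : S.Lp s * s ^ e ≤ S.Sord s (J + 1) * s ^ J := by
    calc S.Lp s * s ^ e ≤ S.Lp s * s ^ (S.gp + 2 + J) := Nat.mul_le_mul_left _ (Nat.pow_le_pow_right hs (by omega))
      _ = S.Lp s * s ^ (S.gp + 2) * s ^ J := by rw [pow_add, mul_assoc]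
      _ ≤ S.Sord s (J + 1) * s ^ J := Nat.mul_le_mul_right _ (S.Lp_mul_le_Sord s (J + 1))
  exact_mod_cast h1

/-- `L s ≤ U_J`. [folklore] -/
theorem Lp_mul_s_le_UJ (J : ℕ) (hs : 1 ≤ s) : (S.Lp s : ℝ) * s ≤ S.UJ s J := by
  have := S.Lp_pow_le_UJ (J := J) (e := 1) (by omega) hs
  simpa using this

/-- `L ≤ U_J`. [folklore] -/
theorem Lp_le_UJ (J : ℕ) (hs : 1 ≤ s) : (S.Lp s : ℝ) ≤ S.UJ s J := by
  have := S.Lp_pow_le_UJ (J := J) (e := 0) (by omega) hs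
  simpa using this

/-- The stage-`J` "volume" `V_J = U_J s = Sord(J+1) s^{J+1}`. [folklore] -/
theorem UJ_mul_s (s J : ℕ) : S.UJ s J * s = (S.Sord s (J + 1) : ℝ) * (s : ℝ) ^ (J + 1) := by
  unfold UJ; ring

/-- `V_J ≤ s^{ek+J₁+1}` (`J < J₁`, `2^{J₁} ≤ s`). [folklore] -/
theorem UJ_mul_s_le {J : ℕ} (hJ : J < S.J₁) (hs : 1 ≤ s) (h2 : 2 ^ S.J₁ ≤ s) :
    S.UJ s J * s ≤ (s : ℝ) ^ (S.ek + S.J₁ + 1) := by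
  rw [S.UJ_mul_s]
  have h1 : S.Sord s (J + 1) * s ^ (J + 1) ≤ s ^ (S.ek + S.J₁ + 1) := by
    unfold Sord
    calc 2 ^ (S.J₁ - (J + 1)) * s ^ S.ek * s ^ (J + 1) ≤ 2 ^ S.J₁ * s ^ S.ek * s ^ (J + 1) := by
          gcongr
          · omega
          · omega
      _ ≤ s * s ^ S.ek * s ^ (J + 1) := by gcongr
      _ = s ^ (S.ek + J + 2) := by ring
      _ ≤ s ^ (S.ek + S.J₁ + 1) := Nat.pow_le_pow_right hs (by omega)
  exact_mod_cast h1

/-- **The unit of the final step**: `U_F = s^{ek+J₁}`. [folklore] -/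
def UF (s : ℕ) : ℝ := (s : ℝ) ^ (S.ek + S.J₁)

/-- `k ≤ 2 U_F` (`2 ≤ s`). [folklore] -/
theorem kp_le_UF (hs : 2 ≤ s) : (S.kp s : ℝ) ≤ 2 * S.UF s := by
  unfold UF
  have h1 : S.kp s ≤ 2 * s ^ (S.ek + S.J₁) := by
    unfold kp
    calc 2 ^ S.J₁ * s ^ S.ek ≤ s ^ S.J₁ * s ^ S.ek := Nat.mul_le_mul_right _ (Nat.pow_le_pow_left hs _)
      _ = s ^ (S.ek + S.J₁) := by rw [← pow_add, add_comm]
      _ ≤ 2 * s ^ (S.ek + S.J₁) := by omega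
  exact_mod_cast h1

/-- `s^{ek} ≤ U_F` (so `Sord J₁ ≤ 2 U_F`). [folklore] -/
theorem pow_ek_le_UF (hs : 1 ≤ s) : (s : ℝ) ^ S.ek ≤ S.UF s := by
  unfold UF; exact pow_le_pow_right₀ (by exact_mod_cast hs) (by omega)

/-- `1 ≤ U_F`. [folklore] -/
theorem one_le_UF (hs : 1 ≤ s) : 1 ≤ S.UF s := one_le_pow₀ (by exact_mod_cast hs)

/-- `L s^e ≤ U_F` for `e ≤ J₁ + gp + 2`. [folklore] -/
theorem Lp_pow_le_UF {e : ℕ} (he : e ≤ S.J₁ + S.gp + 2) (hs : 1 ≤ s) : (S.Lp s : ℝ) * (s : ℝ) ^ e ≤ S.UF s := by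
  unfold UF
  rw [S.Lp_cast, ← pow_add]
  exact pow_le_pow_right₀ (by exact_mod_cast hs) (by unfold ek; omega)

/-- `U_F s = s^{ek+J₁+1}`. [folklore] -/
theorem UF_mul_s (s : ℕ) : S.UF s * s = (s : ℝ) ^ (S.ek + S.J₁ + 1) := by unfold UF; ring

/-- `s^{ek} s^{J₁+1} = U_F s`. [folklore] -/
theorem pow_ek_mul_pow (s : ℕ) : (s : ℝ) ^ S.ek * (s : ℝ) ^ (S.J₁ + 1) = S.UF s * s := by unfold UF; ring

/-- **The unit for `Q(l)`**: `U_θ = 2^{n+2} s^{eL(n+3)} + s^{ek+1}`. [folklore] -/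
def Uθ (s : ℕ) : ℝ := (2 : ℝ) ^ (S.n + 2) * (s : ℝ) ^ (S.eL * (S.n + 3)) + (s : ℝ) ^ (S.ek + 1)

/-- `1 ≤ U_θ`. [folklore] -/
theorem one_le_Uθ (hs : 1 ≤ s) : 1 ≤ S.Uθ s := by
  unfold Uθ
  have h1 : (1 : ℝ) ≤ (s : ℝ) ^ (S.ek + 1) := one_le_pow₀ (by exact_mod_cast hs)
  have h2 : (0 : ℝ) ≤ (2 : ℝ) ^ (S.n + 2) * (s : ℝ) ^ (S.eL * (S.n + 3)) := by positivity
  linarith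

/-- `k ≤ 2 U_θ` (`2^{J₁} ≤ s`). [folklore] -/
theorem kp_le_Uθ (hs : 1 ≤ s) (h2 : 2 ^ S.J₁ ≤ s) : (S.kp s : ℝ) ≤ 2 * S.Uθ s := by
  have h1 := S.kp_real_le h2
  unfold Uθ
  have h3 : (0 : ℝ) ≤ (2 : ℝ) ^ (S.n + 2) * (s : ℝ) ^ (S.eL * (S.n + 3)) := by positivity
  have h4 : (0 : ℝ) ≤ (s : ℝ) ^ (S.ek + 1) := by positivity
  linarith

/-- `L s ≤ U_θ`. [folklore] -/
theorem Lp_mul_s_le_Uθ (hs : 1 ≤ s) : (S.Lp s : ℝ) * s ≤ S.Uθ s := by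
  unfold Uθ
  rw [S.Lp_cast, ← pow_succ]
  have h1 : (s : ℝ) ^ (S.eL + 1) ≤ (s : ℝ) ^ (S.ek + 1) := pow_le_pow_right₀ (by exact_mod_cast hs) (by unfold ek; omega)
  have h3 : (0 : ℝ) ≤ (2 : ℝ) ^ (S.n + 2) * (s : ℝ) ^ (S.eL * (S.n + 3)) := by positivity
  linarith

/-- `L ≤ U_θ`. [folklore] -/
theorem Lp_le_Uθ (hs : 1 ≤ s) : (S.Lp s : ℝ) ≤ S.Uθ s := by
  have h1 := S.Lp_mul_s_le_Uθ hs
  have hL : (0 : ℝ) ≤ S.Lp s := Nat.cast_nonneg _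
  have hs1 : (1 : ℝ) ≤ s := by exact_mod_cast hs
  nlinarith

/-- The range of the points `l/q`: `X_θ = (2L)^{n+2}`. [folklore] -/
def Xθ (s : ℕ) : ℝ := (2 * (S.Lp s : ℝ)) ^ (S.n + 2)

/-- `1 ≤ X_θ`. [folklore] -/
theorem one_le_Xθ (hs : 1 ≤ s) : 1 ≤ S.Xθ s := by
  unfold Xθ; have := S.one_le_Lp_real hs; exact one_le_pow₀ (by linarith)

/-- `L X_θ ≤ U_θ`. [folklore] -/
theorem Lp_mul_Xθ_le (s : ℕ) : (S.Lp s : ℝ) * S.Xθ s ≤ S.Uθ s := by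
  unfold Xθ Uθ
  rw [S.Lp_cast, mul_pow, ← pow_mul]
  have h1 : (s : ℝ) ^ S.eL * ((2 : ℝ) ^ (S.n + 2) * (s : ℝ) ^ (S.eL * (S.n + 2))) =
      (2 : ℝ) ^ (S.n + 2) * (s : ℝ) ^ (S.eL * (S.n + 3)) := by ring
  rw [h1]
  have : (0 : ℝ) ≤ (s : ℝ) ^ (S.ek + 1) := by positivity
  linarith

/-- `log X_θ ≤ eY log s` (`s ≥ 3`). [folklore] -/
theorem log_Xθ_le (hs : 3 ≤ s) : Real.log (S.Xθ s) ≤ S.eY * Real.log s := by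
  have hx := one_le_log_nat hs
  have hs1 : 1 ≤ s := by omega
  have hL := S.one_le_Lp_real hs1
  unfold Xθ
  rw [Real.log_pow, Real.log_mul (by norm_num) (by positivity), S.log_Lp s]
  have h2 : Real.log 2 ≤ 1 := by have := Real.log_two_lt_d9; linarith
  have heY : ((S.n + 2) * (S.eL + 1) : ℝ) ≤ S.eY := by
    have : (S.n + 2) * (S.eL + 1) ≤ S.eY := by unfold eY J₁; nlinarith
    exact_mod_cast this
  have heL : (0 : ℝ) ≤ S.eL := Nat.cast_nonneg _
  have hn : (0 : ℝ) ≤ S.n := Nat.cast_nonneg _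
  push_cast
  calc ((S.n : ℝ) + 2) * (Real.log 2 + S.eL * Real.log s) ≤ (S.n + 2) * ((S.eL + 1) * Real.log s) := by
        refine mul_le_mul_of_nonneg_left ?_ (by linarith); nlinarith
    _ = ((S.n + 2) * (S.eL + 1)) * Real.log s := by ring
    _ ≤ S.eY * Real.log s := mul_le_mul_of_nonneg_right heY (by linarith)

/-- The number of points `N₀ = h (L+1)^{n+2}` is at most `h X_θ`. [folklore] -/
theorem points_le_Xθ (h : ℕ) (hs : 1 ≤ s) :
    ((h * (S.Lp s + 1) * (S.Lp s + 1) ^ (S.n + 1) : ℕ) : ℝ) ≤ h * S.Xθ s := by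
  unfold Xθ
  push_cast
  have hL := S.one_le_Lp_real hs
  have h1 : (h : ℝ) * ((S.Lp s : ℝ) + 1) * ((S.Lp s : ℝ) + 1) ^ (S.n + 1) = h * ((S.Lp s : ℝ) + 1) ^ (S.n + 2) := by ring
  rw [h1]
  exact mul_le_mul_of_nonneg_left (pow_le_pow_left₀ (by positivity) (by linarith) _) (Nat.cast_nonneg _)

end Setup

end Literature.NumberTheory.Transcendental.Baker1975.Ch3


/-!
# Baker 1975, Ch. 3 — numerical estimates III: the thresholds and the verification of `Numerics`

Support for the proof of Theorem 3.1 of A. Baker, *Transcendental Number Theory* (1975), Ch. 3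
(`Literature.NumberTheory.Transcendental.baker1975_thm_3_1`); sequel to `BakerQuantNumericsB.lean`.

We fix the exponent `Cexp(s) = s^{ek+J₁+2}` of the smallness hypothesis `|Λ'| ≤ e^{-h·Cexp}` (the
`C` of (1), up to the normalisation `h ≍ log B`), the threshold conditions `Setup.Good s` on the base
`s` (finitely many, all of the form "constant of the set-up `≤ s`" or `(Kall+2) log s ≤ s`), prove
that they hold for all large `s` (`Setup.exists_good`), and verify every field of
`BakerQuantCore.Data.Numerics` (`Data.numerics_of_good`): Baker's "the estimates are plainly
inconsistent if `k` is sufficiently large" (pp. 35–37), made uniform in `h`.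

Everything here is proved.

## References

* A. Baker, *Transcendental Number Theory*, Cambridge Univ. Press 1975, Ch. 3 §3 (pp. 35–37).
  [BakerTNT1975]
-/

noncomputable section

open Complex Finset Polynomial NumberField Real Filter

namespace Literature.NumberTheory.Transcendental.Baker1975.Ch3

-- see `BakerQuantNumericsA`: never unfold `gp` definitionally below this line
attribute [local irreducible] Setup.gp

/-! ### Pure arithmetic for the four conditions of `key_ineq` -/

/-- The `Cexp`-conditions: `V Ka x + W Kb x + 2 ≤ Cx`. [folklore] -/
theorem cond_Cx {V W x Ka Kb Kall s' Cx : ℝ} (hV1 : 1 ≤ V) (hWV : W ≤ V) (hx : 1 ≤ x)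
    (hKb : 0 ≤ Kb) (hK : Ka + Kb ≤ Kall) (hthr : (Kall + 2) * x ≤ s') (hCx : V * s' ≤ Cx) :
    V * (Ka * x) + W * (Kb * x) + 2 ≤ Cx := by
  have hV0 : 0 ≤ V := by linarith
  have e1 : W * (Kb * x) ≤ V * (Kb * x) := mul_le_mul_of_nonneg_right hWV (mul_nonneg hKb (by linarith))
  have e2 : (2 : ℝ) ≤ 2 * (V * x) := by nlinarith
  have e3 : V * ((Ka + Kb + 2) * x) ≤ V * ((Kall + 2) * x) :=
    mul_le_mul_of_nonneg_left (mul_le_mul_of_nonneg_right (by linarith) (by linarith)) hV0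
  have e4 : V * ((Kall + 2) * x) ≤ V * s' := mul_le_mul_of_nonneg_left hthr hV0
  calc V * (Ka * x) + W * (Kb * x) + 2 ≤ V * (Ka * x) + V * (Kb * x) + 2 * (V * x) := by linarith
    _ = V * ((Ka + Kb + 2) * x) := by ring
    _ ≤ Cx := by linarith

/-- The decay condition: `U Ka x + W Kb x + 2 ≤ U s' g`. [folklore] -/
theorem cond_dec {U W x Ka Kb Kall s' g : ℝ} (hU1 : 1 ≤ U) (hWU : W ≤ U) (hx : 1 ≤ x)
    (hKa : 0 ≤ Ka) (hKb : 0 ≤ Kb) (hK : Ka + Kb ≤ Kall) (hthr : (Kall + 2) * x ≤ s') (hg : 1 ≤ g) :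
    U * (Ka * x) + W * (Kb * x) + 2 ≤ U * s' * g := by
  have hU0 : 0 ≤ U := by linarith
  have e1 : W * (Kb * x) ≤ U * (Kb * x) := mul_le_mul_of_nonneg_right hWU (mul_nonneg hKb (by linarith))
  have e2 : (2 : ℝ) ≤ 2 * (U * x) := by nlinarith
  have e3 : U * ((Ka + Kb + 2) * x) ≤ U * ((Kall + 2) * x) :=
    mul_le_mul_of_nonneg_left (mul_le_mul_of_nonneg_right (by linarith) (by linarith)) hU0
  have e4 : U * ((Kall + 2) * x) ≤ U * s' := mul_le_mul_of_nonneg_left hthr hU0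
  have e0 : 0 ≤ U * ((Ka + Kb + 2) * x) := mul_nonneg hU0 (mul_nonneg (by linarith) (by linarith))
  have hs' : 0 ≤ U * s' := le_trans (le_trans e0 e3) e4
  have e5 : U * s' * 1 ≤ U * s' * g := mul_le_mul_of_nonneg_left hg hs'
  calc U * (Ka * x) + W * (Kb * x) + 2 ≤ U * (Ka * x) + U * (Kb * x) + 2 * (U * x) := by linarith
    _ = U * ((Ka + Kb + 2) * x) := by ring
    _ ≤ U * s' * g := by linarith

/-- `1 ≤ gp log s - log 4` (`gp ≥ 3`, `log s ≥ 1`). [folklore] -/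
theorem one_le_gain (S : Setup) {s : ℕ} (hs : 3 ≤ s) : (1 : ℝ) ≤ S.gp * Real.log s - Real.log 4 := by
  have hx := one_le_log_nat hs
  have hg : (3 : ℝ) ≤ S.gp := by exact_mod_cast S.three_le_gp
  have h4 : Real.log 4 ≤ 2 := by
    have : Real.log 4 = 2 * Real.log 2 := by
      rw [show (4 : ℝ) = 2 ^ 2 by norm_num, Real.log_pow]; push_cast; ring
    have := Real.log_two_lt_d9; linarith
  nlinarith

namespace Setup

variable (S : Setup) {s : ℕ}

/-! ### The exponent of the smallness hypothesis and the thresholds -/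

/-- **The exponent** `Cexp(s) = s^{ek+J₁+2}`: the proof works under `|Λ'| ≤ e^{-h·Cexp(s)}`. [cite: BakerTNT1975, Ch. 3 §3, eq. (1)] -/
def Cexp (s : ℕ) : ℝ := (s : ℝ) ^ (S.ek + S.J₁ + 2)

/-- The product of the degrees of the `αᵢ`-witnesses (it bounds `[ℚ(θ):ℚ]/q^{n+1}`). [folklore] -/
def dprod : ℕ := ∏ i, (S.αWit i).natDegree

/-- **The threshold conditions on the base `s`.** [cite: BakerTNT1975, Ch. 3 §3 Lemmas 6–7] -/
structure Good (s : ℕ) : Prop where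
  /-- `s ≥ 3` (so `log s ≥ 1`) -/
  three_le : 3 ≤ s
  /-- the Siegel count -/
  sieg : S.sSieg ≤ s
  /-- `k ≤ s^{ek+1}` -/
  twoJ : 2 ^ S.J₁ ≤ s
  /-- `Λ < s` -/
  Λle : S.Λ + 1 ≤ s
  /-- the degree of `ℚ(θ)` is `≤ s q^{n+1}` -/
  dprod_le : S.dprod ≤ s
  /-- the master threshold -/
  Kall_le : (S.Kall + 2) * Real.log s ≤ s

/-- **The thresholds hold for all large `s`.** [folklore] -/
theorem eventually_good : ∀ᶠ s : ℕ in atTop, S.Good s := by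
  have h1 : ∀ᶠ s : ℕ in atTop, 3 ≤ s := eventually_ge_atTop 3
  have h2 : ∀ᶠ s : ℕ in atTop, S.sSieg ≤ s := eventually_ge_atTop _
  have h3 : ∀ᶠ s : ℕ in atTop, 2 ^ S.J₁ ≤ s := eventually_ge_atTop _
  have h4 : ∀ᶠ s : ℕ in atTop, S.Λ + 1 ≤ (s : ℝ) :=
    tendsto_natCast_atTop_atTop.eventually (eventually_ge_atTop _)
  have h5 : ∀ᶠ s : ℕ in atTop, S.dprod ≤ s := eventually_ge_atTop _
  have hK : 0 < S.Kall + 2 := by have := S.Kall_nonneg; linarith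
  have h6r : ∀ᶠ x : ℝ in atTop, (S.Kall + 2) * Real.log x ≤ x := by
    have hb := Real.isLittleO_log_id_atTop.bound (show (0 : ℝ) < 1 / (S.Kall + 2) by positivity)
    filter_upwards [hb, eventually_ge_atTop (1 : ℝ)] with x hx hx1
    simp only [Real.norm_eq_abs, id_eq] at hx
    rw [abs_of_nonneg (Real.log_nonneg hx1), abs_of_nonneg (by linarith)] at hx
    calc (S.Kall + 2) * Real.log x ≤ (S.Kall + 2) * (1 / (S.Kall + 2) * x) := mul_le_mul_of_nonneg_left hx hK.le
      _ = x := by field_simp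
  have h6 : ∀ᶠ s : ℕ in atTop, (S.Kall + 2) * Real.log s ≤ s := tendsto_natCast_atTop_atTop.eventually h6r
  filter_upwards [h1, h2, h3, h4, h5, h6] with s a b c d e f
  exact ⟨a, b, c, d, e, f⟩

/-- Hence a threshold `s₀` exists. [folklore] -/
theorem exists_good : ∃ s₀ : ℕ, ∀ s, s₀ ≤ s → S.Good s := eventually_atTop.mp S.eventually_good

/-- **The base** `s₀` of the construction (any `s ≥ s₀` works). [folklore] -/
def s₀ : ℕ := S.exists_good.choose

/-- `Good s` for `s ≥ s₀`. [folklore] -/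
theorem good_of_le (hs : S.s₀ ≤ s) : S.Good s := S.exists_good.choose_spec s hs

/-! ### The degree factor `q^{n+1} dprod` against the units -/

/-- `1 ≤ natDegree (αWit i)` (a non-zero constant has no root). [folklore] -/
theorem one_le_natDegree_αWit (i : Fin (S.n + 1)) : 1 ≤ (S.αWit i).natDegree := by
  by_contra h0
  have h0' : (S.αWit i).natDegree = 0 := by omega
  obtain ⟨hne, hroot⟩ := S.αWit_spec i
  rw [eq_C_of_natDegree_eq_zero h0', aeval_C, algebraMap_int_eq, eq_intCast, Int.cast_eq_zero] at hroot
  apply hne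
  rw [eq_C_of_natDegree_eq_zero h0', hroot, map_zero]

/-- `1 ≤ dprod`. [folklore] -/
theorem one_le_dprod : 1 ≤ S.dprod := Finset.one_le_prod' fun i _ => S.one_le_natDegree_αWit i

/-- **`q^{n+1} · dprod · U_θ ≤ U_F`** (in `ℕ`): the degree of `ℚ(θ)` times the size of `log Q(l)`
stays below the decay `∝ s^{ek+J₁+1}` by a factor `s`. [cite: BakerTNT1975, Ch. 3 §3 Lemma 7] -/
theorem Dθ_mul_Uθ_le_nat (hs2 : 2 ≤ s) (hd : S.dprod ≤ s) :
    S.qp s ^ (S.n + 1) * S.dprod * (2 ^ (S.n + 2) * s ^ (S.eL * (S.n + 3)) + s ^ (S.ek + 1)) ≤ s ^ (S.ek + S.J₁) := by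
  have hs1 : 1 ≤ s := by omega
  have hgp := S.n_add_three_le_gp
  have heL := S.three_le_eL
  have hq : S.qp s ^ (S.n + 1) = s ^ ((S.eL + 1) * (S.n + 1)) := by unfold qp; rw [← pow_mul]
  set e₀ := S.ek + S.J₁ - 1 with he₀
  have hJ₁ : 1 ≤ S.J₁ := by
    unfold J₁; exact le_trans (by norm_num) (Nat.le_add_left 3 (S.eL * (2 * S.n + 3) + S.n))
  have hE : e₀ + 1 = S.ek + S.J₁ := by omega
  -- term A
  have hA : S.qp s ^ (S.n + 1) * S.dprod * (2 ^ (S.n + 2) * s ^ (S.eL * (S.n + 3))) ≤ s ^ e₀ := by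
    have eA : (S.eL + 1) * (S.n + 1) + 1 + (S.n + 2) + S.eL * (S.n + 3) ≤ e₀ := by
      have : (S.eL + 1) * (S.n + 1) + 1 + (S.n + 2) + S.eL * (S.n + 3) + 1 ≤ S.ek + S.J₁ := by
        unfold ek J₁; nlinarith
      omega
    calc S.qp s ^ (S.n + 1) * S.dprod * (2 ^ (S.n + 2) * s ^ (S.eL * (S.n + 3)))
        ≤ s ^ ((S.eL + 1) * (S.n + 1)) * s * (s ^ (S.n + 2) * s ^ (S.eL * (S.n + 3))) := by
          rw [hq]; gcongr
      _ = s ^ ((S.eL + 1) * (S.n + 1) + 1 + (S.n + 2) + S.eL * (S.n + 3)) := by ring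
      _ ≤ s ^ e₀ := Nat.pow_le_pow_right hs1 eA
  -- term B
  have hB : S.qp s ^ (S.n + 1) * S.dprod * s ^ (S.ek + 1) ≤ s ^ e₀ := by
    have eB : (S.eL + 1) * (S.n + 1) + 1 + (S.ek + 1) ≤ e₀ := by
      have : (S.eL + 1) * (S.n + 1) + 1 + (S.ek + 1) + 1 ≤ S.ek + S.J₁ := by
        unfold J₁; nlinarith
      omega
    calc S.qp s ^ (S.n + 1) * S.dprod * s ^ (S.ek + 1) ≤ s ^ ((S.eL + 1) * (S.n + 1)) * s * s ^ (S.ek + 1) := by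
          rw [hq]; gcongr
      _ = s ^ ((S.eL + 1) * (S.n + 1) + 1 + (S.ek + 1)) := by ring
      _ ≤ s ^ e₀ := Nat.pow_le_pow_right hs1 eB
  calc S.qp s ^ (S.n + 1) * S.dprod * (2 ^ (S.n + 2) * s ^ (S.eL * (S.n + 3)) + s ^ (S.ek + 1))
      = S.qp s ^ (S.n + 1) * S.dprod * (2 ^ (S.n + 2) * s ^ (S.eL * (S.n + 3))) +
          S.qp s ^ (S.n + 1) * S.dprod * s ^ (S.ek + 1) := by ring
    _ ≤ s ^ e₀ + s ^ e₀ := add_le_add hA hB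
    _ = 2 * s ^ e₀ := by ring
    _ ≤ s * s ^ e₀ := Nat.mul_le_mul_right _ hs2
    _ = s ^ (S.ek + S.J₁) := by rw [← pow_succ', hE]

/-- The same in `ℝ`: `q^{n+1} dprod · U_θ ≤ U_F`. [folklore] -/
theorem Dθ_mul_Uθ_le (hs2 : 2 ≤ s) (hd : S.dprod ≤ s) :
    ((S.qp s ^ (S.n + 1) * S.dprod : ℕ) : ℝ) * S.Uθ s ≤ S.UF s := by
  have h := S.Dθ_mul_Uθ_le_nat hs2 hd
  unfold Uθ UF
  exact_mod_cast h

/-- `U_θ ≤ U_F`. [folklore] -/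
theorem Uθ_le_UF (hs2 : 2 ≤ s) (hd : S.dprod ≤ s) : S.Uθ s ≤ S.UF s := by
  have h := S.Dθ_mul_Uθ_le hs2 hd
  have h1 : (1 : ℝ) ≤ ((S.qp s ^ (S.n + 1) * S.dprod : ℕ) : ℝ) := by
    have : 1 ≤ S.qp s ^ (S.n + 1) * S.dprod :=
      Nat.mul_pos (pow_pos (S.qp_pos (by omega)) _) S.one_le_dprod
    exact_mod_cast this
  have h0 : 0 ≤ S.Uθ s := le_trans zero_le_one (S.one_le_Uθ (by omega))
  nlinarith

/-- `points`: `h (L+1)^{n+2} ≤ q · h s^{J₁+1}` (in `ℕ`). [folklore] -/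
theorem points_nat (hs2 : 2 ≤ s) (h : ℕ) :
    h * (S.Lp s + 1) * (S.Lp s + 1) ^ (S.n + 1) ≤ S.qp s * (h * s ^ (S.J₁ + 1)) := by
  have hs1 : 1 ≤ s := by omega
  have hL1 : 1 ≤ S.Lp s := S.one_le_Lp hs1
  have hL : S.Lp s + 1 ≤ s ^ (S.eL + 1) := by
    calc S.Lp s + 1 ≤ 2 * S.Lp s := by omega
      _ ≤ s * S.Lp s := Nat.mul_le_mul_right _ hs2
      _ = s ^ (S.eL + 1) := by unfold Lp; rw [pow_succ']
  have hexp : (S.eL + 1) * (S.n + 2) ≤ S.eL + 1 + (S.J₁ + 1) := by unfold J₁; nlinarith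
  calc h * (S.Lp s + 1) * (S.Lp s + 1) ^ (S.n + 1) = h * (S.Lp s + 1) ^ (S.n + 2) := by ring
    _ ≤ h * (s ^ (S.eL + 1)) ^ (S.n + 2) := Nat.mul_le_mul_left _ (Nat.pow_le_pow_left hL _)
    _ = h * s ^ ((S.eL + 1) * (S.n + 2)) := by rw [← pow_mul]
    _ ≤ h * s ^ (S.eL + 1 + (S.J₁ + 1)) := Nat.mul_le_mul_left _ (Nat.pow_le_pow_right hs1 hexp)
    _ = S.qp s * (h * s ^ (S.J₁ + 1)) := by unfold qp; rw [pow_add]; ring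

end Setup

/-! ### The verification of `Numerics` -/

namespace Data

variable {S : Setup} (D : Data S) {s : ℕ}

/-- The main Liouville term is positive. [folklore] -/
theorem liouMain_pos (hs1 : 1 ≤ s) (T R : ℕ) :
    0 < S.ℓinv ^ T * (D.denB (S.Lp s) T R ^ S.D₀ *
      ((Fintype.card (Idx S.n (S.Lp s) D.h) : ℝ) * D.Pb s * D.gKB (S.Lp s) T R) ^ S.D₀) := by
  have hL : (0 : ℝ) < S.Lp s := by exact_mod_cast S.one_le_Lp hs1
  have h1 := S.one_le_ℓinv
  have h2 := one_le_prod_aden S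
  have h3 := S.one_le_prod_αM'
  have h4 := D.Pb_pos hs1
  have h5 := D.one_le_card s
  unfold denB gKB
  positivity

/-- `0 < Mθ`. [folklore] -/
theorem Mθ_pos (hs1 : 1 ≤ s) (l : ℕ) : 0 < D.Mθ s l := by
  have h3 := S.one_le_prod_αM'
  have h4 := D.Pb_pos hs1
  have h5 := D.one_le_card s
  unfold Mθ
  positivity

/-- `ε ≤ e^{hUKεx}|Λ'| ≤ e^{hVKεx}|Λ'|`-type monotonicity in the unit. [folklore] -/
theorem exp_unit_mono {U V K x : ℝ} (hUV : U ≤ V) (hK : 0 ≤ K) (hx : 0 ≤ x) :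
    Real.exp (D.h * (U * (K * x))) ≤ Real.exp (D.h * (V * (K * x))) := by
  have h0 : (0 : ℝ) ≤ D.h := Nat.cast_nonneg _
  exact Real.exp_le_exp.mpr (mul_le_mul_of_nonneg_left (mul_le_mul_of_nonneg_right hUV (mul_nonneg hK hx)) h0)

set_option maxHeartbeats 800000 in
/-- **Baker 1975, Ch. 3, Lemma 6 — the step inequality at stage `J < J₁` holds at every good base.**
[cite: BakerTNT1975, Ch. 3 §3 Lemma 6] -/
theorem step_of_good (hg : S.Good s) (hΛ : ‖D.Λ'‖ ≤ Real.exp (-(D.h * S.Cexp s))) {J : ℕ} (hJ : J < S.J₁) :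
    D.hermiteUB (S.Lp s) (S.kp s) (D.h * s ^ (J + 1)) (S.Sord s (J + 1)) (D.h * s ^ (J + 2 + S.gp)) (D.Pb s)
      (((S.n + 1 : ℕ) : ℝ) ^ (S.Sord s J) * D.errB (S.Lp s) (S.kp s) (D.h * s ^ (J + 1)) (D.Pb s))
      ((D.h * s ^ (J + 2) : ℕ) : ℝ) <
    D.liouvilleLB (S.Lp s) (S.Sord s (J + 1)) (D.h * s ^ (J + 2)) (D.Pb s) := by
  have hs3 := hg.three_le
  have hs1 : 1 ≤ s := by omega
  have hs2 : 2 ≤ s := by omega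
  have h2J := hg.twoJ
  have hx := one_le_log_nat hs3
  have hh := D.one_le_h_real
  have h0 : (0 : ℝ) ≤ D.h := by linarith
  have hsr : (1 : ℝ) ≤ s := by exact_mod_cast hs1
  have hZpos := D.liouMain_pos hs1 (S.Sord s (J + 1)) (D.h * s ^ (J + 2))
  -- names
  set L := S.Lp s with hL
  set k := S.kp s with hk
  set T' := S.Sord s (J + 1) with hT'
  set T := S.Sord s J with hT
  set R₁n := D.h * s ^ (J + 1) with hR₁n
  set R₂n := D.h * s ^ (J + 2) with hR₂n
  set Rcn := D.h * s ^ (J + 2 + S.gp) with hRcn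
  set P := D.Pb s with hP
  set x := Real.log s with hxdef
  set Λn := ‖D.Λ'‖ with hΛn
  set U := S.UJ s J with hU
  set V := U * s with hV
  set X₁ : ℝ := (s : ℝ) ^ (J + 1) with hX₁
  set X₂ : ℝ := (s : ℝ) ^ (J + 2) with hX₂
  set Xc : ℝ := (s : ℝ) ^ (J + 2 + S.gp) with hXc
  -- units and ranges
  have hU1 : 1 ≤ U := S.one_le_UJ J hs1
  have hU0 : 0 ≤ U := by linarith
  have hUV : U ≤ V := by
    have : 0 ≤ U * ((s : ℝ) - 1) := mul_nonneg hU0 (by linarith)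
    rw [hV]; linarith
  have hV1 : 1 ≤ V := hU1.trans hUV
  have hkU : (k : ℝ) ≤ 2 * U := S.kp_le_UJ hJ hs2
  have hT'U1 : (T' : ℝ) ≤ U := S.Sord_succ_le_UJ J hs1
  have hT'0 : (0 : ℝ) ≤ T' := Nat.cast_nonneg _
  have hT'U : (T' : ℝ) ≤ 2 * U := by linarith
  have hTU : (T : ℝ) ≤ 2 * U := S.Sord_le_UJ hJ hs1
  have hLs : (L : ℝ) * s ≤ U := S.Lp_mul_s_le_UJ J hs1
  have hLX₁ : (L : ℝ) * X₁ ≤ U := S.Lp_pow_le_UJ (by omega) hs1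
  have hLX₂ : (L : ℝ) * X₂ ≤ U := S.Lp_pow_le_UJ (by omega) hs1
  have hLXc : (L : ℝ) * Xc ≤ U := S.Lp_pow_le_UJ (by omega) hs1
  have hX₁1 : 1 ≤ X₁ := one_le_pow₀ hsr
  have hX₂1 : 1 ≤ X₂ := one_le_pow₀ hsr
  have hXc1 : 1 ≤ Xc := one_le_pow₀ hsr
  have heY : ∀ e : ℕ, e ≤ S.eY → Real.log ((s : ℝ) ^ e) ≤ S.eY * x := fun e he => by
    rw [Real.log_pow]; exact mul_le_mul_of_nonneg_right (by exact_mod_cast he) (by linarith)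
  have hlX₁ : Real.log X₁ ≤ S.eY * x := heY _ (by unfold Setup.eY; omega)
  have hlX₂ : Real.log X₂ ≤ S.eY * x := heY _ (by unfold Setup.eY; omega)
  have hlXc : Real.log Xc ≤ S.eY * x := heY _ (by unfold Setup.eY; omega)
  have hR₁c : (R₁n : ℝ) = D.h * X₁ := by rw [hR₁n]; push_cast; ring
  have hR₂c : (R₂n : ℝ) = D.h * X₂ := by rw [hR₂n]; push_cast; ring
  have hRcc : (Rcn : ℝ) = D.h * Xc := by rw [hRcn]; push_cast; ring
  have hT'k : T' ≤ k := S.Sord_le_kp s (J + 1)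
  have hT'1 : 1 ≤ T' := le_trans (Nat.one_le_pow _ _ hs1) (S.pow_ek_le_Sord s (J + 1))
  have hP0 : 0 ≤ P := (D.Pb_pos hs1).le
  have hTX : (T' : ℝ) * X₁ = V := by rw [hV, hU, S.UJ_mul_s]
  have hX₁₂ : X₁ ≤ X₂ := pow_le_pow_right₀ hsr (by omega)
  have hX₁c : X₁ ≤ Xc := pow_le_pow_right₀ hsr (by omega)
  have hρ : (R₁n : ℝ) ≤ R₂n := by rw [hR₁c, hR₂c]; exact mul_le_mul_of_nonneg_left hX₁₂ h0
  have hρc : (R₁n : ℝ) ≤ Rcn := by rw [hR₁c, hRcc]; exact mul_le_mul_of_nonneg_left hX₁c h0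
  have hR₁pos : (0 : ℝ) < R₁n := by rw [hR₁c]; exact mul_pos (by linarith) (by linarith)
  -- ε
  set ε := ((S.n + 1 : ℕ) : ℝ) ^ T * D.errB L k R₁n P with hε
  have hE0 := D.errB_nonneg L k R₁n hP0
  have hε0 : 0 ≤ ε := mul_nonneg (pow_nonneg (Nat.cast_nonneg _) _) hE0
  have hεb : ε ≤ Real.exp (D.h * (V * (S.Kε * x))) * Λn := by
    have f1 := D.n1_pow_le hs3 T hTU
    have f2 := D.errB_le hs3 h2J (le_refl k) hU1 hkU hkU hLs hR₁c.le hX₁1 hlX₁ hLX₁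
    calc ε ≤ Real.exp (D.h * (U * ((2 * S.n) * x))) * (Real.exp (D.h * (U * (S.KE * x))) * Λn) :=
          mul_le_mul f1 f2 hE0 (Real.exp_pos _).le
      _ = Real.exp (D.h * (U * (S.Kε * x))) * Λn := by rw [← mul_assoc, exp_hU_mul]; rfl
      _ ≤ Real.exp (D.h * (V * (S.Kε * x))) * Λn :=
          mul_le_mul_of_nonneg_right (D.exp_unit_mono hUV S.Kε_nonneg (by linarith)) (norm_nonneg _)
  -- H₁, H₂
  have hKH0 : 0 ≤ S.KH * x := mul_nonneg S.KH_nonneg (by linarith)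
  have hHbound : ∀ {t Xt : ℝ}, (R₁n : ℝ) ≤ t → t ≤ D.h * Xt → Real.log Xt ≤ S.eY * x →
      hermH R₁n T' ε t ≤ Λn * Real.exp (D.h * (V * ((S.Kε + S.KH) * x))) := by
    intro t Xt ht htX hlXt
    have h1 := D.hermH_le hs3 h2J hR₁c hX₁1 hT'1 hT'k hTX.le (hT'U1.trans hUV) ht htX hlXt hε0
    calc hermH R₁n T' ε t ≤ ε * Real.exp (D.h * (V * (S.KH * x))) := h1
      _ ≤ (Real.exp (D.h * (V * (S.Kε * x))) * Λn) * Real.exp (D.h * (V * (S.KH * x))) :=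
          mul_le_mul_of_nonneg_right hεb (Real.exp_pos _).le
      _ = Λn * Real.exp (D.h * (V * ((S.Kε + S.KH) * x))) := by
          rw [mul_comm (Real.exp _) Λn, mul_assoc, exp_hU_mul]
  have hH₁ := hHbound hρ hR₂c.le hlX₂
  have hH₂ := hHbound hρc hRcc.le hlXc
  have hH₂0 : 0 ≤ hermH R₁n T' ε Rcn := hermH_nonneg R₁n T' hε0 (by linarith)
  -- growth
  have hGr := D.growthB_le hs3 h2J hU1 hkU hLs hRcc.le hXc1 hLXc
  -- gain
  have hM4 : (4 : ℝ) ≤ (s : ℝ) ^ S.gp := by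
    have h3 : (3 : ℝ) ≤ s := by exact_mod_cast hs3
    calc (4 : ℝ) ≤ (s : ℝ) ^ 2 := by nlinarith
      _ ≤ (s : ℝ) ^ S.gp := pow_le_pow_right₀ hsr (le_trans (by norm_num) S.three_le_gp)
  have hMρ : (s : ℝ) ^ S.gp * R₂n ≤ Rcn := by
    rw [hR₂c, hRcc, hXc, hX₂]; exact le_of_eq (by ring)
  obtain ⟨hgain, hgain1⟩ := ratio_pow_le_exp hR₁pos hρ hM4 hMρ (T' * R₁n)
  have hgain0 : 0 ≤ (((R₂n : ℝ) + R₁n) / (Rcn - R₁n)) ^ (T' * R₁n) :=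
    pow_nonneg (ratio_nonneg hR₁pos hρ (by linarith) hMρ) _
  have hg' : (((R₂n : ℝ) + R₁n) / (Rcn - R₁n)) ^ (T' * R₁n) ≤
      Real.exp (-(D.h * (U * s * (S.gp * x - Real.log 4)))) := by
    refine hgain.trans (le_of_eq ?_)
    congr 1
    rw [Real.log_pow, Nat.cast_mul, hR₁c, ← hV, ← hTX]; ring
  -- error term
  have hE := D.errB_le hs3 h2J hT'k hU1 hT'U hkU hLs hR₂c.le hX₂1 hlX₂ hLX₂
  have hE' : D.errB L T' R₂n P ≤ Λn * Real.exp (D.h * (U * (S.KE * x))) := by rw [mul_comm]; exact hE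
  -- main term
  have hZ := D.liouMain_le hs3 h2J hT'k hU1 hT'U hkU hLs hR₂c.le hX₂1 hlX₂ hLX₂
  have hX : Real.exp (-(D.h * (U * (S.KΞ * x)))) ≤ (S.ℓinv ^ T')⁻¹ * (D.denB L T' R₂n ^ S.D₀ *
      ((Fintype.card (Idx S.n L D.h) : ℝ) * P * D.gKB L T' R₂n) ^ S.D₀)⁻¹ := by
    rw [← mul_inv, Real.exp_neg]
    exact inv_anti₀ hZpos hZ
  -- the four conditions
  have hthr := hg.Kall_le
  have hVs : V * s ≤ S.Cexp s := by
    have h1 := S.UJ_mul_s_le hJ hs1 h2J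
    rw [hV, hU]
    unfold Setup.Cexp
    rw [pow_succ]
    exact mul_le_mul_of_nonneg_right h1 (by linarith)
  have hUs : U * s ≤ S.Cexp s := by
    have : U * s ≤ V * s := mul_le_mul_of_nonneg_right hUV (by linarith)
    exact this.trans hVs
  have nK₁ := S.K₁_nonneg; have nKE := S.KE_nonneg; have nKε := S.Kε_nonneg; have nKH := S.KH_nonneg
  have nKΞ := S.KΞ_nonneg; have nKgr := S.Kgr_nonneg; have nKY := S.KY_nonneg; have nKθE := S.KθE_nonneg
  have hKall : S.Kall = S.Kε + S.KH + S.KΞ + S.Kgr + S.KY + S.KθE + S.KE + (S.eL + S.J₁ + S.gp + 2) := rfl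
  have hpos4 : (0 : ℝ) ≤ S.eL + S.J₁ + S.gp + 2 := by positivity
  have c₁ : V * ((S.Kε + S.KH) * x) + U * (S.KΞ * x) + 2 ≤ S.Cexp s :=
    cond_Cx hV1 hUV hx nKΞ (by rw [hKall]; linarith) hthr hVs
  have c₃ : U * (S.KE * x) + U * (S.KΞ * x) + 2 ≤ S.Cexp s :=
    cond_Cx hU1 le_rfl hx nKΞ (by rw [hKall]; linarith) hthr hUs
  have c₄ : U * (S.Kgr * x) + U * (S.KΞ * x) + 2 ≤ U * s * (S.gp * x - Real.log 4) :=
    cond_dec hU1 le_rfl hx nKgr nKΞ (by rw [hKall]; linarith) hthr (one_le_gain S hs3)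
  -- conclude
  have key := key_ineq hh hΛ hH₁ hH₂0 hH₂ hGr hgain0 hgain1 hg' hE' hX c₁ c₁ c₃ c₄
  unfold hermiteUB liouvilleLB
  linarith only [key]

set_option maxHeartbeats 800000 in
/-- **Baker 1975, Ch. 3, Lemma 7 — the final inequality at the points `l/q` holds at every good base.**
[cite: BakerTNT1975, Ch. 3 §3 Lemma 7] -/
theorem final_of_good (hg : S.Good s) (hΛ : ‖D.Λ'‖ ≤ Real.exp (-(D.h * S.Cexp s))) {l : ℕ}
    (hl : l < D.h * (S.Lp s + 1) * (S.Lp s + 1) ^ (S.n + 1)) :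
    D.UB₀ s + D.errθ s l <
      (((D.denθ (S.Lp s) (S.qp s) l : ℕ) : ℝ) ^ (S.qp s ^ (S.n + 1) * ∏ i, (S.αWit i).natDegree) *
        D.Mθ s l ^ (S.qp s ^ (S.n + 1) * ∏ i, (S.αWit i).natDegree))⁻¹ := by
  have hs3 := hg.three_le
  have hs1 : 1 ≤ s := by omega
  have hs2 : 2 ≤ s := by omega
  have h2J := hg.twoJ
  have hx := one_le_log_nat hs3
  have hh := D.one_le_h_real
  have h0 : (0 : ℝ) ≤ D.h := by linarith
  have hsr : (1 : ℝ) ≤ s := by exact_mod_cast hs1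
  have hq0 : 0 < S.qp s := S.qp_pos hs1
  have hYpos : 0 < ((D.denθ (S.Lp s) (S.qp s) l : ℕ) : ℝ) ^ (S.qp s ^ (S.n + 1) * ∏ i, (S.αWit i).natDegree) *
      D.Mθ s l ^ (S.qp s ^ (S.n + 1) * ∏ i, (S.αWit i).natDegree) := by
    have h1 : (1 : ℝ) ≤ ((D.denθ (S.Lp s) (S.qp s) l : ℕ) : ℝ) := by exact_mod_cast D.one_le_denθ (S.Lp s) hq0 l
    have h2 := D.Mθ_pos hs1 l
    positivity
  unfold UB₀
  -- names
  set L := S.Lp s with hL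
  set k := S.kp s with hk
  set q := S.qp s with hq
  set T := S.Sord s S.J₁ with hT
  set Sd := s ^ S.ek with hSd
  set R₁n := D.h * s ^ (S.J₁ + 1) with hR₁n
  set Rcn := D.h * s ^ (S.J₁ + 1 + S.gp) with hRcn
  set P := D.Pb s with hP
  set Dθ := q ^ (S.n + 1) * ∏ i, (S.αWit i).natDegree with hDθ
  set x := Real.log s with hxdef
  set Λn := ‖D.Λ'‖ with hΛn
  set U := S.UF s with hU
  set V := U * s with hV
  set W := (Dθ : ℝ) * S.Uθ s with hW
  set X₁ : ℝ := (s : ℝ) ^ (S.J₁ + 1) with hX₁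
  set Xc : ℝ := (s : ℝ) ^ (S.J₁ + 1 + S.gp) with hXc
  -- units and ranges
  have hU1 : 1 ≤ U := S.one_le_UF hs1
  have hU0 : 0 ≤ U := by linarith
  have hUV : U ≤ V := by
    have : 0 ≤ U * ((s : ℝ) - 1) := mul_nonneg hU0 (by linarith)
    rw [hV]; linarith
  have hV1 : 1 ≤ V := hU1.trans hUV
  have hkU : (k : ℝ) ≤ 2 * U := S.kp_le_UF hs2
  have hLs : (L : ℝ) * s ≤ U := by
    have := S.Lp_pow_le_UF (e := 1) (by omega) hs1
    simpa using this
  have hLX₁ : (L : ℝ) * X₁ ≤ U := S.Lp_pow_le_UF (by omega) hs1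
  have hLXc : (L : ℝ) * Xc ≤ U := S.Lp_pow_le_UF (by omega) hs1
  have hX₁1 : 1 ≤ X₁ := one_le_pow₀ hsr
  have hXc1 : 1 ≤ Xc := one_le_pow₀ hsr
  have heY : ∀ e : ℕ, e ≤ S.eY → Real.log ((s : ℝ) ^ e) ≤ S.eY * x := fun e he => by
    rw [Real.log_pow]; exact mul_le_mul_of_nonneg_right (by exact_mod_cast he) (by linarith)
  have hlX₁ : Real.log X₁ ≤ S.eY * x := heY _ (by unfold Setup.eY; omega)
  have hlXc : Real.log Xc ≤ S.eY * x := heY _ (by unfold Setup.eY; omega)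
  have hR₁c : (R₁n : ℝ) = D.h * X₁ := by rw [hR₁n]; push_cast; ring
  have hRcc : (Rcn : ℝ) = D.h * Xc := by rw [hRcn]; push_cast; ring
  have hSd1 : 1 ≤ Sd := Nat.one_le_pow _ _ hs1
  have hSdk : Sd ≤ k := by rw [hSd, hk]; unfold Setup.kp; exact Nat.le_mul_of_pos_left _ (pow_pos two_pos _)
  have hSdc : (Sd : ℝ) = (s : ℝ) ^ S.ek := by rw [hSd]; push_cast; rfl
  have hTX : (Sd : ℝ) * X₁ = V := by rw [hV, hU, hSdc]; exact S.pow_ek_mul_pow s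
  have hSdU : (Sd : ℝ) ≤ U := by rw [hSdc]; exact S.pow_ek_le_UF hs1
  have hSdV' : (Sd : ℝ) ≤ V := hSdU.trans hUV
  have hTc : (T : ℝ) = (s : ℝ) ^ S.ek := by rw [hT, S.Sord_J₁]; push_cast; rfl
  have hTU : (T : ℝ) ≤ 2 * U := by rw [hTc]; linarith [S.pow_ek_le_UF hs1]
  have hP0 : 0 ≤ P := (D.Pb_pos hs1).le
  have hX₁c : X₁ ≤ Xc := pow_le_pow_right₀ hsr (by omega)
  have hρc : (R₁n : ℝ) ≤ Rcn := by rw [hR₁c, hRcc]; exact mul_le_mul_of_nonneg_left hX₁c h0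
  have hR₁pos : (0 : ℝ) < R₁n := by rw [hR₁c]; exact mul_pos (by linarith) (by linarith)
  -- the θ-unit
  have hθ1 := S.one_le_Uθ hs1
  have hkθ := S.kp_le_Uθ hs1 h2J
  have hLsθ := S.Lp_mul_s_le_Uθ hs1
  have hLXθ := S.Lp_mul_Xθ_le s
  have hXθ1 := S.one_le_Xθ hs1
  have hlXθ := S.log_Xθ_le hs3
  have hLθ := S.Lp_le_Uθ hs1
  have hlθ : (l : ℝ) ≤ D.h * S.Xθ s := by
    have h1 : (l : ℝ) ≤ ((D.h * (S.Lp s + 1) * (S.Lp s + 1) ^ (S.n + 1) : ℕ) : ℝ) := by exact_mod_cast hl.le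
    exact h1.trans (S.points_le_Xθ D.h hs1)
  have hθU : S.Uθ s ≤ U := S.Uθ_le_UF hs2 hg.dprod_le
  have hWU : W ≤ U := S.Dθ_mul_Uθ_le hs2 hg.dprod_le
  have hWV : W ≤ V := hWU.trans hUV
  -- ε
  set ε := ((S.n + 1 : ℕ) : ℝ) ^ T * D.errB L k R₁n P with hε
  have hE0 := D.errB_nonneg L k R₁n hP0
  have hε0 : 0 ≤ ε := mul_nonneg (pow_nonneg (Nat.cast_nonneg _) _) hE0
  have hεb : ε ≤ Real.exp (D.h * (V * (S.Kε * x))) * Λn := by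
    have f1 := D.n1_pow_le hs3 T hTU
    have f2 := D.errB_le hs3 h2J (le_refl k) hU1 hkU hkU hLs hR₁c.le hX₁1 hlX₁ hLX₁
    calc ε ≤ Real.exp (D.h * (U * ((2 * S.n) * x))) * (Real.exp (D.h * (U * (S.KE * x))) * Λn) :=
          mul_le_mul f1 f2 hE0 (Real.exp_pos _).le
      _ = Real.exp (D.h * (U * (S.Kε * x))) * Λn := by rw [← mul_assoc, exp_hU_mul]; rfl
      _ ≤ Real.exp (D.h * (V * (S.Kε * x))) * Λn :=
          mul_le_mul_of_nonneg_right (D.exp_unit_mono hUV S.Kε_nonneg (by linarith)) (norm_nonneg _)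
  -- H₁, H₂
  have hHbound : ∀ {t Xt : ℝ}, (R₁n : ℝ) ≤ t → t ≤ D.h * Xt → Real.log Xt ≤ S.eY * x →
      hermH R₁n Sd ε t ≤ Λn * Real.exp (D.h * (V * ((S.Kε + S.KH) * x))) := by
    intro t Xt ht htX hlXt
    have h1 := D.hermH_le hs3 h2J hR₁c hX₁1 hSd1 hSdk hTX.le hSdV' ht htX hlXt hε0
    calc hermH R₁n Sd ε t ≤ ε * Real.exp (D.h * (V * (S.KH * x))) := h1
      _ ≤ (Real.exp (D.h * (V * (S.Kε * x))) * Λn) * Real.exp (D.h * (V * (S.KH * x))) :=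
          mul_le_mul_of_nonneg_right hεb (Real.exp_pos _).le
      _ = Λn * Real.exp (D.h * (V * ((S.Kε + S.KH) * x))) := by
          rw [mul_comm (Real.exp _) Λn, mul_assoc, exp_hU_mul]
  have hH₁ := hHbound le_rfl hR₁c.le hlX₁
  have hH₂ := hHbound hρc hRcc.le hlXc
  have hH₂0 : 0 ≤ hermH R₁n Sd ε Rcn := hermH_nonneg R₁n Sd hε0 (by linarith)
  -- growth
  have hGr := D.growthB_le hs3 h2J hU1 hkU hLs hRcc.le hXc1 hLXc
  -- gain
  have hM4 : (4 : ℝ) ≤ (s : ℝ) ^ S.gp := by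
    have h3 : (3 : ℝ) ≤ s := by exact_mod_cast hs3
    calc (4 : ℝ) ≤ (s : ℝ) ^ 2 := by nlinarith
      _ ≤ (s : ℝ) ^ S.gp := pow_le_pow_right₀ hsr (le_trans (by norm_num) S.three_le_gp)
  have hMρ : (s : ℝ) ^ S.gp * R₁n ≤ Rcn := by
    rw [hR₁c, hRcc, hXc, hX₁]; exact le_of_eq (by ring)
  obtain ⟨hgain, hgain1⟩ := ratio_pow_le_exp hR₁pos le_rfl hM4 hMρ (Sd * R₁n)
  have hgain0 : 0 ≤ (((R₁n : ℝ) + R₁n) / (Rcn - R₁n)) ^ (Sd * R₁n) :=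
    pow_nonneg (ratio_nonneg hR₁pos le_rfl (by linarith) hMρ) _
  have hg' : (((R₁n : ℝ) + R₁n) / (Rcn - R₁n)) ^ (Sd * R₁n) ≤
      Real.exp (-(D.h * (U * s * (S.gp * x - Real.log 4)))) := by
    refine hgain.trans (le_of_eq ?_)
    congr 1
    rw [Real.log_pow, Nat.cast_mul, hR₁c, ← hV, ← hTX]; ring
  -- error term
  have hE := D.errθ_le hs3 h2J hθ1 hkθ hLsθ hlθ hXθ1 hlXθ hLXθ
  have hE' : D.errθ s l ≤ Λn * Real.exp (D.h * (U * (S.KθE * x))) := by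
    rw [mul_comm]
    exact hE.trans (mul_le_mul_of_nonneg_right (D.exp_unit_mono hθU S.KθE_nonneg (by linarith)) (norm_nonneg _))
  -- main term
  have hY := D.Ymain_le hs3 h2J hθ1 hkθ hLsθ hlθ hXθ1 hLXθ hLθ Dθ
  have hX : Real.exp (-(D.h * (W * (S.KY * x)))) ≤ (((D.denθ L q l : ℕ) : ℝ) ^ Dθ * D.Mθ s l ^ Dθ)⁻¹ := by
    rw [Real.exp_neg]
    exact inv_anti₀ hYpos hY
  -- the four conditions
  have hthr := hg.Kall_le
  have hVs : V * s ≤ S.Cexp s := by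
    rw [hV, hU]; unfold Setup.UF Setup.Cexp; exact le_of_eq (by ring)
  have hUs : U * s ≤ S.Cexp s := by
    have : U * s ≤ V * s := mul_le_mul_of_nonneg_right hUV (by linarith)
    exact this.trans hVs
  have nK₁ := S.K₁_nonneg; have nKE := S.KE_nonneg; have nKε := S.Kε_nonneg; have nKH := S.KH_nonneg
  have nKΞ := S.KΞ_nonneg; have nKgr := S.Kgr_nonneg; have nKY := S.KY_nonneg; have nKθE := S.KθE_nonneg
  have hKall : S.Kall = S.Kε + S.KH + S.KΞ + S.Kgr + S.KY + S.KθE + S.KE + (S.eL + S.J₁ + S.gp + 2) := rfl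
  have hpos4 : (0 : ℝ) ≤ S.eL + S.J₁ + S.gp + 2 := by positivity
  have c₁ : V * ((S.Kε + S.KH) * x) + W * (S.KY * x) + 2 ≤ S.Cexp s :=
    cond_Cx hV1 hWV hx nKY (by rw [hKall]; linarith) hthr hVs
  have c₃ : U * (S.KθE * x) + W * (S.KY * x) + 2 ≤ S.Cexp s :=
    cond_Cx hU1 hWU hx nKY (by rw [hKall]; linarith) hthr hUs
  have c₄ : U * (S.Kgr * x) + W * (S.KY * x) + 2 ≤ U * s * (S.gp * x - Real.log 4) :=
    cond_dec hU1 hWU hx nKgr nKY (by rw [hKall]; linarith) hthr (one_le_gain S hs3)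
  -- conclude
  have key := key_ineq hh hΛ hH₁ hH₂0 hH₂ hGr hgain0 hgain1 hg' hE' hX c₁ c₁ c₃ c₄
  unfold hermiteUB
  linarith only [key]

/-- **All the numerical conditions hold at every good base** (given the smallness of `Λ'`).
[cite: BakerTNT1975, Ch. 3 §3 Lemmas 6–7] -/
theorem numerics_of_good (hg : S.Good s) (hΛ : ‖D.Λ'‖ ≤ Real.exp (-(D.h * S.Cexp s))) : D.Numerics s := by
  have hs3 := hg.three_le
  have hs1 : 1 ≤ s := by omega
  have hs2 : 2 ≤ s := by omega
  have hh := D.one_le_h_real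
  have h0 : (0 : ℝ) ≤ D.h := by linarith
  have hsr : (1 : ℝ) ≤ s := by exact_mod_cast hs1
  have hC1 : 1 ≤ S.Cexp s := one_le_pow₀ hsr
  have hC0 : 0 ≤ D.h * S.Cexp s := mul_nonneg h0 (by linarith)
  refine ⟨hs3, hg.sieg, ?_, ?_, ?_, D.one_le_Pb hs1, ?_, fun J hJ => D.step_of_good hg hΛ hJ,
    fun l hl => D.final_of_good hg hΛ hl⟩
  · have := hg.Λle; linarith
  · exact hΛ.trans (Real.exp_le_one_iff.mpr (by linarith))
  · -- L · Rc · |Λ'| ≤ 1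
    set Y : ℝ := (S.Lp s : ℝ) * (s : ℝ) ^ (S.J₁ + 1 + S.gp) with hY
    have hYC : Y ≤ S.Cexp s := by
      refine (S.Lp_pow_le_UF (by omega) hs1).trans ?_
      unfold Setup.UF Setup.Cexp
      exact pow_le_pow_right₀ hsr (by omega)
    have hcast : (S.Lp s : ℝ) * ((D.h * s ^ (S.J₁ + 1 + S.gp) : ℕ) : ℝ) = D.h * Y := by
      rw [hY]; push_cast; ring
    have e1 : (D.h : ℝ) ≤ Real.exp (D.h - 1) := by linarith [Real.add_one_le_exp ((D.h : ℝ) - 1)]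
    have e2 : Y ≤ Real.exp (Y - 1) := by linarith [Real.add_one_le_exp (Y - 1)]
    have hY0 : 0 ≤ Y := by rw [hY]; positivity
    have hA : D.h * Y ≤ Real.exp (D.h * S.Cexp s) := by
      calc D.h * Y ≤ Real.exp (D.h - 1) * Real.exp (Y - 1) := mul_le_mul e1 e2 hY0 (Real.exp_pos _).le
        _ = Real.exp (D.h - 1 + (Y - 1)) := by rw [Real.exp_add]
        _ ≤ Real.exp (D.h * S.Cexp s) := by
            refine Real.exp_le_exp.mpr ?_
            have : 0 ≤ ((D.h : ℝ) - 1) * (S.Cexp s - 1) := mul_nonneg (by linarith) (by linarith)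
            nlinarith
    rw [hcast]
    calc D.h * Y * ‖D.Λ'‖ ≤ Real.exp (D.h * S.Cexp s) * Real.exp (-(D.h * S.Cexp s)) :=
          mul_le_mul hA hΛ (norm_nonneg _) (Real.exp_pos _).le
      _ = 1 := by rw [← Real.exp_add]; simp
  · exact_mod_cast S.points_nat hs2 D.h

end Data

end Literature.NumberTheory.Transcendental.Baker1975.Ch3

/-!
# Baker 1975, Ch. 3, Theorem 3.1 — proof (`baker1975_thm_3_1_holds`)

The discharge of the named fact `Literature.NumberTheory.Transcendental.baker1975_thm_3_1`
(A. Baker, *Transcendental Number Theory* (1975), Ch. 3, Theorem 3.1: `|Λ| > B^{-C}` for the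
linear form `Λ = β₀ + β₁ log α₁ + ⋯ + βₙ log αₙ` with algebraic `βⱼ` of heights `≤ B`).

The analytic–arithmetic core is `BakerQuantCore.Data.exists_relation_of_numerics` ("(1) implies
(2)", Baker §3–§4) together with `BakerQuantNumericsC.Data.numerics_of_good` (all the numerical
conditions hold at the base `s₀` of the set-up as soon as `|Λ'| ≤ e^{-h·Cexp(s₀)}`). This file
carries out §4's "inductive argument" (pp. 37–38) in the language of the coefficient field `K`:

* `HB K h x` — "`x ∈ K` has a denominator `≤ eʰ` and all conjugates `≤ eʰ`" (the form in which
  `BakerQuantSetup.Data` takes the coefficients), with its calculus: integer multiples, differences,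
  quotients (`exists_den_inv`), and `HB` from a witness polynomial of height `≤ B` when `eʰ ≥ B+1`;
* `LB m l D₀ C` — the lower bound `|β + ∑ βᵢ lᵢ| ≥ e^{-C h}` (or `= 0`) for all coefficient fields
  of degree `≤ D₀` containing the `αᵢ` and all coefficients with `HB K h`;
* `exists_LB` — by induction on the number `m` of logarithms (p. 37: normalise by a non-zero
  `βᵣ`, get the relation (2) with `|b'| ≤ L`, pass to `β''ⱼ = b'ᵣ βⱼ - b'ⱼ βᵣ` which kills one
  logarithm, and use the case `m - 1`; the cases "all `βᵢ = 0`" and `m = 0` are Liouville's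
  inequality `liouville_lower_bound`);
* `baker1975_thm_3_1_holds` — the public statement: drop the logarithms that are `0`, take
  `K = ℚ(α, β)` (degree `≤ d^{2n+1}`, `finrank_adjoin_le_prod_natDegree`), `h = ⌊log B⌋ + 2`.

## References

* A. Baker, *Transcendental Number Theory*, Cambridge Univ. Press 1975, Ch. 3, Thm 3.1, §4
  (pp. 37–38). [BakerTNT1975]
-/

noncomputable section

open Complex Finset Polynomial NumberField Real

namespace Literature.NumberTheory.Transcendental.Baker1975.Ch3

attribute [local irreducible] Setup.gp

/-! ### Coefficients with a denominator and bounded conjugates -/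

/-- **`HB K h x`**: `x ∈ K` has a denominator `b ≤ eʰ` (`b x ∈ 𝓞_K`) and all its conjugates are
`≤ eʰ` — the shape of the hypotheses on the `βⱼ` in `BakerQuantSetup.Data`. [cite: BakerTNT1975, Ch. 3 §3, eq. (1)] -/
structure HB (K : IntermediateField ℚ ℂ) (h : ℕ) (x : K) : Prop where
  /-- a denominator `b ≤ eʰ` with `b x ∈ 𝓞_K`, and all conjugates of `x` are `≤ eʰ` -/
  out : ∃ b : ℕ, 1 ≤ b ∧ (b : ℝ) ≤ Real.exp h ∧ IsIntegral ℤ ((b : K) * x) ∧ ∀ σ : K →+* ℂ, ‖σ x‖ ≤ Real.exp h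

/-- `2 ≤ e`. [folklore] -/
private theorem two_le_exp_one : (2 : ℝ) ≤ Real.exp 1 := by
  have := Real.add_one_le_exp (1 : ℝ); linarith

/-- `n ≤ eⁿ` for naturals (as reals). [folklore] -/
theorem nat_le_exp (n : ℕ) : (n : ℝ) ≤ Real.exp n := by
  have := Real.add_one_le_exp (n : ℝ); linarith

/-- Natural numbers are algebraic integers. [folklore] -/
theorem natCast_isIntegral (K : IntermediateField ℚ ℂ) (b : ℕ) : IsIntegral ℤ ((b : K)) := by
  simpa using isIntegral_algebraMap (R := ℤ) (A := K) (x := (b : ℤ))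

/-- Rational integers are algebraic integers. [folklore] -/
theorem intCast_isIntegral (K : IntermediateField ℚ ℂ) (c : ℤ) : IsIntegral ℤ ((c : K)) := by
  simpa using isIntegral_algebraMap (R := ℤ) (A := K) (x := c)

/-- `((|c| : ℕ) : K) = ± c`. [folklore] -/
theorem natAbs_cast_eq (K : IntermediateField ℚ ℂ) (c : ℤ) :
    ((c.natAbs : ℕ) : K) = (c : K) ∨ ((c.natAbs : ℕ) : K) = -(c : K) := by
  rcases le_total 0 c with hc | hc
  · left; rw [← Int.cast_natCast, Int.natCast_natAbs, abs_of_nonneg hc]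
  · right; rw [← Int.cast_natCast, Int.natCast_natAbs, abs_of_nonpos hc, Int.cast_neg]

namespace HB

variable {K : IntermediateField ℚ ℂ} {h : ℕ} {x y : K}

/-- Monotonicity in `h`. [folklore] -/
theorem mono (hx : HB K h x) {h' : ℕ} (hh : h ≤ h') : HB K h' x := by
  obtain ⟨b, hb1, hb, hint, hσ⟩ := hx.out
  have he : Real.exp h ≤ Real.exp h' := Real.exp_le_exp.mpr (by exact_mod_cast hh)
  exact ⟨⟨b, hb1, hb.trans he, hint, fun σ => (hσ σ).trans he⟩⟩

/-- Negation. [folklore] -/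
theorem neg (hx : HB K h x) : HB K h (-x) := by
  obtain ⟨b, hb1, hb, hint, hσ⟩ := hx.out
  refine ⟨⟨b, hb1, hb, ?_, fun σ => by rw [map_neg, norm_neg]; exact hσ σ⟩⟩
  have : (b : K) * -x = -((b : K) * x) := by ring
  rw [this]; exact hint.neg

/-- Multiplication by a rational integer `c` with `|c| ≤ e^{h₁}`. [folklore] -/
theorem intMul (hx : HB K h x) {c : ℤ} {h₁ : ℕ} (hc : (|c| : ℝ) ≤ Real.exp h₁) : HB K (h + h₁) ((c : K) * x) := by
  obtain ⟨b, hb1, hb, hint, hσ⟩ := hx.out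
  have he : Real.exp h ≤ Real.exp ((h + h₁ : ℕ) : ℝ) := Real.exp_le_exp.mpr (by push_cast; linarith)
  refine ⟨⟨b, hb1, hb.trans he, ?_, fun σ => ?_⟩⟩
  · have : (b : K) * ((c : K) * x) = (c : K) * ((b : K) * x) := by ring
    rw [this]
    exact (isIntegral_algebraMap (R := ℤ) (A := K) (x := c)).mul hint
  · rw [map_mul, map_intCast, norm_mul, Complex.norm_intCast]
    calc |(c : ℝ)| * ‖σ x‖ ≤ Real.exp h₁ * Real.exp h := mul_le_mul hc (hσ σ) (norm_nonneg _) (Real.exp_pos _).le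
      _ = Real.exp ((h + h₁ : ℕ) : ℝ) := by rw [← Real.exp_add]; push_cast; ring_nf

/-- Subtraction: `HB h x → HB h y → HB (2h+1) (x - y)`. [folklore] -/
theorem sub (hx : HB K h x) (hy : HB K h y) : HB K (2 * h + 1) (x - y) := by
  obtain ⟨b, hb1, hb, hint, hσ⟩ := hx.out
  obtain ⟨b', hb1', hb', hint', hσ'⟩ := hy.out
  have h0 : (0 : ℝ) ≤ h := Nat.cast_nonneg _
  have hcast : ((2 * h + 1 : ℕ) : ℝ) = 2 * h + 1 := by push_cast; ring
  refine ⟨⟨b * b', Nat.mul_pos hb1 hb1', ?_, ?_, fun σ => ?_⟩⟩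
  · rw [hcast]; push_cast
    calc (b : ℝ) * b' ≤ Real.exp h * Real.exp h := mul_le_mul hb hb' (Nat.cast_nonneg _) (Real.exp_pos _).le
      _ ≤ Real.exp (2 * h + 1) := by
          rw [← Real.exp_add]; exact Real.exp_le_exp.mpr (by linarith)
  · have : ((b * b' : ℕ) : K) * (x - y) = (b' : K) * ((b : K) * x) - (b : K) * ((b' : K) * y) := by push_cast; ring
    rw [this]
    exact ((natCast_isIntegral K b').mul hint).sub ((natCast_isIntegral K b).mul hint')
  · rw [map_sub]
    have e1 : ‖σ x - σ y‖ ≤ Real.exp h + Real.exp h := (norm_sub_le _ _).trans (add_le_add (hσ σ) (hσ' σ))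
    have e2 : Real.exp h + Real.exp h ≤ Real.exp 1 * Real.exp h := by nlinarith [Real.exp_pos (h : ℝ), two_le_exp_one]
    rw [← Real.exp_add] at e2
    refine e1.trans (e2.trans (Real.exp_le_exp.mpr ?_))
    rw [hcast]; linarith

/-- The intermediate field `K` is a number field when finite-dimensional. [folklore] -/
theorem numberField (K : IntermediateField ℚ ℂ) [FiniteDimensional ℚ K] : NumberField K :=
  { to_charZero := charZero_of_injective_algebraMap (algebraMap ℚ K).injective
    to_finiteDimensional := ‹_› }

/-- **Quotients**: `HB h x → HB h y → y ≠ 0 → HB ((6D₀+2) h) (x / y)` for `[K:ℚ] ≤ D₀`, `1 ≤ h`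
(through `exists_den_inv`; Baker p. 37: "`β'ⱼ = -βⱼ/βₙ` … heights at most `B' ≤ B^c`").
[cite: BakerTNT1975, Ch. 3 §4 (p. 37)] -/
theorem div [FiniteDimensional ℚ K] (hx : HB K h x) (hy : HB K h y) (hy0 : y ≠ 0) {D₀ : ℕ}
    (hD : Module.finrank ℚ K ≤ D₀) (h1 : 1 ≤ h) : HB K ((6 * D₀ + 2) * h) (x / y) := by
  haveI := numberField K
  obtain ⟨bx, hbx1, hbx, hintx, hσx⟩ := hx.out
  obtain ⟨bb, hbb1, hbb, hintb, hσb⟩ := hy.out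
  set D := Module.finrank ℚ K with hDdef
  have hD1 : 1 ≤ D := Module.finrank_pos
  have hh1 : (1 : ℝ) ≤ h := by exact_mod_cast h1
  have hDr : (D : ℝ) ≤ D₀ := by exact_mod_cast hD
  have hD0 : (0 : ℝ) ≤ D := Nat.cast_nonneg _
  set y' : K := (bb : K) * y with hy'
  have hbbK : (bb : K) ≠ 0 := by exact_mod_cast (show bb ≠ 0 by omega)
  have hy'0 : y' ≠ 0 := mul_ne_zero hbbK hy0
  -- conjugates of y' ≤ e^{2h}
  set M : ℝ := Real.exp (2 * h) with hM
  have hM1 : 1 ≤ M := Real.one_le_exp (by positivity)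
  have hMy : ∀ φ : K →+* ℂ, ‖φ y'‖ ≤ M := fun φ => by
    rw [hy', map_mul, map_natCast, norm_mul, Complex.norm_natCast, hM]
    calc (bb : ℝ) * ‖φ y‖ ≤ Real.exp h * Real.exp h := mul_le_mul hbb (hσb φ) (norm_nonneg _) (Real.exp_pos _).le
      _ = Real.exp (2 * h) := by rw [← Real.exp_add]; ring_nf
  obtain ⟨c, hc0, hcle, hcint, hcσ⟩ := exists_den_inv hy'0 hintb hM1 hMy
  -- the new denominator
  have hxy : x / y = (bb : K) * x * y'⁻¹ := by
    rw [hy', mul_inv]; field_simp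
  refine ⟨⟨bx * c.natAbs, Nat.mul_pos hbx1 (Int.natAbs_pos.mpr hc0), ?_, ?_, fun σ => ?_⟩⟩
  · -- bx |c| ≤ e^h (2M)^D ≤ e^{(6D₀+2)h}
    have hcabs : ((c.natAbs : ℕ) : ℝ) = |(c : ℝ)| := by rw [Nat.cast_natAbs, Int.cast_abs]
    rw [Nat.cast_mul, hcabs]
    have e1 : (bx : ℝ) * |(c : ℝ)| ≤ Real.exp h * (2 * M) ^ D := mul_le_mul hbx hcle (abs_nonneg _) (Real.exp_pos _).le
    refine e1.trans ?_
    have e2 : (2 * M) ^ D ≤ Real.exp (D * (1 + 2 * h)) := by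
      have h2M : 2 * M ≤ Real.exp (1 + 2 * h) := by
        rw [Real.exp_add, hM]; exact mul_le_mul_of_nonneg_right two_le_exp_one (Real.exp_pos _).le
      calc (2 * M) ^ D ≤ Real.exp (1 + 2 * h) ^ D := pow_le_pow_left₀ (by positivity) h2M D
        _ = Real.exp (D * (1 + 2 * h)) := by rw [← Real.exp_nat_mul]
    calc Real.exp h * (2 * M) ^ D ≤ Real.exp h * Real.exp (D * (1 + 2 * h)) :=
          mul_le_mul_of_nonneg_left e2 (Real.exp_pos _).le
      _ = Real.exp (h + D * (1 + 2 * h)) := by rw [Real.exp_add]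
      _ ≤ Real.exp (((6 * D₀ + 2) * h : ℕ) : ℝ) := by
          refine Real.exp_le_exp.mpr ?_
          push_cast
          have : (D : ℝ) * 1 ≤ D₀ * h := by nlinarith
          nlinarith
  · -- integrality of (bx |c|) (x / y) = ± bb (bx x) (c y'⁻¹)
    rw [hxy]
    have hI : IsIntegral ℤ ((bb : K) * (((bx : K) * x) * ((c : K) * y'⁻¹))) :=
      (natCast_isIntegral K bb).mul (hintx.mul hcint)
    rcases natAbs_cast_eq K c with hc | hc
    · have : ((bx * c.natAbs : ℕ) : K) * ((bb : K) * x * y'⁻¹) =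
          (bb : K) * (((bx : K) * x) * ((c : K) * y'⁻¹)) := by
        rw [Nat.cast_mul, hc]; ring
      rw [this]; exact hI
    · have : ((bx * c.natAbs : ℕ) : K) * ((bb : K) * x * y'⁻¹) =
          -((bb : K) * (((bx : K) * x) * ((c : K) * y'⁻¹))) := by
        rw [Nat.cast_mul, hc]; ring
      rw [this]; exact hI.neg
  · -- conjugates of x / y
    rw [hxy, map_mul, map_mul, map_natCast, norm_mul, norm_mul, Complex.norm_natCast]
    have e1 : (bb : ℝ) * ‖σ x‖ * ‖σ y'⁻¹‖ ≤ Real.exp h * Real.exp h * (D * (2 * M) ^ D * M ^ D) := by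
      refine mul_le_mul (mul_le_mul hbb (hσx σ) (norm_nonneg _) (Real.exp_pos _).le) (hcσ σ) (norm_nonneg _) ?_
      positivity
    refine e1.trans ?_
    have hDexp : (D : ℝ) ≤ Real.exp D := nat_le_exp D
    have e2 : (2 * M) ^ D ≤ Real.exp (D * (1 + 2 * h)) := by
      have h2M : 2 * M ≤ Real.exp (1 + 2 * h) := by
        rw [Real.exp_add, hM]; exact mul_le_mul_of_nonneg_right two_le_exp_one (Real.exp_pos _).le
      calc (2 * M) ^ D ≤ Real.exp (1 + 2 * h) ^ D := pow_le_pow_left₀ (by positivity) h2M D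
        _ = Real.exp (D * (1 + 2 * h)) := by rw [← Real.exp_nat_mul]
    have e3 : M ^ D = Real.exp (D * (2 * h)) := by rw [hM, ← Real.exp_nat_mul]
    calc Real.exp h * Real.exp h * (D * (2 * M) ^ D * M ^ D)
        ≤ Real.exp h * Real.exp h * (Real.exp D * Real.exp (D * (1 + 2 * h)) * Real.exp (D * (2 * h))) := by
          rw [e3]
          refine mul_le_mul_of_nonneg_left ?_ (by positivity)
          exact mul_le_mul (mul_le_mul hDexp e2 (by positivity) (Real.exp_pos _).le) le_rfl (Real.exp_pos _).le (by positivity)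
      _ = Real.exp (h + h + (D + D * (1 + 2 * h) + D * (2 * h))) := by simp only [← Real.exp_add]
      _ ≤ Real.exp (((6 * D₀ + 2) * h : ℕ) : ℝ) := by
          refine Real.exp_le_exp.mpr ?_
          push_cast
          have : (D : ℝ) * 1 ≤ D₀ * h := by nlinarith
          nlinarith

/-- **`HB` from a witness polynomial**: a root `x ∈ K` of a non-zero `Q ∈ ℤ[X]` of height `≤ B`
has `HB K h x` as soon as `eʰ ≥ B + 1` (denominator = leading coefficient, conjugates by Cauchy's
bound `norm_le_of_aeval_eq_zero`). [cite: BakerTNT1975, Ch. 3 §2 (p. 29)] -/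
theorem of_witness (x : K) {Q : ℤ[X]} (hQ : Q ≠ 0) {B : ℕ} (hB : ∀ k, |Q.coeff k| ≤ (B : ℤ))
    (hroot : aeval (x : ℂ) Q = 0) (hh : (B : ℝ) + 1 ≤ Real.exp h) : HB K h x := by
  have hlc : Q.leadingCoeff ≠ 0 := leadingCoeff_ne_zero.mpr hQ
  have hBr : ∀ i, |(Q.coeff i : ℝ)| ≤ B := fun i => by exact_mod_cast hB i
  have hrootK : aeval x Q = 0 := by
    have h1 := aeval_algebraMap_apply ℂ x Q
    rw [show algebraMap K ℂ x = (x : ℂ) from rfl, hroot] at h1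
    exact (algebraMap K ℂ).injective (by rw [map_zero]; exact h1.symm)
  have hint : IsIntegral ℤ ((Q.leadingCoeff : K) * x) := by
    have := isIntegral_leadingCoeff_smul (R := ℤ) (p := Q) (x := x) hrootK
    rwa [zsmul_eq_mul] at this
  refine ⟨⟨Q.leadingCoeff.natAbs, Int.natAbs_pos.mpr hlc, ?_, ?_, fun σ => ?_⟩⟩
  · have h1 : (Q.leadingCoeff.natAbs : ℤ) ≤ B := by
      rw [Int.natCast_natAbs]; exact hB _
    have h2 : ((Q.leadingCoeff.natAbs : ℕ) : ℝ) ≤ B := by exact_mod_cast h1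
    linarith
  · rcases natAbs_cast_eq K Q.leadingCoeff with hc | hc
    · rwa [hc]
    · rw [hc, neg_mul]; exact hint.neg
  · have hσroot : aeval (σ x) Q = 0 := by
      rw [show σ x = σ.toIntAlgHom x from rfl, aeval_algHom_apply, hrootK, map_zero]
    exact (norm_le_of_aeval_eq_zero hQ hBr hσroot).trans hh

end HB

/-- **Liouville for a single coefficient**: `HB K h x`, `x ≠ 0`, `[K:ℚ] ≤ D₀` give
`|x| ≥ e^{-(2D₀+1)h}` (the case `n = 0` of the theorem, and "one at least of `β₁, …, βₙ` is not
`0`", p. 37). [cite: BakerTNT1975, Ch. 3 §4 (p. 37)] -/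
theorem lb_const {K : IntermediateField ℚ ℂ} [FiniteDimensional ℚ K] {h : ℕ} {x : K} (hx : HB K h x)
    (hx0 : x ≠ 0) {D₀ : ℕ} (hD : Module.finrank ℚ K ≤ D₀) :
    Real.exp (-((2 * D₀ + 1) * h)) ≤ ‖(x : ℂ)‖ := by
  haveI := HB.numberField K
  obtain ⟨b, hb1, hb, hint, hσ⟩ := hx.out
  set D := Module.finrank ℚ K with hDdef
  have hD1 : 1 ≤ D := Module.finrank_pos
  have h0 : (0 : ℝ) ≤ h := Nat.cast_nonneg _
  have hM1 : (1 : ℝ) ≤ Real.exp h := Real.one_le_exp h0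
  have key := liouville_lower_bound (algebraMap K ℂ : K →+* ℂ) hx0 hb1 hint hM1 hσ
  refine le_trans ?_ key
  rw [Real.exp_neg]
  have hpos : (0 : ℝ) < (b : ℝ) ^ D * Real.exp h ^ (D - 1) := by
    have : (0 : ℝ) < b := by exact_mod_cast hb1
    positivity
  refine inv_anti₀ hpos ?_
  have hDr : (D : ℝ) ≤ D₀ := by exact_mod_cast hD
  calc (b : ℝ) ^ D * Real.exp h ^ (D - 1) ≤ Real.exp h ^ D * Real.exp h ^ D := by
        refine mul_le_mul (pow_le_pow_left₀ (Nat.cast_nonneg _) hb D) (pow_le_pow_right₀ hM1 (by omega)) (by positivity) (by positivity)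
    _ = Real.exp (2 * D * h) := by rw [← pow_add, ← Real.exp_nat_mul]; push_cast; ring_nf
    _ ≤ Real.exp ((2 * D₀ + 1) * h) := Real.exp_le_exp.mpr (by nlinarith)

/-! ### The lower bound with coefficients in a field, by induction on the number of logarithms -/

/-- **`LB m l D₀ C`**: for every coefficient field `K ⊆ ℂ` of degree `≤ D₀` containing the
`e^{lᵢ}`, every `h ≥ 1` and all coefficients `β, βᵢ ∈ K` with `HB K h`: `β + ∑ βᵢ lᵢ = 0` or
`|β + ∑ βᵢ lᵢ| ≥ e^{-C h}`. [cite: BakerTNT1975, Ch. 3 Thm 3.1] -/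
structure LB (m : ℕ) (l : Fin m → ℂ) (D₀ : ℕ) (C : ℝ) : Prop where
  /-- the lower bound, for every admissible field, level and coefficients -/
  out : ∀ (K : IntermediateField ℚ ℂ) [FiniteDimensional ℚ K], Module.finrank ℚ K ≤ D₀ → (∀ i, cexp (l i) ∈ K) →
    ∀ (h : ℕ), 1 ≤ h → ∀ (βc : K) (β : Fin m → K), HB K h βc → (∀ i, HB K h (β i)) →
      ((βc : ℂ) + ∑ i, (β i : ℂ) * l i = 0 ∨ Real.exp (-(C * h)) ≤ ‖(βc : ℂ) + ∑ i, (β i : ℂ) * l i‖)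

/-- The set-up of the step with the `r`-th logarithm moved to the last place. [folklore] -/
def stepSetup {m : ℕ} (l : Fin (m + 1) → ℂ) (hl : ∀ i, l i ≠ 0) (halg : ∀ i, IsAlgebraic ℚ (cexp (l i)))
    (D₀ : ℕ) (r : Fin (m + 1)) : Setup where
  n := m
  l := l ∘ Equiv.swap r (Fin.last m)
  l_ne_zero := fun _ => hl _
  isAlgebraic := fun _ => halg _
  D₀ := D₀

/-- **The inductive lower bound** (Baker's §4, pp. 37–38). [cite: BakerTNT1975, Ch. 3 §4] -/
theorem exists_LB : ∀ (m : ℕ) (l : Fin m → ℂ), (∀ i, l i ≠ 0) → (∀ i, IsAlgebraic ℚ (cexp (l i))) →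
    ∀ D₀ : ℕ, ∃ C : ℝ, 0 < C ∧ LB m l D₀ C := by
  intro m
  induction m with
  | zero =>
    intro l _ _ D₀
    refine ⟨2 * D₀ + 1, by positivity, ⟨?_⟩⟩
    intro K _ hD _ h _ βc β hβc _
    simp only [Finset.univ_eq_empty, Finset.sum_empty, add_zero]
    by_cases h0 : βc = 0
    · left; simp [h0]
    · right
      exact lb_const hβc h0 hD
  | succ m ih =>
    intro l hl halg D₀
    -- the set-ups and their constants
    let S : Fin (m + 1) → Setup := fun r => stepSetup l hl halg D₀ r
    let Lr : Fin (m + 1) → ℝ := fun r => ((S r).Lp (S r).s₀ : ℝ)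
    let Cx : Fin (m + 1) → ℝ := fun r => (S r).Cexp (S r).s₀
    -- the inductive constants
    have ih' : ∀ r' : Fin (m + 1), ∃ C : ℝ, 0 < C ∧ LB m (l ∘ r'.succAbove) D₀ C := fun r' =>
      ih (l ∘ r'.succAbove) (fun i => hl _) (fun i => halg _) D₀
    choose Cih hCih hLB using ih'
    -- the constant
    set C : ℝ := (2 * D₀ + 1) + ∑ r, ((6 * D₀ + 2) * Cx r + (2 * D₀ + 1)) +
      ∑ r, ∑ r', (Cih r' * (2 * Lr r + 3) + Lr r) with hC
    have hLr0 : ∀ r, 0 ≤ Lr r := fun r => Nat.cast_nonneg _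
    have hCx0 : ∀ r, 0 ≤ Cx r := fun r => by
      show 0 ≤ (S r).Cexp (S r).s₀; unfold Setup.Cexp; positivity
    have hsum1 : 0 ≤ ∑ r, ((6 * D₀ + 2) * Cx r + (2 * D₀ + 1)) :=
      sum_nonneg fun r _ => by have := hCx0 r; positivity
    have hsum2 : 0 ≤ ∑ r, ∑ r', (Cih r' * (2 * Lr r + 3) + Lr r) :=
      sum_nonneg fun r _ => sum_nonneg fun r' _ => by have := hLr0 r; have := hCih r'; positivity
    have hC0 : 0 < C := by rw [hC]; positivity
    have hCbase : (2 * D₀ + 1 : ℝ) ≤ C := by rw [hC]; linarith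
    have hCr : ∀ r, (6 * D₀ + 2) * Cx r + (2 * D₀ + 1) ≤ C := fun r => by
      have h1 : (6 * D₀ + 2) * Cx r + (2 * D₀ + 1) ≤ ∑ r, ((6 * D₀ + 2) * Cx r + (2 * D₀ + 1)) :=
        single_le_sum (f := fun r => (6 * D₀ + 2) * Cx r + (2 * D₀ + 1)) (fun r _ => by have := hCx0 r; positivity) (mem_univ r)
      rw [hC]; linarith
    have hCrr : ∀ r r', Cih r' * (2 * Lr r + 3) + Lr r ≤ C := fun r r' => by
      have h1 : Cih r' * (2 * Lr r + 3) + Lr r ≤ ∑ r', (Cih r' * (2 * Lr r + 3) + Lr r) :=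
        single_le_sum (f := fun r' => Cih r' * (2 * Lr r + 3) + Lr r) (fun r' _ => by have := hLr0 r; have := hCih r'; positivity) (mem_univ r')
      have h2 : ∑ r', (Cih r' * (2 * Lr r + 3) + Lr r) ≤ ∑ r, ∑ r', (Cih r' * (2 * Lr r + 3) + Lr r) :=
        single_le_sum (f := fun r => ∑ r', (Cih r' * (2 * Lr r + 3) + Lr r))
          (fun r _ => sum_nonneg fun r' _ => by have := hLr0 r; have := hCih r'; positivity) (mem_univ r)
      rw [hC]; linarith
    refine ⟨C, hC0, ⟨?_⟩⟩
    intro K _ hD hα h h1 βc β hβc hβ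
    set Λ : ℂ := (βc : ℂ) + ∑ i, (β i : ℂ) * l i with hΛ
    have hh1 : (1 : ℝ) ≤ h := by exact_mod_cast h1
    have hh0 : (0 : ℝ) ≤ h := by linarith
    -- either the bound holds, or Λ is small
    by_cases hbig : Real.exp (-(C * h)) ≤ ‖Λ‖
    · exact Or.inr hbig
    push Not at hbig
    -- case A : all βᵢ = 0
    by_cases hA : ∀ i, β i = 0
    · have hΛc : Λ = (βc : ℂ) := by rw [hΛ]; simp [hA]
      by_cases h0 : βc = 0
      · left; rw [hΛc, h0]; rfl
      · right
        rw [hΛc]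
        refine le_trans (Real.exp_le_exp.mpr ?_) (lb_const hβc h0 hD)
        nlinarith
    push Not at hA
    obtain ⟨r, hr⟩ := hA
    -- case B : βᵣ ≠ 0; normalise
    have hβr := lb_const (hβ r) hr hD
    have hβr0 : (β r : ℂ) ≠ 0 := by exact_mod_cast hr
    set σ := Equiv.swap r (Fin.last m) with hσ
    set H : ℕ := (6 * D₀ + 2) * h with hH
    have hH2 : 2 ≤ H := by rw [hH]; nlinarith
    let β'c : K := -(βc / β r)
    let β' : Fin m → K := fun j => -(β (σ (Fin.castSucc j)) / β r)
    let βv : Option (Fin m) → K := fun o => o.elim β'c β'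
    have hβv : ∀ o, HB K H (βv o) := by
      intro o; cases o with
      | none => exact (HB.div hβc (hβ r) hr hD h1).neg
      | some j => exact (HB.div (hβ _) (hβ r) hr hD h1).neg
    have hβv' : ∀ o, ∃ b : ℕ, 1 ≤ b ∧ (b : ℝ) ≤ Real.exp H ∧ IsIntegral ℤ ((b : K) * βv o) ∧
        ∀ τ : K →+* ℂ, ‖τ (βv o)‖ ≤ Real.exp H := fun o => (hβv o).out
    choose bden hb1 hble hint hemb using hβv'
    let D : Data (S r) :=
      { K := K, fd := ‹_›, finrank_le := hD, αmem := fun i => hα _, βv := βv, h := H, two_le_h := hH2,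
        bden := bden, one_le_bden := hb1, bden_le := hble, isIntegral_bden := hint,
        norm_emb_le := fun τ o => hemb o τ }
    -- D.Λ' = -Λ / βᵣ
    have hσr : σ (Fin.last m) = r := by simp [hσ, Equiv.swap_apply_right]
    have hsum : ∑ i, (β i : ℂ) * l i =
        ∑ j : Fin m, (β (σ (Fin.castSucc j)) : ℂ) * l (σ (Fin.castSucc j)) + (β r : ℂ) * l r := by
      rw [← Equiv.sum_comp σ (fun i => (β i : ℂ) * l i), Fin.sum_univ_castSucc, hσr]
    have hΛ' : D.Λ' = -(Λ * ((β r : ℂ))⁻¹) := by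
      show ((-(βc / β r) : K) : ℂ) + ∑ j : Fin m, ((-(β (σ (Fin.castSucc j)) / β r) : K) : ℂ) * l (σ (Fin.castSucc j)) -
        l (σ (Fin.last m)) = _
      rw [hσr, hΛ, hsum]
      push_cast
      have hS : ∑ j : Fin m, -((β (σ (Fin.castSucc j)) : ℂ) / (β r : ℂ)) * l (σ (Fin.castSucc j)) =
          -(∑ j : Fin m, (β (σ (Fin.castSucc j)) : ℂ) * l (σ (Fin.castSucc j))) * ((β r : ℂ))⁻¹ := by
        rw [neg_mul, Finset.sum_mul, ← Finset.sum_neg_distrib]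
        exact Finset.sum_congr rfl fun j _ => by ring
      rw [hS]
      field_simp
      ring
    -- smallness of Λ'
    have hDh : (D.h : ℝ) = (6 * D₀ + 2) * h := by
      show (((6 * D₀ + 2) * h : ℕ) : ℝ) = _; push_cast; ring
    have hΛ'small : ‖D.Λ'‖ ≤ Real.exp (-(D.h * (S r).Cexp (S r).s₀)) := by
      rw [hΛ', norm_neg, norm_mul, norm_inv]
      have hβrpos : 0 < ‖(β r : ℂ)‖ := norm_pos_iff.mpr hβr0
      rw [← div_eq_mul_inv, div_le_iff₀ hβrpos, hDh]
      have e1 : Real.exp (-(C * h)) ≤ Real.exp (-((6 * D₀ + 2) * h * Cx r)) * Real.exp (-((2 * D₀ + 1) * h)) := by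
        rw [← Real.exp_add]
        refine Real.exp_le_exp.mpr ?_
        have := mul_le_mul_of_nonneg_right (hCr r) hh0
        nlinarith [hCx0 r]
      calc ‖Λ‖ ≤ Real.exp (-(C * h)) := hbig.le
        _ ≤ Real.exp (-((6 * D₀ + 2) * h * Cx r)) * Real.exp (-((2 * D₀ + 1) * h)) := e1
        _ ≤ Real.exp (-((6 * D₀ + 2) * h * (S r).Cexp (S r).s₀)) * ‖(β r : ℂ)‖ :=
            mul_le_mul_of_nonneg_left hβr (Real.exp_pos _).le
    -- the relation (2)
    have hgood : (S r).Good (S r).s₀ := (S r).good_of_le le_rfl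
    have hN : D.Numerics (S r).s₀ := D.numerics_of_good hgood hΛ'small
    obtain ⟨b, hb0, hbL, hrel⟩ := D.exists_relation_of_numerics _ hN
    -- back to the original indexing
    let bt : Fin (m + 1) → ℤ := fun i => b (σ i)
    have hσσ : ∀ i, σ (σ i) = i := fun i => by simp [hσ, Equiv.swap_apply_self]
    have hrel' : ∑ i, (bt i : ℂ) * l i = 0 := by
      have h1 : ∑ i, (bt i : ℂ) * l i = ∑ i, (b i : ℂ) * (S r).l i := by
        rw [← Equiv.sum_comp σ (fun i => (bt i : ℂ) * l i)]
        refine Finset.sum_congr rfl fun i _ => ?_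
        show (b (σ (σ i)) : ℂ) * l (σ i) = (b i : ℂ) * l (σ i)
        rw [hσσ]
      rw [h1, hrel]
    have hbt0 : bt ≠ 0 := by
      intro h0; apply hb0; funext i
      have := congrFun h0 (σ i)
      simpa [bt, hσσ] using this
    have hbtL : ∀ i, (|bt i| : ℝ) ≤ Lr r := fun i => by
      have := hbL (σ i)
      show (|b (σ i)| : ℝ) ≤ ((S r).Lp (S r).s₀ : ℝ)
      exact_mod_cast this
    obtain ⟨r', hr'⟩ := Function.ne_iff.mp hbt0
    have hLexp : ∀ i, (|bt i| : ℝ) ≤ Real.exp ((S r).Lp (S r).s₀ : ℕ) := fun i =>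
      (hbtL i).trans (nat_le_exp _)
    -- the new coefficients (βⱼ'' = bᵣ' βⱼ - bⱼ βᵣ', kills the r'-th logarithm)
    set h'' : ℕ := 2 * (h + (S r).Lp (S r).s₀) + 1 with hh''
    let βc'' : K := (bt r' : K) * βc
    let β'' : Fin m → K := fun j => (bt r' : K) * β (r'.succAbove j) - (bt (r'.succAbove j) : K) * β r'
    have hβc'' : HB K h'' βc'' := (hβc.intMul (hLexp r')).mono (by omega)
    have hβ'' : ∀ j, HB K h'' (β'' j) := fun j => HB.sub ((hβ _).intMul (hLexp r')) ((hβ r').intMul (hLexp _))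
    -- the identity Λ'' = b_{r'} Λ
    have hid : ((βc'' : K) : ℂ) + ∑ j, ((β'' j : K) : ℂ) * (l ∘ r'.succAbove) j = (bt r' : ℂ) * Λ := by
      show (((bt r' : K) * βc : K) : ℂ) +
        ∑ j, ((((bt r' : K) * β (r'.succAbove j) - (bt (r'.succAbove j) : K) * β r' : K)) : ℂ) * l (r'.succAbove j) = _
      push_cast
      have hg : ∑ i, ((bt r' : ℂ) * (β i : ℂ) - (bt i : ℂ) * (β r' : ℂ)) * l i = (bt r' : ℂ) * ∑ i, (β i : ℂ) * l i := by
        have h1 : ∑ i, ((bt r' : ℂ) * (β i : ℂ) - (bt i : ℂ) * (β r' : ℂ)) * l i =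
            (bt r' : ℂ) * ∑ i, (β i : ℂ) * l i - (β r' : ℂ) * ∑ i, (bt i : ℂ) * l i := by
          rw [Finset.mul_sum, Finset.mul_sum, ← Finset.sum_sub_distrib]
          exact Finset.sum_congr rfl fun i _ => by ring
        rw [h1, hrel', mul_zero, sub_zero]
      have hsplit := Fin.sum_univ_succAbove (fun i => ((bt r' : ℂ) * (β i : ℂ) - (bt i : ℂ) * (β r' : ℂ)) * l i) r'
      simp only [sub_self, zero_mul, zero_add] at hsplit
      rw [hΛ]
      linear_combination hg - hsplit
    -- apply the inductive hypothesis
    have hα' : ∀ j, cexp ((l ∘ r'.succAbove) j) ∈ K := fun j => hα _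
    have h''1 : 1 ≤ h'' := by omega
    rcases (hLB r').out K hD hα' h'' h''1 βc'' β'' hβc'' hβ'' with hzero | hlb
    · left
      rw [hid] at hzero
      have : Λ = 0 := (mul_eq_zero.mp hzero).resolve_left (by exact_mod_cast hr')
      rw [hΛ] at this; exact this
    · right
      rw [hid, norm_mul, Complex.norm_intCast] at hlb
      have hLr1 : 1 ≤ Lr r := by
        show (1 : ℝ) ≤ ((S r).Lp (S r).s₀ : ℝ)
        exact_mod_cast (S r).one_le_Lp (by have := hgood.three_le; omega)
      have hLrpos : 0 < Lr r := by linarith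
      have e1 : Real.exp (-(Cih r' * h'')) ≤ Lr r * ‖Λ‖ :=
        hlb.trans (mul_le_mul_of_nonneg_right (hbtL r') (norm_nonneg _))
      have e2 : Real.exp (-(C * h)) * Lr r ≤ Real.exp (-(Cih r' * h'')) := by
        have hh''r : (h'' : ℝ) = 2 * (h + Lr r) + 1 := by rw [hh'']; push_cast; ring
        calc Real.exp (-(C * h)) * Lr r ≤ Real.exp (-(C * h)) * Real.exp (Lr r) :=
              mul_le_mul_of_nonneg_left (nat_le_exp _) (Real.exp_pos _).le
          _ = Real.exp (-(C * h) + Lr r) := by rw [Real.exp_add]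
          _ ≤ Real.exp (-(Cih r' * h'')) := by
              refine Real.exp_le_exp.mpr ?_
              rw [hh''r]
              have := mul_le_mul_of_nonneg_right (hCrr r r') hh0
              have p1 : 0 ≤ Cih r' * Lr r * (h - 1) := mul_nonneg (mul_nonneg (hCih r').le (hLr0 r)) (by linarith)
              have p2 : 0 ≤ Cih r' * (h - 1) := mul_nonneg (hCih r').le (by linarith)
              have p3 : 0 ≤ Lr r * (h - 1) := mul_nonneg (hLr0 r) (by linarith)
              nlinarith
      have e3 : Real.exp (-(C * h)) * Lr r ≤ ‖Λ‖ * Lr r := by rw [mul_comm ‖Λ‖]; exact e2.trans e1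
      have := le_of_mul_le_mul_right e3 hLrpos
      rw [hΛ] at this; exact this

end Literature.NumberTheory.Transcendental.Baker1975.Ch3

/-! ### The public statement -/

namespace Literature.NumberTheory.Transcendental

open Baker1975.Ch3 in
/-- **Baker 1975, Ch. 3, Theorem 3.1** — discharge of the named fact `baker1975_thm_3_1`.
[cite: BakerTNT1975, Ch. 3 Thm 3.1 (PDF p. 27)] -/
theorem baker1975_thm_3_1_holds : baker1975_thm_3_1 := by
  intro n d A α l hα0 hexp hwit
  classical
  -- the non-zero logarithms
  let I := {i : Fin n // l i ≠ 0}
  let m := Fintype.card I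
  let e : Fin m ≃ I := (Fintype.equivFin I).symm
  let l' : Fin m → ℂ := fun j => l (e j)
  have hl' : ∀ j, l' j ≠ 0 := fun j => (e j).2
  have hmapalg : ∀ (P : ℤ[X]) (z : ℂ), P ≠ 0 → aeval z P = 0 →
      (P.map (Int.castRingHom ℚ) ≠ 0 ∧ aeval z (P.map (Int.castRingHom ℚ)) = 0) := fun P z hP hz => by
    refine ⟨(Polynomial.map_ne_zero_iff (Int.castRingHom ℚ).injective_int).mpr hP, ?_⟩
    rw [show Int.castRingHom ℚ = algebraMap ℤ ℚ from rfl, Polynomial.aeval_map_algebraMap]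
    exact hz
  have halg' : ∀ j, IsAlgebraic ℚ (cexp (l' j)) := fun j => by
    obtain ⟨P, hP0, -, -, hP⟩ := hwit (e j)
    rw [show cexp (l' j) = α (e j) from hexp _]
    obtain ⟨h1, h2⟩ := hmapalg P _ hP0 hP
    exact ⟨_, h1, h2⟩
  set D₀ := d ^ (n + (n + 1)) with hD₀
  obtain ⟨C, hC0, hLB⟩ := Baker1975.Ch3.exists_LB m l' hl' halg' D₀
  refine ⟨4 * C + 1, by positivity, ?_⟩
  intro B hB β hβwit
  -- the field K = ℚ(α, β)
  choose P hP0 hPdeg hPcoef hProot using hwit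
  choose Q hQ0 hQdeg hQcoef hQroot using hβwit
  let ι := Fin n ⊕ Fin (n + 1)
  let x : ι → ℂ := Sum.elim α β
  let W : ι → ℚ[X] := Sum.elim (fun i => (P i).map (Int.castRingHom ℚ)) (fun j => (Q j).map (Int.castRingHom ℚ))
  have hW : ∀ i, W i ≠ 0 ∧ aeval (x i) (W i) = 0 ∧ (W i).natDegree ≤ d := by
    intro i; cases i with
    | inl i =>
      obtain ⟨h1, h2⟩ := hmapalg (P i) (α i) (hP0 i) (hProot i)
      exact ⟨h1, h2, by
        show ((P i).map (Int.castRingHom ℚ)).natDegree ≤ d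
        rw [natDegree_map_eq_of_injective (Int.castRingHom ℚ).injective_int]; exact hPdeg i⟩
    | inr j =>
      obtain ⟨h1, h2⟩ := hmapalg (Q j) (β j) (hQ0 j) (hQroot j)
      exact ⟨h1, h2, by
        show ((Q j).map (Int.castRingHom ℚ)).natDegree ≤ d
        rw [natDegree_map_eq_of_injective (Int.castRingHom ℚ).injective_int]; exact hQdeg j⟩
  let K : IntermediateField ℚ ℂ := IntermediateField.adjoin ℚ (x '' (↑(Finset.univ : Finset ι)))
  have hint : ∀ y ∈ x '' (↑(Finset.univ : Finset ι)), IsIntegral ℚ y := by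
    rintro y ⟨i, -, rfl⟩
    exact (show IsAlgebraic ℚ (x i) from ⟨W i, (hW i).1, (hW i).2.1⟩).isIntegral
  haveI : FiniteDimensional ℚ K := IntermediateField.finiteDimensional_adjoin hint
  have hKdeg : Module.finrank ℚ K ≤ D₀ := by
    refine (finrank_adjoin_le_prod_natDegree (F := ℚ) Finset.univ x W (fun i _ => (hW i).1) (fun i _ => (hW i).2.1)).trans ?_
    calc ∏ i, (W i).natDegree ≤ d ^ (Finset.univ : Finset ι).card := Finset.prod_le_pow_card _ _ _ fun i _ => (hW i).2.2
      _ = D₀ := by rw [hD₀, Finset.card_univ]; simp [ι, Fintype.card_sum, Fintype.card_fin]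
  have hmem : ∀ i, x i ∈ K := fun i =>
    IntermediateField.subset_adjoin _ _ (Set.mem_image_of_mem _ (Finset.mem_coe.mpr (Finset.mem_univ i)))
  -- the size parameter h
  have hB1 : (1 : ℝ) ≤ B := by exact_mod_cast (show 1 ≤ B by omega)
  have hB2 : (2 : ℝ) ≤ B := by exact_mod_cast hB
  have hBpos : (0 : ℝ) < B := by linarith
  have hlogB : Real.log 2 ≤ Real.log B := Real.log_le_log (by norm_num) hB2
  have hlog2 := Real.log_two_gt_d9
  set h : ℕ := ⌊Real.log B⌋₊ + 2 with hh
  have hhle : (h : ℝ) ≤ Real.log B + 2 := by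
    rw [hh]; push_cast; have := Nat.floor_le (Real.log_nonneg hB1); linarith
  have hexph : (B : ℝ) + 1 ≤ Real.exp h := by
    have h1 : Real.log B + 1 ≤ (h : ℝ) := by
      rw [hh]; push_cast; have := Nat.lt_floor_add_one (Real.log B); linarith
    calc (B : ℝ) + 1 ≤ 2 * B := by linarith
      _ ≤ Real.exp 1 * B := mul_le_mul_of_nonneg_right two_le_exp_one hBpos.le
      _ = Real.exp (Real.log B + 1) := by rw [Real.exp_add, Real.exp_log hBpos]; ring
      _ ≤ Real.exp h := Real.exp_le_exp.mpr h1
  have hh1 : 1 ≤ h := by omega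
  -- the coefficients in K and the lower bound
  let βK : Fin (n + 1) → K := fun j => ⟨β j, hmem (Sum.inr j)⟩
  have hHB : ∀ j, HB K h (βK j) := fun j => HB.of_witness (βK j) (hQ0 j) (hQcoef j) (hQroot j) hexph
  have hαK : ∀ j, cexp (l' j) ∈ K := fun j => by
    rw [show cexp (l' j) = α (e j) from hexp _]; exact hmem (Sum.inl _)
  -- the linear form, re-indexed
  have hform : β 0 + ∑ i : Fin n, β i.succ * l i =
      ((βK 0 : K) : ℂ) + ∑ j : Fin m, ((βK (Fin.succ (e j).1) : K) : ℂ) * l' j := by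
    have h1 : ∑ i : Fin n, β i.succ * l i = ∑ i ∈ Finset.univ.filter (fun i => l i ≠ 0), β i.succ * l i := by
      rw [Finset.sum_filter_of_ne]
      intro i _ hne hli
      exact hne (by rw [hli, mul_zero])
    have h2 : ∑ i ∈ Finset.univ.filter (fun i => l i ≠ 0), β i.succ * l i = ∑ i : I, β i.1.succ * l i.1 :=
      Finset.sum_subtype _ (by simp) (fun i => β i.succ * l i)
    have h3 : ∑ i : I, β i.1.succ * l i.1 = ∑ j : Fin m, β (e j).1.succ * l (e j).1 :=
      (Equiv.sum_comp e (fun i : I => β i.1.succ * l i.1)).symm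
    rw [h1, h2, h3]
  rcases hLB.out K hKdeg hαK h hh1 (βK 0) (fun j => βK (Fin.succ (e j).1)) (hHB 0) (fun j => hHB _) with hzero | hlb
  · left; rw [hform]; exact hzero
  · right
    rw [← hform] at hlb
    refine lt_of_lt_of_le ?_ hlb
    rw [Real.rpow_def_of_pos hBpos]
    refine Real.exp_lt_exp.mpr ?_
    -- log B · (-(4C+1)) < -(C h) since h ≤ log B + 2 < 4 log B
    have h4 : (h : ℝ) < 4 * Real.log B := by linarith
    nlinarith [mul_pos hC0 (by linarith : (0 : ℝ) < Real.log B)]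

end Literature.NumberTheory.Transcendental
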